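import Summits.HodgeConjecture.HodgeConjecture.Cruxes.BlochSeedDiscOne.BnCCert

/-!
# BnCCertCover (dual g12) — Δ2 of the node CIL landing path: the two COVER-INTEGRALITY leaf-row kinds («shape multiset τ BANNED on a side»,
«τ PRESENT ⇒ mass row + cover row») and the branching node «τ absent ∨ τ present» for the branch-and-cut certificate checker `BnCCert`
(FORMAT v1, v7 `ac9f7f6247e5`), extending its tree cover `BnCCertTree` (Δ1, `32094e0efd85`) — an ADD-ON module: v7 is imported byte-unchanged; Δ1's
partial-assignment helpers (`setAt`, `agrees_setAt`, `matchesB_of_agrees`, 60 lines) are restated in §0 so that this file depends on v7 ALONE (the farm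
builds crux workfiles lazily; a two-deep workfile import chain does not elaborate there).

unit `plan-lens-HodgeAV-dual-g12` (agent `planner-plan-lens-HodgeAV-dual-g12-0`); token `line stmt-HodgeConjecture-18881
Cruxes/BlochSeedDiscOne/Lines/birth.lean 814a6a70c14e831a stub_rung_pad4_seedAt`.  ORDERED by director-hodge R19.526 (2c) ∕ R19.527 («Δ2 = the two CIBB
leaf-row kinds in `BnCCert` ∕ `BnCCertTree` terms + the branching node, pen ∕ Lean only, so that a FLOOR-GRADE CIBB tree can be replayed»).

HONEST FRAMING.  Nothing in this file is proved toward HC ∕ HC_CM ∕ HC_AV ∕ №4 ∕ 26512 ∕ 18881 ∕ H2, and nothing toward the node target `FloorFree 6 199 8`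
either: this is CHECKER SOUNDNESS for a richer certificate format.  No certificate for the node exists (lifted m = 0 in every instrument of record); the
smoke tests of §10 use FAKE leaves (caps ∕ literal patterns only — no LP content).  pen ∕ Lean, kit = 0.

## WHAT THE TWO ROW KINDS ARE (gs-eng-2 `classbb/cibb.py`, strengthen's `CoverIntegrality.lean` v2.2 `73ca8273f3aed60a` §§3–4, joint memo COVER-INTEGRALITY-JOINT v1.1)

The exact class LP of a node has one column per shape-type MULTISET on each side.  Cover-integrality branching (CIBB) adds, at a search node, LITERALS
on multisets: `(sd, τ)` BANNED (no supported cell of side `sd` has shape multiset `τ`: the column is deleted — in the kernel: the type drops out of the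
pointwise check) or `(sd, τ)` PRESENT, which justifies two ROWS with dual prices `Z, W ≥ 0`:
* MASS ROW `Σ_{t ~ τ} m_sd(t) ≥ 1` (some supported cell of side `sd` has multiset `τ`, and supported cells have multiplicity `≥ 1`);
* COVER ROW `Σ_{t' matched-below ∕ above τ} m_{sd'}(t') ≥ 1` on the OTHER side: by (A4) the present cell has a live partner, slot by slot amply above
  (τ on P) ∕ below (τ on N), and `BnCCert.belowB_of_ample` turns each slot into the Boolean shape relation `belowB`; so the partner's type `t'` satisfies
  `covUp τ t'` ∕ `covDown τ t'` := «under one of the 24 slot bijections, `belowB` holds slotwise» — literally `cibb.py`'s `matched_below` and the memo's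
  multiset shadow `⊲_S` (strengthen's `MultisetBelow` ∕ `multisetShadowRows_of_A4fun` ∕ `shadow_branch` are the cell-level twins; this file re-proves the
  `STuple`-level form it needs from `Design.A4` + `belowB_of_ample`, importing nothing new).
The branch is the excluded middle `Present D sd τ ∨ ¬ Present D sd τ` (`CTreeC.disj`): the ABSENT child inherits the ban, the PRESENT child the two rows.
REPLAY COMPATIBILITY: an instrument whose cover relation is `matched_below` over the shape-level `BELOW` of `classbb/shapes.py` (= `belowB`) replays
literally; an instrument using a FINER cover relation cannot be replayed by this module (its cover rows would be unsound here) — say so before building one.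

## FORMAT «v1 + L1» (JSON ↔ Lean; the converter `s4leaf2bnc.py` of g11 extends field-for-field)

* certificate `CertC = {h, B, rmin, vars, leaves : List LeafC}`; `LeafC = {base : BnCCert.Leaf (v1 leaf, unchanged: recs∕derived∕func∕L∕ρ∕laws),
  bans : List (Side × STuple), pres : List Pres}`, `Pres = {side, τ : STuple, Z : ℤ, W : ℤ}` — JSON `"bans": [[side, [s₀,s₁,s₂,s₃]], …]`,
  `"pres": [{"side": side, "tau": [s₀,s₁,s₂,s₃], "Z": z, "W": w}, …]`, a shape `s = [a, p, q]`, `side ∈ {"N","P"}`; a literal's tuple is ANY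
  representative of the multiset (semantics are permutation-invariant) but the SAME representative must be used in the tree and in the leaf (the tree ↔ leaf
  literal comparison `memLit` is syntactic).
* tree `CTreeC = leaf i | node q [5 kids] | disj sd τ absent present` — JSON `{"leaf": i} | {"stat": q, "kids": [...5]} | {"disj": [side, tau],
  "absent": T, "present": T}`; checked with fuel `≥` depth.
* leaf inequality (dual feasibility), for every admissible NON-BANNED type `t` of side `sd` (class functional: sorted types; cell functional: cells):
  `sgn(sd)·G(t) + Σ_i Y_i·[count_i t = K_i] + Σ_{r ∈ pres} (Z_r·[r.side = sd ∧ t ~ r.τ] + W_r·[cover hit]) ≤ L ∓ ρ`, and the closing inequality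
  `L·B < Σ_i Y_i·thr_i + ρ·rmin + Σ_r (Z_r + W_r)`.  A closed CIBB leaf (LP infeasible, or bound `> B`) with its exact duals (γ on the six agreement rows ↦
  `func`, Y on attained rows, ρ on rank, Z ∕ W on the mass ∕ cover rows of the present literals, L on copies) is exactly one such leaf.
* WHOLE-NODE theorem `floorFree_of_validTC : validTC C t fuel = true → FloorFreeH C.h C.B C.rmin`; PER-REGION theorem `regionEmpty_of_validRC` (a disj ∕ stat
  tree over ONE cap region, e.g. T13 row 1, refutes every admissible (A1)∧(A4) design of that region with `copies ≤ B`, `rank ≥ rmin`) — the honest Lean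
  shape of «FLOOR-GRADE on one region»; it is NOT `FloorFree`.

## CONTENTS
§1 slot permutations and the multiset predicates `sameM` ∕ `covUp` ∕ `covDown` · §2 their invariance under slot swaps (closure of the 24-list, `decide`) ·
§3 literal semantics `Present` ∕ `Banned` and the (A4) cover lemmas · §4 presence records and pays · §5 the leaf and its check · §6 soundness of the pointwise
check (sorted enumeration, as v7 (E1b)) · §7 `leafC_sound` (v7's leaf Farkas (S5) with the two row kinds) · §8 the tree with `disj` and its soundness ·
§9 end-to-end theorems · §10 smoke tests (FAKE leaves).
-/

set_option linter.dupNamespace false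
set_option autoImplicit false

namespace Summit.HodgeConjecture.HodgeConjecture.Cruxes.BlochSeedDiscOne.BnCCertCover

open Summit.HodgeConjecture.HodgeConjecture.Cruxes.BlochSeedDiscOne.DepthBoundA4
open Summit.HodgeConjecture.HodgeConjecture.Cruxes.BlochSeedDiscOne.RingFiveEmpty
open Summit.HodgeConjecture.HodgeConjecture.Cruxes.BlochSeedDiscOne.BnCCert

/-! ## §0 Partial assignments (restated verbatim from `BnCCertTree` §§1–2, so that this module imports v7 only) -/

/-- assign value `k` to variable `q` of a partial assignment (out of range: unchanged) -/
def setAt : List (Option ℕ) → ℕ → ℕ → List (Option ℕ)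
  | [], _, _ => []
  | _ :: l, 0, k => some k :: l
  | a :: l, q + 1, k => a :: setAt l q k

@[simp] theorem length_setAt : ∀ (l : List (Option ℕ)) (q k : ℕ), (setAt l q k).length = l.length
  | [], _, _ => rfl
  | _ :: _, 0, _ => rfl
  | a :: l, q + 1, k => by simp [setAt, length_setAt l q k]

theorem getElem?_setAt_self : ∀ (l : List (Option ℕ)) (q k : ℕ), q < l.length → (setAt l q k)[q]? = some (some k)
  | [], q, k, h => by simp at h
  | _ :: l, 0, k, _ => by simp [setAt]
  | a :: l, q + 1, k, h => by
      simp only [setAt, List.getElem?_cons_succ]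
      exact getElem?_setAt_self l q k (by simpa using h)

theorem getElem?_setAt_ne : ∀ (l : List (Option ℕ)) (q k i : ℕ), i ≠ q → (setAt l q k)[i]? = l[i]?
  | [], _, _, _, _ => by simp [setAt]
  | _ :: l, 0, k, i, h => by
      cases i with
      | zero => exact absurd rfl h
      | succ i => simp [setAt]
  | a :: l, q + 1, k, i, h => by
      cases i with
      | zero => simp [setAt]
      | succ i =>
          simp only [setAt, List.getElem?_cons_succ]
          exact getElem?_setAt_ne l q k i (fun e => h (by omega))

/-- a partial assignment `asg` AGREES with a value vector `ks` when `asg.length = ks.length ∧ ∀ i k, asg[i]? = some (some k) → ks[i]? = some k` (spelled out) -/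
theorem agrees_setAt {asg : List (Option ℕ)} {ks : List ℕ}
    (h : (asg.length = ks.length ∧ ∀ j m : ℕ, asg[j]? = some (some m) → ks[j]? = some m)) {q k : ℕ} (hk : ks[q]? = some k) :
    ((setAt asg q k).length = ks.length ∧ ∀ j m : ℕ, (setAt asg q k)[j]? = some (some m) → ks[j]? = some m) := by
  refine ⟨by rw [length_setAt]; exact h.1, fun i k' hi => ?_⟩
  by_cases hiq : i = q
  · subst hiq
    have hq : i < asg.length := by
      rw [h.1]
      by_contra hc
      rw [List.getElem?_eq_none_iff.mpr (Nat.le_of_not_lt hc)] at hk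
      simp at hk
    rw [getElem?_setAt_self asg i k hq] at hi
    simp only [Option.some.injEq] at hi
    subst hi
    exact hk
  · rw [getElem?_setAt_ne asg q k i hiq] at hi
    exact h.2 i k' hi

theorem matchesB_of_agrees {caps : List (Option ℕ)} {ks : List ℕ}
    (h : (caps.length = ks.length ∧ ∀ j m : ℕ, caps[j]? = some (some m) → ks[j]? = some m)) : matchesB caps ks = true := by
  unfold matchesB
  refine List.all_eq_true.mpr fun ck hck => ?_
  obtain ⟨i, hi⟩ := List.mem_iff_getElem?.mp hck
  have hz := List.getElem?_zip_eq_some.mp hi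
  obtain ⟨c, k⟩ := ck
  cases c with
  | none => simp
  | some c =>
      have hks := h.2 i c hz.1
      rw [hz.2] at hks
      simp only [Option.some.injEq] at hks
      subst hks
      simp

/-! ## §1 Slot permutations and multiset predicates -/

/-- the 24 slot bijections, as an explicit list (kernel-evaluable) -/
def perms4 : List (Fin 4 → Fin 4) :=
  [![0, 1, 2, 3], ![0, 1, 3, 2], ![0, 2, 1, 3], ![0, 2, 3, 1], ![0, 3, 1, 2], ![0, 3, 2, 1],
   ![1, 0, 2, 3], ![1, 0, 3, 2], ![1, 2, 0, 3], ![1, 2, 3, 0], ![1, 3, 0, 2], ![1, 3, 2, 0],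
   ![2, 0, 1, 3], ![2, 0, 3, 1], ![2, 1, 0, 3], ![2, 1, 3, 0], ![2, 3, 0, 1], ![2, 3, 1, 0],
   ![3, 0, 1, 2], ![3, 0, 2, 1], ![3, 1, 0, 2], ![3, 1, 2, 0], ![3, 2, 0, 1], ![3, 2, 1, 0]]

/-- conjunction over the four slots -/
def all4 (b : Fin 4 → Bool) : Bool := b 0 && b 1 && b 2 && b 3

theorem all4_iff (b : Fin 4 → Bool) : all4 b = true ↔ ∀ f : Fin 4, b f = true := by
  simp only [all4, Bool.and_eq_true]
  constructor
  · rintro ⟨⟨⟨h0, h1⟩, h2⟩, h3⟩ f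
    fin_cases f
    · exact h0
    · exact h1
    · exact h2
    · exact h3
  · intro h
    exact ⟨⟨⟨h 0, h 1⟩, h 2⟩, h 3⟩

/-- «under some slot bijection `p`, `R (τ (p f)) (t f)` holds in every slot» -/
def anyRel (R : Shape → Shape → Bool) (τ t : STuple) : Bool := perms4.any fun p => all4 fun f => R (τ (p f)) (t f)

/-- `t` is a slot permutation of `τ`: SAME MULTISET of shapes -/
def sameM (τ t : STuple) : Bool := anyRel (fun a b => decide (a = b)) τ t

/-- `t` lies slotwise `belowB`-ABOVE a permutation of `τ` (the cover set of a P-literal `τ` consists of N-types `t` with `covUp τ t`) -/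
def covUp (τ t : STuple) : Bool := anyRel belowB τ t

/-- `t` lies slotwise `belowB`-BELOW a permutation of `π` (the cover set of an N-literal `π` consists of P-types `t` with `covDown π t`) -/
def covDown (π t : STuple) : Bool := anyRel (fun a b => belowB b a) π t

/-- syntactic equality of shape tuples (slot by slot) -/
def eqT (a b : STuple) : Bool := decide (a 0 = b 0) && decide (a 1 = b 1) && decide (a 2 = b 2) && decide (a 3 = b 3)

theorem eqT_eq {a b : STuple} (h : eqT a b = true) : a = b := by
  simp only [eqT, Bool.and_eq_true, decide_eq_true_eq] at h
  obtain ⟨⟨⟨h0, h1⟩, h2⟩, h3⟩ := h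
  funext f
  fin_cases f
  · exact h0
  · exact h1
  · exact h2
  · exact h3

/-! ## §2 Invariance of the multiset predicates under slot swaps of the tested type -/

def sw01 : Fin 4 → Fin 4 := ![1, 0, 2, 3]
def sw12 : Fin 4 → Fin 4 := ![0, 2, 1, 3]
def sw23 : Fin 4 → Fin 4 := ![0, 1, 3, 2]

theorem sw01_invol : ∀ f : Fin 4, sw01 (sw01 f) = f := by decide
theorem sw12_invol : ∀ f : Fin 4, sw12 (sw12 f) = f := by decide
theorem sw23_invol : ∀ f : Fin 4, sw23 (sw23 f) = f := by decide

/-- the 24-list is closed under right composition with each adjacent swap (kernel `decide`: the elaborator's instance evaluation is too deep) -/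
theorem perms4_closed01 : ∀ p ∈ perms4, ∃ q ∈ perms4, ∀ f : Fin 4, q f = p (sw01 f) := by decide +kernel
theorem perms4_closed12 : ∀ p ∈ perms4, ∃ q ∈ perms4, ∀ f : Fin 4, q f = p (sw12 f) := by decide +kernel
theorem perms4_closed23 : ∀ p ∈ perms4, ∃ q ∈ perms4, ∀ f : Fin 4, q f = p (sw23 f) := by decide +kernel

/-- `anyRel` is invariant under an involutive slot permutation of the tested type under which the 24-list is closed -/
theorem anyRel_comp (R : Shape → Shape → Bool) (τ t : STuple) (s : Fin 4 → Fin 4) (hs : ∀ f, s (s f) = f)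
    (hc : ∀ p ∈ perms4, ∃ q ∈ perms4, ∀ f : Fin 4, q f = p (s f)) :
    anyRel R τ (fun f => t (s f)) = anyRel R τ t := by
  rw [Bool.eq_iff_iff]
  simp only [anyRel, List.any_eq_true, all4_iff]
  constructor
  · rintro ⟨p, hp, hall⟩
    obtain ⟨q, hq, hqf⟩ := hc p hp
    refine ⟨q, hq, fun f => ?_⟩
    have h := hall (s f)
    rw [hs] at h
    rw [hqf]
    exact h
  · rintro ⟨p, hp, hall⟩
    obtain ⟨q, hq, hqf⟩ := hc p hp
    refine ⟨q, hq, fun f => ?_⟩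
    rw [hqf]
    exact hall (s f)

theorem vec_sw01 (x y z w : Shape) : (![y, x, z, w] : STuple) = fun f => (![x, y, z, w] : STuple) (sw01 f) := by
  funext f; fin_cases f <;> rfl
theorem vec_sw12 (x y z w : Shape) : (![x, z, y, w] : STuple) = fun f => (![x, y, z, w] : STuple) (sw12 f) := by
  funext f; fin_cases f <;> rfl
theorem vec_sw23 (x y z w : Shape) : (![x, y, w, z] : STuple) = fun f => (![x, y, z, w] : STuple) (sw23 f) := by
  funext f; fin_cases f <;> rfl

theorem anyRel_swap01 (R : Shape → Shape → Bool) (τ : STuple) (x y z w : Shape) :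
    anyRel R τ ![y, x, z, w] = anyRel R τ ![x, y, z, w] := by
  rw [vec_sw01 x y z w]; exact anyRel_comp R τ _ sw01 sw01_invol perms4_closed01
theorem anyRel_swap12 (R : Shape → Shape → Bool) (τ : STuple) (x y z w : Shape) :
    anyRel R τ ![x, z, y, w] = anyRel R τ ![x, y, z, w] := by
  rw [vec_sw12 x y z w]; exact anyRel_comp R τ _ sw12 sw12_invol perms4_closed12
theorem anyRel_swap23 (R : Shape → Shape → Bool) (τ : STuple) (x y z w : Shape) :
    anyRel R τ ![x, y, w, z] = anyRel R τ ![x, y, z, w] := by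
  rw [vec_sw23 x y z w]; exact anyRel_comp R τ _ sw23 sw23_invol perms4_closed23

/-! ## §3 Literal semantics and the (A4) cover lemmas -/

/-- the literal `(sd, τ)` is PRESENT on the design: some supported cell of side `sd` has shape multiset `τ` -/
def Present (D : Design) (sd : Side) (τ : STuple) : Prop := ∃ c ∈ suppSide D sd, sameM τ (typeOf c) = true

/-- the literal `(sd, τ)` is BANNED (absent) on the design -/
def Banned (D : Design) (sd : Side) (τ : STuple) : Prop := ∀ c ∈ suppSide D sd, sameM τ (typeOf c) = false

theorem banned_of_not_present {D : Design} {sd : Side} {τ : STuple} (h : ¬ Present D sd τ) : Banned D sd τ :=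
  fun c hc => Bool.eq_false_iff.mpr fun ht => h ⟨c, hc, ht⟩

theorem sameM_elim {τ t : STuple} (h : sameM τ t = true) : ∃ p ∈ perms4, ∀ f : Fin 4, τ (p f) = t f := by
  simp only [sameM, anyRel, List.any_eq_true, all4_iff, decide_eq_true_eq] at h
  exact h

/-- (A4) ⇒ COVER, upward: if `c` has multiset `τ` and `y` is live above `c`, the type of `y` is hit by `covUp τ` (slotwise `belowB_of_ample`) -/
theorem covUp_of_live {τ : STuple} {c y : Cell} (hτ : sameM τ (typeOf c) = true) (hl : Live c y) : covUp τ (typeOf y) = true := by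
  obtain ⟨p, hp, hpf⟩ := sameM_elim hτ
  simp only [covUp, anyRel, List.any_eq_true, all4_iff]
  exact ⟨p, hp, fun f => by rw [hpf f]; exact belowB_of_ample _ _ (hl f)⟩

/-- (A4) ⇒ COVER, downward: if `y` has multiset `π` and `y` is live above `x`, the type of `x` is hit by `covDown π` -/
theorem covDown_of_live {π : STuple} {x y : Cell} (hπ : sameM π (typeOf y) = true) (hl : Live x y) : covDown π (typeOf x) = true := by
  obtain ⟨p, hp, hpf⟩ := sameM_elim hπ
  simp only [covDown, anyRel, List.any_eq_true, all4_iff]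
  exact ⟨p, hp, fun f => by rw [hpf f]; exact belowB_of_ample _ _ (hl f)⟩

/-! ## §4 Presence records and their pays -/

/-- a PRESENT literal with its two dual prices: `Z` on the mass row of its own side, `W` on the cover row of the other side -/
structure Pres where
  side : Side
  τ : STuple
  Z : ℤ
  W : ℤ

/-- the mass row of `r` hits type `t` of side `sd` -/
def massHit (r : Pres) (sd : Side) (t : STuple) : Bool := decide (r.side = sd) && sameM r.τ t

/-- the cover row of `r` hits type `t` of side `sd` (the side opposite to the literal's) -/
def coverHit (r : Pres) (sd : Side) (t : STuple) : Bool :=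
  match r.side, sd with
  | Side.P, Side.N => covUp r.τ t
  | Side.N, Side.P => covDown r.τ t
  | _, _ => false

theorem indB_nonneg (b : Bool) : 0 ≤ indB b := by
  cases b <;> simp [indB]

/-- `Σ_{r ∈ pres} (Z_r·[mass hit] + W_r·[cover hit])` at type `t` of side `sd` -/
def presPay (pres : List Pres) (sd : Side) (t : STuple) : ℤ :=
  (pres.map fun r => r.Z * indB (massHit r sd t) + r.W * indB (coverHit r sd t)).sum

/-- some ban literal of side `sd` hits type `t` -/
def banHit (bans : List (Side × STuple)) (sd : Side) (t : STuple) : Bool :=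
  bans.any fun b => decide (b.1 = sd) && sameM b.2 t

theorem massHit_swap01 (r : Pres) (sd : Side) (x y z w : Shape) : massHit r sd ![y, x, z, w] = massHit r sd ![x, y, z, w] := by
  simp only [massHit, sameM, anyRel_swap01 _ _ x y z w]
theorem massHit_swap12 (r : Pres) (sd : Side) (x y z w : Shape) : massHit r sd ![x, z, y, w] = massHit r sd ![x, y, z, w] := by
  simp only [massHit, sameM, anyRel_swap12 _ _ x y z w]
theorem massHit_swap23 (r : Pres) (sd : Side) (x y z w : Shape) : massHit r sd ![x, y, w, z] = massHit r sd ![x, y, z, w] := by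
  simp only [massHit, sameM, anyRel_swap23 _ _ x y z w]

theorem coverHit_swap01 (r : Pres) (sd : Side) (x y z w : Shape) : coverHit r sd ![y, x, z, w] = coverHit r sd ![x, y, z, w] := by
  obtain ⟨rs, τ, Z, W⟩ := r
  cases rs <;> cases sd <;> simp [coverHit, covUp, covDown, anyRel_swap01 _ _ x y z w]
theorem coverHit_swap12 (r : Pres) (sd : Side) (x y z w : Shape) : coverHit r sd ![x, z, y, w] = coverHit r sd ![x, y, z, w] := by
  obtain ⟨rs, τ, Z, W⟩ := r
  cases rs <;> cases sd <;> simp [coverHit, covUp, covDown, anyRel_swap12 _ _ x y z w]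
theorem coverHit_swap23 (r : Pres) (sd : Side) (x y z w : Shape) : coverHit r sd ![x, y, w, z] = coverHit r sd ![x, y, z, w] := by
  obtain ⟨rs, τ, Z, W⟩ := r
  cases rs <;> cases sd <;> simp [coverHit, covUp, covDown, anyRel_swap23 _ _ x y z w]

theorem presPay_swap01 (pres : List Pres) (sd : Side) (x y z w : Shape) : presPay pres sd ![y, x, z, w] = presPay pres sd ![x, y, z, w] := by
  simp only [presPay, massHit_swap01 _ _ x y z w, coverHit_swap01 _ _ x y z w]
theorem presPay_swap12 (pres : List Pres) (sd : Side) (x y z w : Shape) : presPay pres sd ![x, z, y, w] = presPay pres sd ![x, y, z, w] := by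
  simp only [presPay, massHit_swap12 _ _ x y z w, coverHit_swap12 _ _ x y z w]
theorem presPay_swap23 (pres : List Pres) (sd : Side) (x y z w : Shape) : presPay pres sd ![x, y, w, z] = presPay pres sd ![x, y, z, w] := by
  simp only [presPay, massHit_swap23 _ _ x y z w, coverHit_swap23 _ _ x y z w]

theorem banHit_swap01 (bans : List (Side × STuple)) (sd : Side) (x y z w : Shape) : banHit bans sd ![y, x, z, w] = banHit bans sd ![x, y, z, w] := by
  simp only [banHit, sameM, anyRel_swap01 _ _ x y z w]
theorem banHit_swap12 (bans : List (Side × STuple)) (sd : Side) (x y z w : Shape) : banHit bans sd ![x, z, y, w] = banHit bans sd ![x, y, z, w] := by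
  simp only [banHit, sameM, anyRel_swap12 _ _ x y z w]
theorem banHit_swap23 (bans : List (Side × STuple)) (sd : Side) (x y z w : Shape) : banHit bans sd ![x, y, w, z] = banHit bans sd ![x, y, z, w] := by
  simp only [banHit, sameM, anyRel_swap23 _ _ x y z w]

/-- the mass row of a literal hits the type of a cell carrying its multiset -/
theorem massHit_self {r : Pres} {c : Cell} (h : sameM r.τ (typeOf c) = true) : massHit r r.side (typeOf c) = true := by
  simp [massHit, h]

/-- the cover row of a P-literal hits the live partner above -/
theorem coverHit_P {r : Pres} (hs : r.side = Side.P) {c y : Cell} (h : sameM r.τ (typeOf c) = true) (hl : Live c y) :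
    coverHit r Side.N (typeOf y) = true := by
  obtain ⟨rs, τ, Z, W⟩ := r
  simp only at hs
  subst hs
  simp only [coverHit]
  exact covUp_of_live h hl

/-- the cover row of an N-literal hits the live partner below -/
theorem coverHit_N {r : Pres} (hs : r.side = Side.N) {x y : Cell} (h : sameM r.τ (typeOf y) = true) (hl : Live x y) :
    coverHit r Side.P (typeOf x) = true := by
  obtain ⟨rs, τ, Z, W⟩ := r
  simp only at hs
  subst hs
  simp only [coverHit]
  exact covDown_of_live h hl

/-- a ban literal never hits a supported cell of a design on which all bans hold -/
theorem banHit_false_of_banned {D : Design} {bans : List (Side × STuple)} (hb : ∀ b ∈ bans, Banned D b.1 b.2)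
    {sd : Side} {c : Cell} (hc : c ∈ suppSide D sd) : banHit bans sd (typeOf c) = false := by
  rw [Bool.eq_false_iff]
  intro h
  simp only [banHit, List.any_eq_true, Bool.and_eq_true, decide_eq_true_eq] at h
  obtain ⟨b, hmem, hsd, hsame⟩ := h
  have hban := hb b hmem c (by rw [hsd]; exact hc)
  rw [hban] at hsame
  exact Bool.false_ne_true hsame

/-- exchange of `linZ` with the presence pays -/
theorem linZ_presPay (L' : List (Cell × ℕ)) (pres : List Pres) (sd : Side) :
    linZ L' (fun c => presPay pres sd (typeOf c)) =
      (pres.map fun r => r.Z * linZ L' (fun c => indB (massHit r sd (typeOf c))) + r.W * linZ L' (fun c => indB (coverHit r sd (typeOf c)))).sum := by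
  unfold presPay
  rw [linZ_sum_map L' pres (fun r c => r.Z * indB (massHit r sd (typeOf c)) + r.W * indB (coverHit r sd (typeOf c)))]
  congr 1
  refine List.map_congr_left fun r _ => ?_
  rw [linZ_add, linZ_smul, linZ_smul]

/-! ## §5 The leaf with literals and its check -/

/-- a «v1 + L1» leaf: a v1 leaf plus ban literals and present literals (with their mass ∕ cover prices) -/
structure LeafC where
  base : Leaf
  bans : List (Side × STuple)
  pres : List Pres

/-- a «v1 + L1» certificate -/
structure CertC where
  h : ℕ
  B : ℕ
  rmin : ℤ
  vars : List Var
  leaves : List LeafC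

/-- the underlying v1 certificate (same `h, B, rmin, vars`; base leaves) — used to cite v7's region ∕ bound ∕ parity machinery verbatim -/
def CertC.toB (C : CertC) : BnCCert := ⟨C.h, C.B, C.rmin, C.vars, C.leaves.map LeafC.base⟩

/-- the POINTWISE CHECK with literals on one side: banned types are skipped; present literals pay `presPay` -/
def checkPtC (h : ℕ) (bs : List Bound) (E : List (Var × VarRec)) (func : Func) (L ρ : ℤ) (bans : List (Side × STuple)) (pres : List Pres)
    (sd : Side) : Bool :=
  match func with
  | Func.cls γ => (admTypesSorted h bs sd).all fun t =>
      banHit bans sd t || decide (sd.sgn * Gtype γ t + coverPay E sd t + presPay pres sd t ≤ sd.bnd L ρ)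
  | Func.cell rows => (admCells h bs sd).all fun c =>
      banHit bans sd (typeOf c) || decide (sd.sgn * Gc rows c + coverPay E sd (typeOf c) + presPay pres sd (typeOf c) ≤ sd.bnd L ρ)

/-- the core conjuncts of the leaf check (v7's, plus `Z, W ≥ 0` and the closing inequality with the literal credits `Σ (Z + W)`) -/
def checkCoreC (C : CertC) (lf : LeafC) : Bool :=
  let E := ents C.vars lf.base
  let bs := allBounds C.vars lf.base
  decide (lf.base.recs.length = C.vars.length) &&
  checkDerivedAll C.h (primaryBounds E) lf.base.derived &&
  decide (0 ≤ lf.base.L) && decide (0 ≤ lf.base.ρ) &&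
  (E.all fun e => decide (0 ≤ e.2.Y) && thrOK C.h bs lf.base.laws e) &&
  funcOK lf.base.func &&
  (lf.pres.all fun r => decide (0 ≤ r.Z) && decide (0 ≤ r.W)) &&
  decide (lf.base.L * (C.B : ℤ) < (E.map fun e => e.2.Y * (e.2.thr : ℤ)).sum + lf.base.ρ * C.rmin + (lf.pres.map fun r => r.Z + r.W).sum)

/-- **leaf check** («v1 + L1») -/
def checkLeafC (C : CertC) (lf : LeafC) : Bool :=
  checkCoreC C lf &&
  checkPtC C.h (allBounds C.vars lf.base) (ents C.vars lf.base) lf.base.func lf.base.L lf.base.ρ lf.bans lf.pres Side.N &&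
  checkPtC C.h (allBounds C.vars lf.base) (ents C.vars lf.base) lf.base.func lf.base.L lf.base.ρ lf.bans lf.pres Side.P

theorem hder_of_checkLeafC {C : CertC} {lf : LeafC} (h : checkLeafC C lf = true) :
    checkDerivedAll C.h (primaryBounds (ents C.vars lf.base)) lf.base.derived = true := by
  simp only [checkLeafC, checkCoreC, Bool.and_eq_true, decide_eq_true_eq] at h
  obtain ⟨⟨⟨⟨⟨⟨⟨⟨⟨_, hder⟩, _⟩, _⟩, _⟩, _⟩, _⟩, _⟩, _⟩, _⟩ := h
  exact hder

/-! ## §6 Soundness of the pointwise check (sorted enumeration transported by the swap lemmas, as v7 (E1b)) -/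

/-- the class-leaf pointwise predicate with literals on an explicit type -/
def CovPt (h : ℕ) (bs : List Bound) (E : List (Var × VarRec)) (γ : Coefs) (L ρ : ℤ) (bans : List (Side × STuple)) (pres : List Pres)
    (sd : Side) (x y z w : Shape) : Prop :=
  admType h bs sd ![x, y, z, w] = true → banHit bans sd ![x, y, z, w] = false →
    sd.sgn * Gtype γ ![x, y, z, w] + coverPay E sd ![x, y, z, w] + presPay pres sd ![x, y, z, w] ≤ sd.bnd L ρ

theorem covPt_all {h : ℕ} {bs : List Bound} {E : List (Var × VarRec)} {γ : Coefs} {L ρ : ℤ} {bans : List (Side × STuple)}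
    {pres : List Pres} {sd : Side}
    (hchk : ∀ t ∈ admTypesSorted h bs sd,
      banHit bans sd t = true ∨ sd.sgn * Gtype γ t + coverPay E sd t + presPay pres sd t ≤ sd.bnd L ρ) :
    ∀ x y z w, CovPt h bs E γ L ρ bans pres sd x y z w := by
  refine forall_of_sorted4 (rankOf (adm0 h sd)) (CovPt h bs E γ L ρ bans pres sd) ?_ ?_ ?_ ?_
  · intro x y z w hP ha hb
    rw [banHit_swap01] at hb
    have := hP (admType_swap01 h bs sd x y z w ha) hb
    rw [← Gtype_swap01, ← coverPay_swap01, ← presPay_swap01] at this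
    exact this
  · intro x y z w hP ha hb
    rw [banHit_swap12] at hb
    have := hP (admType_swap12 h bs sd x y z w ha) hb
    rw [← Gtype_swap12, ← coverPay_swap12, ← presPay_swap12] at this
    exact this
  · intro x y z w hP ha hb
    rw [banHit_swap23] at hb
    have := hP (admType_swap23 h bs sd x y z w ha) hb
    rw [← Gtype_swap23, ← coverPay_swap23, ← presPay_swap23] at this
    exact this
  · intro x y z w h1 h2 h3 ha hb
    have hx : (adm0 h sd).elem x = true := by simpa using admType_static ha 0
    have hy : (adm0 h sd).elem y = true := by simpa using admType_static ha 1
    have hz : (adm0 h sd).elem z = true := by simpa using admType_static ha 2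
    have hw : (adm0 h sd).elem w = true := by simpa using admType_static ha 3
    rcases hchk _ (List.mem_filter.mpr ⟨mem_stuples _ x y z w (List.mem_of_elem_eq_true hx) (List.mem_of_elem_eq_true hy)
      (List.mem_of_elem_eq_true hz) (List.mem_of_elem_eq_true hw) h1 h2 h3, ha⟩) with hban | hle
    · rw [hb] at hban
      exact absurd hban Bool.false_ne_true
    · exact hle

/-- the pointwise check with literals is sound on every supported, non-banned cell of an admissible type -/
theorem checkPtC_sound {h : ℕ} {bs : List Bound} {E : List (Var × VarRec)} {func : Func} {L ρ : ℤ} {bans : List (Side × STuple)}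
    {pres : List Pres} {sd : Side} (hchk : checkPtC h bs E func L ρ bans pres sd = true) (c : Cell)
    (hadm : admType h bs sd (typeOf c) = true) (hnb : banHit bans sd (typeOf c) = false) :
    sd.sgn * Fval func c + coverPay E sd (typeOf c) + presPay pres sd (typeOf c) ≤ sd.bnd L ρ := by
  cases func with
  | cls γ =>
    simp only [checkPtC, List.all_eq_true, Bool.or_eq_true, decide_eq_true_eq] at hchk
    have ht : (![typeOf c 0, typeOf c 1, typeOf c 2, typeOf c 3] : STuple) = typeOf c := by
      funext f; fin_cases f <;> rfl
    have := covPt_all hchk (typeOf c 0) (typeOf c 1) (typeOf c 2) (typeOf c 3)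
    rw [CovPt, ht] at this
    simp only [Fval, Gcell_eq_Gtype]
    exact this hadm hnb
  | cell rows =>
    simp only [checkPtC, List.all_eq_true, Bool.or_eq_true, decide_eq_true_eq] at hchk
    rcases hchk c (mem_admCells hadm) with hban | hle
    · rw [hnb] at hban
      exact absurd hban Bool.false_ne_true
    · exact hle

/-! ## §7 The leaf Farkas with literals -/

/-- **LEAF FARKAS («v1 + L1») — PROVED.**  In the region of a checked leaf, on which its bans hold and its present literals are present, no (A1)∧(A4) design
with both sides non-empty, `copies ≤ B`, `rank ≥ rmin` exists: v7's chain `0 = Σ_N m·F − Σ_P m·F ≤ (L−ρ)·M_N + (L+ρ)·M_P − Σ_i Y_i·mass_i − Σ_r (Z_r·mass_r +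
W_r·cover_r) ≤ L·B − ρ·rmin − Σ_i Y_i·thr_i − Σ_r (Z_r + W_r) < 0`, the two new facts being `mass_r ≥ 1` (presence; supported multiplicities are `≥ 1`) and
`cover_r ≥ 1` ((A4) live partner + `belowB_of_ample`, §3). -/
theorem leafC_sound (C : CertC) (lf : LeafC) (hlf : checkLeafC C lf = true) (D : Design) (h1 : D.A1) (h4 : D.A4)
    (hB : D.copies ≤ C.B) (hr : C.rmin ≤ D.rank) (hN : D.suppN ≠ []) (hP : D.suppP ≠ [])
    (hreg : InRegion C.vars lf.base D)
    (hadm : ∀ sd : Side, ∀ c' ∈ suppSide D sd, admType C.h (allBounds C.vars lf.base) sd (typeOf c') = true)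
    (hbans : ∀ b ∈ lf.bans, Banned D b.1 b.2) (hpres : ∀ r ∈ lf.pres, Present D r.side r.τ)
    (hparity : ParityOK C.toB lf.base D) : False := by
  simp only [checkLeafC, Bool.and_eq_true] at hlf
  obtain ⟨⟨hcore, hNall⟩, hPall⟩ := hlf
  simp only [checkCoreC, Bool.and_eq_true, decide_eq_true_eq, List.all_eq_true] at hcore
  obtain ⟨⟨⟨⟨⟨⟨⟨_hlen, _hder⟩, hL⟩, hρ⟩, hYthr⟩, hfok⟩, hZW⟩, hclose⟩ := hcore
  -- masses, copies and rank in terms of `linZ`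
  have hMN0 : (0 : ℤ) ≤ ((D.N.map Prod.snd).sum : ℕ) := by positivity
  have hMP0 : (0 : ℤ) ≤ ((D.P.map Prod.snd).sum : ℕ) := by positivity
  have hcop : (((D.N.map Prod.snd).sum : ℕ) : ℤ) + ((D.P.map Prod.snd).sum : ℕ) ≤ C.B := by
    have : D.copies ≤ C.B := hB
    unfold Design.copies at this
    exact_mod_cast this
  have hrk : C.rmin ≤ (((D.N.map Prod.snd).sum : ℕ) : ℤ) - ((D.P.map Prod.snd).sum : ℕ) := by
    unfold Design.rank at hr
    exact hr
  -- (1) the balanced functional vanishes (A1)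
  have hvan := Fval_vanishes D h1 lf.base.func hfok
  -- (2) the pointwise inequalities (bans discharged by `banHit_false_of_banned`), summed against the masses
  have hpt : ∀ sd : Side, ∀ c' ∈ suppSide D sd,
      sd.sgn * Fval lf.base.func c' + coverPay (ents C.vars lf.base) sd (typeOf c') + presPay lf.pres sd (typeOf c')
        ≤ sd.bnd lf.base.L lf.base.ρ := by
    intro sd c' hc'
    have hnb := banHit_false_of_banned hbans hc'
    cases sd with
    | N => exact checkPtC_sound hNall c' (hadm Side.N c' hc') hnb
    | P => exact checkPtC_sound hPall c' (hadm Side.P c' hc') hnb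
  have hNsum : linZ D.N (fun c => Fval lf.base.func c + coverPay (ents C.vars lf.base) Side.N (typeOf c) + presPay lf.pres Side.N (typeOf c))
      ≤ (lf.base.L - lf.base.ρ) * ((D.N.map Prod.snd).sum : ℕ) := by
    refine linZ_le_mul_sum D.N _ _ fun cm hcm hpos => ?_
    have hsupp : cm.1 ∈ D.suppN := (mem_suppN_iff D cm.1).mpr ⟨cm.2, hcm, hpos⟩
    have hineq := hpt Side.N cm.1 hsupp
    simp only [Side.sgn, Side.bnd, one_mul] at hineq
    exact hineq
  have hPsum : linZ D.P (fun c => -Fval lf.base.func c + coverPay (ents C.vars lf.base) Side.P (typeOf c) + presPay lf.pres Side.P (typeOf c))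
      ≤ (lf.base.L + lf.base.ρ) * ((D.P.map Prod.snd).sum : ℕ) := by
    refine linZ_le_mul_sum D.P _ _ fun cm hcm hpos => ?_
    have hsupp : cm.1 ∈ D.suppP := (mem_suppP_iff D cm.1).mpr ⟨cm.2, hcm, hpos⟩
    have hineq := hpt Side.P cm.1 hsupp
    simp only [Side.sgn, Side.bnd, neg_mul, one_mul] at hineq
    exact hineq
  rw [linZ_add, linZ_add] at hNsum hPsum
  have hneg : linZ D.P (fun c => -Fval lf.base.func c) = -linZ D.P (Fval lf.base.func) := by
    have h := linZ_smul D.P (-1) (Fval lf.base.func)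
    simp only [neg_mul, one_mul] at h
    exact h
  rw [hneg] at hPsum
  -- (3) exchange of the payments: `Σ_c m·coverPay = Σ_i Y_i·mass_i`, `Σ_c m·presPay = Σ_r (Z_r·mass_r + W_r·cover_r)`
  have hpay : ∀ (L' : List (Cell × ℕ)) (sd : Side), linZ L' (fun c => coverPay (ents C.vars lf.base) sd (typeOf c))
      = ((ents C.vars lf.base).map fun e => e.2.Y * linZ L' (fun c => ind e sd (typeOf c))).sum := by
    intro L' sd
    unfold coverPay
    rw [linZ_sum_map L' (ents C.vars lf.base) (fun e c => e.2.Y * ind e sd (typeOf c))]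
    congr 1
    refine List.map_congr_left fun e _ => ?_
    exact linZ_smul L' _ _
  rw [hpay, linZ_presPay] at hNsum hPsum
  -- (4) per entry: `Y·thr ≤ Y·(mass_N + mass_P)` (verbatim from v7 `leaf_core`)
  have hne : ∀ sd : Side, suppSide D sd ≠ [] := by
    intro sd
    cases sd
    · exact hN
    · exact hP
  have hent : ∀ e ∈ ents C.vars lf.base, e.2.Y * (e.2.thr : ℤ)
      ≤ e.2.Y * linZ D.N (fun c => ind e Side.N (typeOf c)) + e.2.Y * linZ D.P (fun c => ind e Side.P (typeOf c)) := by
    intro e he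
    obtain ⟨hY, hthr⟩ := hYthr e he
    rw [← mul_add]
    apply mul_le_mul_of_nonneg_left _ hY
    have hmN : 0 ≤ linZ D.N (fun c => ind e Side.N (typeOf c)) := linZ_nonneg _ _ fun cm _ _ => ind_nonneg _ _ _
    have hmP : 0 ≤ linZ D.P (fun c => ind e Side.P (typeOf c)) := linZ_nonneg _ _ fun cm _ _ => ind_nonneg _ _ _
    simp only [thrOK, Bool.or_eq_true, decide_eq_true_eq] at hthr
    rcases hthr with h0 | hcap
    · rw [h0]; push_cast; linarith
    · cases hc : e.2.cap with
      | none => simp only [hc] at hcap; exact absurd hcap Bool.false_ne_true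
      | some k =>
        simp only [hc, Bool.or_eq_true, Bool.and_eq_true, decide_eq_true_eq] at hcap
        have hmax := hreg e he k hc
        obtain ⟨c₀, hc₀, hcnt⟩ : ∃ c₀ ∈ suppSide D e.1.side, e.1.stat.count (typeOf c₀) = k := by
          rcases hmax.2 with hk0 | hex
          · obtain ⟨c₀, hc₀⟩ := List.exists_mem_of_ne_nil _ (hne e.1.side)
            refine ⟨c₀, hc₀, ?_⟩
            have := hmax.1 c₀ hc₀
            omega
          · exact hex
        have hge1 : 1 ≤ linZ D.N (fun c => ind e Side.N (typeOf c)) + linZ D.P (fun c => ind e Side.P (typeOf c)) := by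
          have key : ∀ sd : Side, e.1.side = sd → c₀ ∈ suppSide D sd →
              1 ≤ linZ D.N (fun c => ind e Side.N (typeOf c)) + linZ D.P (fun c => ind e Side.P (typeOf c)) := by
            intro sd hsd hc₀'
            have hind1 : ind e sd (typeOf c₀) = 1 := by
              simp [ind, hc, attains, hsd, hcnt]
            cases sd with
            | N =>
              obtain ⟨m₀, hm₀, hpos₀⟩ := (mem_suppN_iff D c₀).mp hc₀'
              have := one_le_linZ D.N _ (fun c => ind_nonneg _ _ _) c₀ m₀ hm₀ hpos₀ hind1
              linarith
            | P =>
              obtain ⟨m₀, hm₀, hpos₀⟩ := (mem_suppP_iff D c₀).mp hc₀'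
              have := one_le_linZ D.P _ (fun c => ind_nonneg _ _ _) c₀ m₀ hm₀ hpos₀ hind1
              linarith
          exact key _ rfl hc₀
        rcases hcap with h1' | ⟨h2, hpar⟩
        · rw [h1']; push_cast; linarith
        · rw [h2]
          have heven := hparity e he k hc h2 hpar
          have hindk : ∀ sd : Side, (fun c => ind e sd (typeOf c)) = fun c => if attains e.1 k sd (typeOf c) then (1 : ℤ) else 0 := by
            intro sd
            funext c
            simp [ind, hc]
          rw [hindk Side.N, hindk Side.P] at hge1 ⊢
          obtain ⟨q, hq⟩ := heven
          push_cast
          omega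
  -- (4b) per present literal: `Z + W ≤ Z·(mass_N + mass_P) + W·(cover_N + cover_P)` — presence gives mass ≥ 1, (A4) gives cover ≥ 1
  have h0 : ∀ (L' : List (Cell × ℕ)) (b : Cell → Bool), 0 ≤ linZ L' (fun c => indB (b c)) :=
    fun L' b => linZ_nonneg _ _ fun cm _ _ => indB_nonneg _
  have hlit : ∀ r ∈ lf.pres, r.Z + r.W
      ≤ (r.Z * linZ D.N (fun c => indB (massHit r Side.N (typeOf c))) + r.W * linZ D.N (fun c => indB (coverHit r Side.N (typeOf c))))
        + (r.Z * linZ D.P (fun c => indB (massHit r Side.P (typeOf c))) + r.W * linZ D.P (fun c => indB (coverHit r Side.P (typeOf c)))) := by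
    intro r hrm
    obtain ⟨hZ, hW⟩ := hZW r hrm
    obtain ⟨c₀, hc₀, hsame⟩ := hpres r hrm
    have hmN := h0 D.N (fun c => massHit r Side.N (typeOf c))
    have hmP := h0 D.P (fun c => massHit r Side.P (typeOf c))
    have hcN := h0 D.N (fun c => coverHit r Side.N (typeOf c))
    have hcP := h0 D.P (fun c => coverHit r Side.P (typeOf c))
    -- mass ≥ 1
    have hmass : 1 ≤ linZ D.N (fun c => indB (massHit r Side.N (typeOf c))) + linZ D.P (fun c => indB (massHit r Side.P (typeOf c))) := by
      have hhit : indB (massHit r r.side (typeOf c₀)) = 1 := by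
        rw [massHit_self hsame]; rfl
      cases hs : r.side with
      | N =>
        rw [hs] at hc₀ hhit
        obtain ⟨m₀, hm₀, hpos₀⟩ := (mem_suppN_iff D c₀).mp hc₀
        have := one_le_linZ D.N (fun c => indB (massHit r Side.N (typeOf c))) (fun c => indB_nonneg _) c₀ m₀ hm₀ hpos₀ hhit
        linarith
      | P =>
        rw [hs] at hc₀ hhit
        obtain ⟨m₀, hm₀, hpos₀⟩ := (mem_suppP_iff D c₀).mp hc₀
        have := one_le_linZ D.P (fun c => indB (massHit r Side.P (typeOf c))) (fun c => indB_nonneg _) c₀ m₀ hm₀ hpos₀ hhit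
        linarith
    -- cover ≥ 1
    have hcov : 1 ≤ linZ D.N (fun c => indB (coverHit r Side.N (typeOf c))) + linZ D.P (fun c => indB (coverHit r Side.P (typeOf c))) := by
      cases hs : r.side with
      | P =>
        rw [hs] at hc₀
        obtain ⟨y, hy, hl⟩ := h4.1 c₀ hc₀
        have hhit : indB (coverHit r Side.N (typeOf y)) = 1 := by
          rw [coverHit_P hs hsame hl]; rfl
        obtain ⟨m₀, hm₀, hpos₀⟩ := (mem_suppN_iff D y).mp hy
        have := one_le_linZ D.N (fun c => indB (coverHit r Side.N (typeOf c))) (fun c => indB_nonneg _) y m₀ hm₀ hpos₀ hhit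
        linarith
      | N =>
        rw [hs] at hc₀
        obtain ⟨x, hx, hl⟩ := h4.2 c₀ hc₀
        have hhit : indB (coverHit r Side.P (typeOf x)) = 1 := by
          rw [coverHit_N hs hsame hl]; rfl
        obtain ⟨m₀, hm₀, hpos₀⟩ := (mem_suppP_iff D x).mp hx
        have := one_le_linZ D.P (fun c => indB (coverHit r Side.P (typeOf c))) (fun c => indB_nonneg _) x m₀ hm₀ hpos₀ hhit
        linarith
    have hZ1 := mul_le_mul_of_nonneg_left hmass hZ
    have hW1 := mul_le_mul_of_nonneg_left hcov hW
    rw [mul_one, mul_add] at hZ1 hW1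
    linarith
  -- (5) sum over the entries and the literals, and close
  have hsum : ((ents C.vars lf.base).map fun e => e.2.Y * (e.2.thr : ℤ)).sum
      ≤ ((ents C.vars lf.base).map fun e => e.2.Y * linZ D.N (fun c => ind e Side.N (typeOf c))).sum
        + ((ents C.vars lf.base).map fun e => e.2.Y * linZ D.P (fun c => ind e Side.P (typeOf c))).sum := by
    rw [← List.sum_map_add]
    exact List.sum_le_sum hent
  have hsumL : (lf.pres.map fun r => r.Z + r.W).sum
      ≤ (lf.pres.map fun r => r.Z * linZ D.N (fun c => indB (massHit r Side.N (typeOf c))) + r.W * linZ D.N (fun c => indB (coverHit r Side.N (typeOf c)))).sum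
        + (lf.pres.map fun r => r.Z * linZ D.P (fun c => indB (massHit r Side.P (typeOf c))) + r.W * linZ D.P (fun c => indB (coverHit r Side.P (typeOf c)))).sum := by
    rw [← List.sum_map_add]
    exact List.sum_le_sum hlit
  have hLB : lf.base.L * ((((D.N.map Prod.snd).sum : ℕ) : ℤ) + ((D.P.map Prod.snd).sum : ℕ)) ≤ lf.base.L * (C.B : ℤ) :=
    mul_le_mul_of_nonneg_left hcop hL
  have hρr : lf.base.ρ * C.rmin ≤ lf.base.ρ * ((((D.N.map Prod.snd).sum : ℕ) : ℤ) - ((D.P.map Prod.snd).sum : ℕ)) :=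
    mul_le_mul_of_nonneg_left hrk hρ
  nlinarith [hvan, hNsum, hPsum, hsum, hsumL, hclose, hLB, hρr]

/-! ## §8 The branch tree with «absent ∨ present» nodes and its soundness -/

/-- a branch tree: `leaf i`; `node q kids` = branch statistic `q` into its five values (as Δ1); `disj sd τ A B` = branch on the literal `(sd, τ)`:
`A` is checked with the literal BANNED, `B` with the literal PRESENT. -/
inductive CTreeC where
  | leaf (i : ℕ)
  | node (q : ℕ) (kids : List CTreeC)
  | disj (sd : Side) (τ : STuple) (absent present : CTreeC)

/-- syntactic membership of a literal in a literal list -/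
def memLit (l : List (Side × STuple)) (b : Side × STuple) : Bool := l.any fun b' => decide (b'.1 = b.1) && eqT b'.2 b.2

theorem memLit_sound {l : List (Side × STuple)} {b : Side × STuple} (h : memLit l b = true) : ∃ b' ∈ l, b'.1 = b.1 ∧ b'.2 = b.2 := by
  simp only [memLit, List.any_eq_true, Bool.and_eq_true, decide_eq_true_eq] at h
  obtain ⟨b', hb', h1, h2⟩ := h
  exact ⟨b', hb', h1, eqT_eq h2⟩

/-- the tree cover check with fuel: under the partial assignment `asg` and the path literals `bans` ∕ `pres`, the subtree accounts for every completion — a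
leaf must carry EXACTLY the caps of the path and may only USE literals of the path (each leaf ban ∈ `bans`, each leaf presence ∈ `pres`, syntactically);
a `node` is as in Δ1; a `disj` pushes its literal onto `bans` for the absent child and onto `pres` for the present child. -/
def coverTC (C : CertC) : CTreeC → ℕ → List (Option ℕ) → List (Side × STuple) → List (Side × STuple) → Bool
  | .leaf i, _, asg, bans, pres =>
      match C.leaves[i]? with
      | some lf => decide (lf.base.recs.map VarRec.cap = asg) && (lf.bans.all fun b => memLit bans b) &&
          (lf.pres.all fun r => memLit pres (r.side, r.τ))
      | none => false
  | .node _ _, 0, _, _, _ => false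
  | .node q kids, fuel + 1, asg, bans, pres =>
      decide (q < asg.length) && decide (kids.length = 5) &&
        ((List.range 5).all fun k =>
          match kids[k]? with
          | some t => coverTC C t fuel (setAt asg q k) bans pres
          | none => false)
  | .disj _ _ _ _, 0, _, _, _ => false
  | .disj sd τ A B, fuel + 1, asg, bans, pres =>
      coverTC C A fuel asg ((sd, τ) :: bans) pres && coverTC C B fuel asg bans ((sd, τ) :: pres)

/-- the ROOT check (as Δ1: a root `node 0` may leave the floor statistic's value-0 child unchecked); `fuel` ≥ the depth of the tree -/
def rootCoverTC (C : CertC) (t : CTreeC) (fuel : ℕ) : Bool :=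
  match t with
  | .node 0 kids =>
      decide (0 < C.vars.length) && decide (kids.length = 5) &&
        ((List.range 5).all fun k => decide (k = 0) ||
          match kids[k]? with
          | some s => coverTC C s fuel (setAt (List.replicate C.vars.length none) 0 k) [] []
          | none => false)
  | _ => coverTC C t fuel (List.replicate C.vars.length none) [] []

/-- **the whole-node checker** («v1 + L1», tree cover with literal branches): floor variable first, every leaf passes `checkLeafC`, the tree covers. -/
def validTC (C : CertC) (t : CTreeC) (fuel : ℕ) : Bool :=
  decide (C.vars[0]? = some ⟨Side.P, floorStat C.h⟩) &&
  (C.leaves.all fun lf => checkLeafC C lf) &&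
  rootCoverTC C t fuel

/-- **the per-REGION checker**: the tree covers the single cap region `caps` (one `Option ℕ` per variable; `none` = unbranched) from the empty literal lists. -/
def validRC (C : CertC) (t : CTreeC) (fuel : ℕ) (caps : List (Option ℕ)) : Bool :=
  decide (caps.length = C.vars.length) &&
  (C.leaves.all fun lf => checkLeafC C lf) &&
  coverTC C t fuel caps [] []

/-- soundness of the tree cover with literals: a matching leaf whose literals all hold on the design -/
theorem coverTC_sound (C : CertC) (D : Design) (ks : List ℕ) (hks : ∀ k ∈ ks, k < 5) :
    ∀ (fuel : ℕ) (t : CTreeC) (asg : List (Option ℕ)) (bans pres : List (Side × STuple)),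
      coverTC C t fuel asg bans pres = true →
      (asg.length = ks.length ∧ ∀ j m : ℕ, asg[j]? = some (some m) → ks[j]? = some m) →
      (∀ b ∈ bans, Banned D b.1 b.2) → (∀ b ∈ pres, Present D b.1 b.2) →
      ∃ lf ∈ C.leaves, matchesB (lf.base.recs.map VarRec.cap) ks = true ∧
        (∀ b ∈ lf.bans, Banned D b.1 b.2) ∧ (∀ r ∈ lf.pres, Present D r.side r.τ) := by
  have hleaf : ∀ (fuel i : ℕ) (asg : List (Option ℕ)) (bans pres : List (Side × STuple)),
      coverTC C (.leaf i) fuel asg bans pres = true →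
      (asg.length = ks.length ∧ ∀ j m : ℕ, asg[j]? = some (some m) → ks[j]? = some m) →
      (∀ b ∈ bans, Banned D b.1 b.2) → (∀ b ∈ pres, Present D b.1 b.2) →
      ∃ lf ∈ C.leaves, matchesB (lf.base.recs.map VarRec.cap) ks = true ∧
        (∀ b ∈ lf.bans, Banned D b.1 b.2) ∧ (∀ r ∈ lf.pres, Present D r.side r.τ) := by
    intro fuel i asg bans pres h hag hb hp
    rcases hi : C.leaves[i]? with _ | lf
    · simp [coverTC, hi] at h
    · simp only [coverTC, hi, Bool.and_eq_true, decide_eq_true_eq, List.all_eq_true] at h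
      obtain ⟨⟨hcaps, hbl⟩, hpl⟩ := h
      subst hcaps
      refine ⟨lf, List.mem_of_getElem? hi, matchesB_of_agrees hag, fun b hbm => ?_, fun r hrm => ?_⟩
      · obtain ⟨b', hb', h1, h2⟩ := memLit_sound (hbl b hbm)
        have := hb b' hb'
        rw [h1, h2] at this
        exact this
      · obtain ⟨b', hb', h1, h2⟩ := memLit_sound (hpl r hrm)
        have := hp b' hb'
        rw [h1, h2] at this
        exact this
  intro fuel
  induction fuel with
  | zero =>
      intro t asg bans pres h hag hb hp
      cases t with
      | leaf i => exact hleaf 0 i asg bans pres h hag hb hp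
      | node q kids => simp [coverTC] at h
      | disj sd τ A B => simp [coverTC] at h
  | succ n ih =>
      intro t asg bans pres h hag hb hp
      cases t with
      | leaf i => exact hleaf (n + 1) i asg bans pres h hag hb hp
      | node q kids =>
          simp only [coverTC, Bool.and_eq_true, decide_eq_true_eq, List.all_eq_true] at h
          obtain ⟨⟨hq, hlen5⟩, hall⟩ := h
          have hqk : q < ks.length := by rw [← hag.1]; exact hq
          obtain ⟨k, hk⟩ : ∃ k, ks[q]? = some k := ⟨ks[q], List.getElem?_eq_getElem hqk⟩
          have hk5 : k < 5 := hks k (List.mem_of_getElem? hk)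
          have hs := hall k (List.mem_range.mpr hk5)
          obtain ⟨s, hsk⟩ : ∃ s, kids[k]? = some s := ⟨kids[k]'(by omega), List.getElem?_eq_getElem (by omega)⟩
          simp only [hsk] at hs
          exact ih s (setAt asg q k) bans pres hs (agrees_setAt hag hk) hb hp
      | disj sd τ A B =>
          simp only [coverTC, Bool.and_eq_true] at h
          obtain ⟨hA, hB⟩ := h
          rcases Classical.em (Present D sd τ) with hyes | hno
          · refine ih B asg bans ((sd, τ) :: pres) hB hag hb fun b hbm => ?_
            rcases List.mem_cons.mp hbm with rfl | hbm
            · exact hyes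
            · exact hp b hbm
          · refine ih A asg ((sd, τ) :: bans) pres hA hag (fun b hbm => ?_) hp
            rcases List.mem_cons.mp hbm with rfl | hbm
            · exact banned_of_not_present hno
            · exact hb b hbm

/-- the root check covers every value vector with a positive floor count (coordinate 0), with the literal facts of the matching leaf -/
theorem rootCoverTC_sound (C : CertC) (D : Design) (t : CTreeC) (fuel : ℕ) (ks : List ℕ) (h : rootCoverTC C t fuel = true)
    (hlen : ks.length = C.vars.length) (hks : ∀ k ∈ ks, k < 5) (hk0 : ks.getD 0 0 ≠ 0) :
    ∃ lf ∈ C.leaves, matchesB (lf.base.recs.map VarRec.cap) ks = true ∧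
      (∀ b ∈ lf.bans, Banned D b.1 b.2) ∧ (∀ r ∈ lf.pres, Present D r.side r.τ) := by
  have hag0 : ((List.replicate C.vars.length (none : Option ℕ)).length = ks.length ∧ ∀ j m : ℕ,
      (List.replicate C.vars.length (none : Option ℕ))[j]? = some (some m) → ks[j]? = some m) := by
    exact ⟨by simp [hlen], fun _ _ h => absurd (List.eq_of_mem_replicate (List.mem_of_getElem? h)) (by simp)⟩
  have hb0 : ∀ b ∈ ([] : List (Side × STuple)), Banned D b.1 b.2 := by simp
  have hp0 : ∀ b ∈ ([] : List (Side × STuple)), Present D b.1 b.2 := by simp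
  cases t with
  | leaf i =>
      simp only [rootCoverTC] at h
      exact coverTC_sound C D ks hks _ _ _ _ _ h hag0 hb0 hp0
  | disj sd τ A B =>
      simp only [rootCoverTC] at h
      exact coverTC_sound C D ks hks _ _ _ _ _ h hag0 hb0 hp0
  | node q kids =>
      cases q with
      | succ q =>
          simp only [rootCoverTC] at h
          exact coverTC_sound C D ks hks _ _ _ _ _ h hag0 hb0 hp0
      | zero =>
          simp only [rootCoverTC, Bool.and_eq_true, decide_eq_true_eq, List.all_eq_true, Bool.or_eq_true] at h
          obtain ⟨⟨hn, hlen5⟩, hall⟩ := h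
          cases ks with
          | nil => simp at hlen; omega
          | cons a tl =>
              simp only [List.getD_cons_zero] at hk0
              have hk5 : a < 5 := hks a (by simp)
              have hs := hall a (List.mem_range.mpr hk5)
              rcases hs with hbad | hs
              · exact absurd hbad hk0
              obtain ⟨s, hsk⟩ : ∃ s, kids[a]? = some s := ⟨kids[a]'(by omega), List.getElem?_eq_getElem (by omega)⟩
              simp only [hsk] at hs
              exact coverTC_sound C D (a :: tl) hks _ _ _ _ _ hs (agrees_setAt hag0 (k := a) (q := 0) rfl) hb0 hp0

/-! ## §9 The end-to-end theorems -/

/-- the design lies in the region read off a matching caps pattern (shared by the whole-node and the per-region theorem) -/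
theorem inRegion_of_matchesB (vars : List Var) (lf : Leaf) (D : Design) (hmatch : matchesB (lf.recs.map VarRec.cap) (vars.map (kOf D)) = true) :
    InRegion vars lf D := by
  intro e he k hk
  obtain ⟨i, hi⟩ := List.mem_iff_getElem?.mp he
  have hvr := List.getElem?_zip_eq_some.mp hi
  have hz : (List.zip (lf.recs.map VarRec.cap) (vars.map (kOf D)))[i]? = some (e.2.cap, kOf D e.1) := by
    apply List.getElem?_zip_eq_some.mpr
    rw [List.getElem?_map, hvr.2, List.getElem?_map, hvr.1]
    exact ⟨rfl, rfl⟩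
  unfold matchesB at hmatch
  have hm := List.all_eq_true.mp hmatch _ (List.mem_of_getElem? hz)
  simp only [hk, decide_eq_true_eq] at hm
  rw [hm]
  exact isMax_kOf D e.1

/-- (cover) every admissible design with a floor letter lies in the region of some leaf of a valid «v1 + L1» certificate, whose literals hold on it -/
theorem region_coverTC (C : CertC) (t : CTreeC) (fuel : ℕ) (hv : validTC C t fuel = true) (D : Design) (hA : D.OnAlphabet C.h) (h4 : D.A4)
    (c : Cell) (hc : c ∈ D.suppN ++ D.suppP) (f : Fin 4) (hfloor : (c f).a = 0) :
    ∃ lf ∈ C.leaves, InRegion C.vars lf.base D ∧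
      (∀ sd : Side, ∀ c' ∈ suppSide D sd, admType C.h (allBounds C.vars lf.base) sd (typeOf c') = true) ∧
      (∀ b ∈ lf.bans, Banned D b.1 b.2) ∧ (∀ r ∈ lf.pres, Present D r.side r.τ) := by
  have hv' := hv
  unfold validTC at hv'
  simp only [Bool.and_eq_true, decide_eq_true_eq] at hv'
  obtain ⟨⟨hv0, hleaves⟩, hroot⟩ := hv'
  have hS1 := static_adm C.h D hA h4
  -- the floor cell is a P-cell (nothing lies amply below level 0)
  have hcP : c ∈ D.suppP := by
    rcases List.mem_append.mp hc with hcN | hcP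
    · exfalso
      obtain ⟨x, hx, hlive⟩ := h4.2 c hcN
      have hlt := (hlive f).1
      have hx0 := (hA x (List.mem_append.mpr (Or.inr hx)) f).2
      omega
    · exact hcP
  have hks5 : ∀ k ∈ C.vars.map (kOf D), k < 5 := fun k hk => by
    obtain ⟨v, _, rfl⟩ := List.mem_map.mp hk
    exact Nat.lt_succ_of_le (kOf_le_four D v)
  -- variable 0 (the P-floor count) is positive on this design
  have hk0 : (C.vars.map (kOf D)).getD 0 0 ≠ 0 := by
    cases hvars : C.vars with
    | nil => rw [hvars] at hv0; simp at hv0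
    | cons v0 rest =>
      rw [hvars] at hv0
      simp only [List.getElem?_cons_zero, Option.some.injEq] at hv0
      subst hv0
      simp only [List.map_cons, List.getD_cons_zero]
      have hcnt : 0 < (floorStat C.h).count (typeOf c) := by
        unfold Stat.count
        refine List.length_pos_of_mem (List.mem_filter.mpr ⟨List.mem_finRange f, ?_⟩)
        refine List.elem_eq_true_of_mem (List.mem_filter.mpr ⟨by rw [admP0T_eq]; exact hS1.1 c hcP f, ?_⟩)
        simp [Shape.isFloor, shapeOf, typeOf, hfloor]
      have hle : (floorStat C.h).count (typeOf c) ≤ kOf D ⟨Side.P, floorStat C.h⟩ :=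
        (isMax_kOf D ⟨Side.P, floorStat C.h⟩).1 c hcP
      omega
  obtain ⟨lf, hlf, hmatch, hbans, hpres⟩ := rootCoverTC_sound C D t fuel (C.vars.map (kOf D)) hroot (by simp) hks5 hk0
  have hreg : InRegion C.vars lf.base D := inRegion_of_matchesB C.vars lf.base D hmatch
  have hchk : checkLeafC C lf = true := List.all_eq_true.mp hleaves lf hlf
  exact ⟨lf, hlf, hreg, adm_of_region C.toB lf.base (hder_of_checkLeafC hchk) D hA h4 hreg, hbans, hpres⟩

/-- soundness (depth form), parametrised by a provider of the parity conclusions (as v7 `depthBound_of_valid'`) -/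
theorem depthBound_of_validTC' (C : CertC) (t : CTreeC) (fuel : ℕ) (hv : validTC C t fuel = true)
    (hpar : ∀ lf ∈ C.leaves, ∀ D : Design, D.A1 →
      (∀ sd : Side, ∀ c' ∈ suppSide D sd, admType C.h (allBounds C.vars lf.base) sd (typeOf c') = true) → ParityOK C.toB lf.base D) :
    DepthBound C.h C.B C.rmin ((C.h : ℤ) - 1) := by
  intro D hA h1 h4 _hμ hB hr c hc f
  by_contra hlt
  have hh := (hA c hc f).1
  have ha0 := (hA c hc f).2
  unfold Letter.height at hh
  unfold Letter.colevel at hlt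
  have hfloor : (c f).a = 0 := by
    push Not at hlt
    have habs : 0 ≤ |(c f).x| + |(c f).y| := by positivity
    omega
  have hleaves : C.leaves.all (fun lf => checkLeafC C lf) = true := by
    have hv' := hv
    unfold validTC at hv'
    simp only [Bool.and_eq_true] at hv'
    exact hv'.1.2
  have hsides : D.suppN ≠ [] ∧ D.suppP ≠ [] := by
    rcases List.mem_append.mp hc with hcN | hcP
    · obtain ⟨x, hx, _⟩ := h4.2 c hcN
      exact ⟨List.ne_nil_of_mem hcN, List.ne_nil_of_mem hx⟩
    · obtain ⟨y, hy, _⟩ := h4.1 c hcP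
      exact ⟨List.ne_nil_of_mem hy, List.ne_nil_of_mem hcP⟩
  obtain ⟨lf, hlf, hreg, hadm, hbans, hpres⟩ := region_coverTC C t fuel hv D hA h4 c hc f hfloor
  have hchk : checkLeafC C lf = true := List.all_eq_true.mp hleaves lf hlf
  exact leafC_sound C lf hchk D h1 h4 hB hr hsides.1 hsides.2 hreg hadm hbans hpres (hpar lf hlf D h1 hadm)

/-- **SOUNDNESS (depth form)** of the «v1 + L1» checker, parity discharged by v7 (S4) `parity_even` -/
theorem depthBound_of_validTC (C : CertC) (t : CTreeC) (fuel : ℕ) (hv : validTC C t fuel = true) :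
    DepthBound C.h C.B C.rmin ((C.h : ℤ) - 1) :=
  depthBound_of_validTC' C t fuel hv fun lf _ D h1 hadm e _ k _ _ he => parity_even C.toB lf.base e.1 k e.2.par he D h1 hadm

/-- **SOUNDNESS (floor form): `validTC C t fuel ⇒ FloorFree h B rmin`.** -/
theorem floorFree_of_validTC (C : CertC) (t : CTreeC) (fuel : ℕ) (hv : validTC C t fuel = true) : FloorFreeH C.h C.B C.rmin := by
  intro D hA h1 h4 hμ hB hr c hc f
  have hcl := depthBound_of_validTC C t fuel hv D hA h1 h4 hμ hB hr c hc f
  have hh := (hA c hc f).1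
  unfold Letter.height at hh
  unfold Letter.colevel at hcl
  linarith

/-- the attained maximum of a variable is unique -/
theorem isMax_unique {D : Design} {v : Var} {k k' : ℕ} (h : IsMax D v k) (h' : IsMax D v k') : k = k' := by
  rcases h.2 with hk | ⟨c, hc, hck⟩ <;> rcases h'.2 with hk' | ⟨c', hc', hck'⟩
  · omega
  · have := h.1 c' hc'; omega
  · have := h'.1 c hc; omega
  · have h₁ := h.1 c' hc'; have h₂ := h'.1 c hc; omega

/-- the design lies in the cap REGION `caps` (one entry per variable of `vars`): every fixed cap is the attained maximum of its variable -/
def InCaps (vars : List Var) (caps : List (Option ℕ)) (D : Design) : Prop :=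
  ∀ vc ∈ List.zip vars caps, ∀ k : ℕ, vc.2 = some k → IsMax D vc.1 k

/-- **PER-REGION SOUNDNESS** — the honest Lean shape of «FLOOR-GRADE on one cap region»: a «v1 + L1» tree over the region `caps` refutes every (A1)∧(A4) design
of that region on the alphabet of height `h` with `copies ≤ B`, `rank ≥ rmin` and a non-empty N-side.  (This is NOT `FloorFree`: the other regions remain.) -/
theorem regionEmpty_of_validRC (C : CertC) (t : CTreeC) (fuel : ℕ) (caps : List (Option ℕ)) (hv : validRC C t fuel caps = true)
    (D : Design) (hA : D.OnAlphabet C.h) (h1 : D.A1) (h4 : D.A4) (hB : D.copies ≤ C.B) (hr : C.rmin ≤ D.rank) (hN : D.suppN ≠ [])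
    (hcaps : InCaps C.vars caps D) : False := by
  have hv' := hv
  unfold validRC at hv'
  simp only [Bool.and_eq_true, decide_eq_true_eq] at hv'
  obtain ⟨⟨hlen, hleaves⟩, hcov⟩ := hv'
  have hP : D.suppP ≠ [] := by
    obtain ⟨y, hy⟩ := List.exists_mem_of_ne_nil _ hN
    obtain ⟨x, hx, _⟩ := h4.2 y hy
    exact List.ne_nil_of_mem hx
  have hks5 : ∀ k ∈ C.vars.map (kOf D), k < 5 := fun k hk => by
    obtain ⟨v, _, rfl⟩ := List.mem_map.mp hk
    exact Nat.lt_succ_of_le (kOf_le_four D v)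
  have hag : caps.length = (C.vars.map (kOf D)).length ∧
      ∀ j m : ℕ, caps[j]? = some (some m) → (C.vars.map (kOf D))[j]? = some m := by
    refine ⟨by simp [hlen], fun j m hj => ?_⟩
    obtain ⟨hjl, _⟩ := List.getElem?_eq_some_iff.mp hj
    obtain ⟨v, hvj⟩ : ∃ v, C.vars[j]? = some v := ⟨C.vars[j]'(by omega), List.getElem?_eq_getElem (by omega)⟩
    have hz : (List.zip C.vars caps)[j]? = some (v, some m) := List.getElem?_zip_eq_some.mpr ⟨hvj, hj⟩
    have hmax := hcaps _ (List.mem_of_getElem? hz) m rfl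
    rw [List.getElem?_map, hvj]
    exact congrArg some (isMax_unique (isMax_kOf D v) hmax)
  obtain ⟨lf, hlf, hmatch, hbans, hpres⟩ := coverTC_sound C D (C.vars.map (kOf D)) hks5 fuel t caps [] [] hcov hag (by simp) (by simp)
  have hreg : InRegion C.vars lf.base D := inRegion_of_matchesB C.vars lf.base D hmatch
  have hchk : checkLeafC C lf = true := List.all_eq_true.mp hleaves lf hlf
  have hadm := adm_of_region C.toB lf.base (hder_of_checkLeafC hchk) D hA h4 hreg
  exact leafC_sound C lf hchk D h1 h4 hB hr hN hP hreg hadm hbans hpres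
    (fun e _ k _ _ he => parity_even C.toB lf.base e.1 k e.2.par he D h1 hadm)

/-- the same with the non-emptiness of the N-side derived from a positive rank floor (`BnCCert.suppN_ne_nil_of_rank`) -/
theorem regionEmpty_of_validRC' (C : CertC) (t : CTreeC) (fuel : ℕ) (caps : List (Option ℕ)) (hv : validRC C t fuel caps = true)
    (hpos : 0 < C.rmin) (D : Design) (hA : D.OnAlphabet C.h) (h1 : D.A1) (h4 : D.A4) (hB : D.copies ≤ C.B) (hr : C.rmin ≤ D.rank)
    (hcaps : InCaps C.vars caps D) : False :=
  regionEmpty_of_validRC C t fuel caps hv D hA h1 h4 hB hr (suppN_ne_nil_of_rank D C.rmin hr hpos) hcaps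

/-! ## §10 Smoke tests (FAKE leaves: caps and literal patterns only — no LP content, nothing about designs) -/
section Smoke

def sA : Shape := ⟨0, 1, 1⟩
def sB : Shape := ⟨1, 1, 0⟩
def τ0 : STuple := ![sA, sA, sB, sB]

/-- `sameM` is multiset equality: a permutation is recognised, a different multiset is not -/
example : sameM τ0 ![sB, sA, sB, sA] = true := by decide
example : sameM τ0 ![sB, sA, sA, sA] = false := by decide

/-- a fake «v1 + L1» leaf carrying only caps, bans and presences -/
def fakeLeafC (caps : List (Option ℕ)) (bans : List (Side × STuple)) (pres : List Pres) : LeafC :=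
  {base := {recs := caps.map fun c => ⟨c, 0, 0, []⟩, derived := [], func := Func.cls ⟨0, 0, 0, 0, 0, 0⟩, L := 0, ρ := 0, laws := []},
   bans := bans, pres := pres}

/-- one variable (the floor count); FLOOR = 2 is split on the literal `(P, τ0)`: absent ↦ leaf 1 (ban), present ↦ leaf 2 (mass ∕ cover rows) -/
def fakeCC : CertC :=
  {h := 6, B := 199, rmin := 8, vars := [⟨Side.P, floorStat 6⟩],
   leaves := [fakeLeafC [some 1] [] [], fakeLeafC [some 2] [(Side.P, τ0)] [], fakeLeafC [some 2] [] [⟨Side.P, τ0, 5, 7⟩],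
              fakeLeafC [some 3] [] [], fakeLeafC [some 4] [] []]}

def fakeTC : CTreeC := .node 0 [.leaf 0, .leaf 0, .disj Side.P τ0 (.leaf 1) (.leaf 2), .leaf 3, .leaf 4]

example : rootCoverTC fakeCC fakeTC 2 = true := by decide
/-- the children of the literal branch swapped (the ban leaf on the PRESENT side) is rejected -/
example : rootCoverTC fakeCC (.node 0 [.leaf 0, .leaf 0, .disj Side.P τ0 (.leaf 2) (.leaf 1), .leaf 3, .leaf 4]) 2 = false := by decide
/-- a leaf using a literal that is not on its path is rejected -/
example : rootCoverTC fakeCC (.node 0 [.leaf 0, .leaf 0, .leaf 2, .leaf 3, .leaf 4]) 2 = false := by decide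
/-- the per-region form: the region FLOOR = 2 alone is covered by the literal branch -/
example : coverTC fakeCC (.disj Side.P τ0 (.leaf 1) (.leaf 2)) 1 [some 2] [] [] = true := by decide

end Smoke


/-! # Δ3 (v2, §§11–18): CIBB-1.5's FIRST-ORDER LETTER ROWS — the ten orbit-summed |E| = 1 rows and the per-letter (KEY) literals «(sd, τ, ℓ) banned ∕ present»
with letter-mass and letter-cover prices — in SEPARABLE form, so that the pointwise dual check stays at TYPE level (per slot: a max over the ≤ 8 admissible
letters of the slot's shape).  Ordered by director-hodge R19.526 (2c) ∕ R19.527 (1)(c) («Δ3 = the per-letter ∕ |E| = 1 rows of CIBB-1.5, after (2b) reports»;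
(2b) reported bus l.10658).  Cell-level twins of the two soundness facts are strengthen's `CoverIntegrality.lean` v2.3∕v2.4 §7 `orbitRowE1_marginal_sound` and
`coverRowsLetterCov_of_A4fun` (CITED, not imported: this file keeps importing v7 `BnCCert` only).  HONEST FRAMING as in the header: checker soundness for a
richer certificate format; no certificate instance exists or is claimed; nothing toward `FloorFree 6 199 8` ∕ 18881 ∕ H2 ∕ HC. -/

/-! ## §11 (Δ3) The |E| = 1 word rows `e ⊗ ψ` in separable form (the kernel rows are v7's law words: `e` at the active slot, an e-free
filling `ψ ∈ {1, h, pt}³` on the passive slots — v7 `Fil`, `filSym`, `filVal`, cf. `lawWord`, `cellCoef_lawWord`) -/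

/-- the pair coefficient of a filling symbol is REAL and is the class datum `v = (1, a, n)` of the letter's SHAPE (pair form of v7 `coef_filSym`) -/
theorem coefP_filSym (φ : Fil) (ℓ : Letter) : coefP (filSym φ) ℓ = (φ.v (shapeOf ℓ), 0) := by
  cases φ with
  | one => rfl
  | h => rfl
  | pt =>
    show (ℓ.a * ℓ.a - (ℓ.x * ℓ.x + ℓ.y * ℓ.y), (0 : ℤ)) = ((shapeOf ℓ).n, 0)
    rw [shapeOf_n]
    refine Prod.ext ?_ rfl
    show ℓ.a * ℓ.a - (ℓ.x * ℓ.x + ℓ.y * ℓ.y) = ℓ.a ^ 2 - (ℓ.x ^ 2 + ℓ.y ^ 2)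
    ring

theorem coefP_e (ℓ : Letter) : coefP Sym.e ℓ = (ℓ.x, -ℓ.y) := rfl

/-- a PASSIVE FILLING `φ` (for CIBB-1.5: a multiset over `{1, h, pt}`, given by any representative) and a triple of passive shapes -/
abbrev Phi := Fil × Fil × Fil
abbrev STri := Shape × Shape × Shape

/-- the six orderings of a filling (WITH repetition when symbols repeat: the kernel row is `|Stab_{S₃} φ|` times CIBB-1.5's orbit row — a positive factor
on a `= 0` row; the converter divides the dual price by it) -/
def ords (φ : Phi) : List Phi :=
  [(φ.1, φ.2.1, φ.2.2), (φ.1, φ.2.2, φ.2.1), (φ.2.1, φ.1, φ.2.2), (φ.2.1, φ.2.2, φ.1), (φ.2.2, φ.1, φ.2.1), (φ.2.2, φ.2.1, φ.1)]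

/-- the PASSIVE COEFFICIENT `V_φ` on a shape triple: the sum over the six orderings of v7 `filVal` (strengthen's `V3`, on shapes) -/
def V3S (φ : Phi) (π : STri) : ℤ := ((ords φ).map fun ψ => filVal ψ π).sum

theorem V3S_eq (φ : Phi) (a b c : Shape) : V3S φ (a, b, c) =
    φ.1.v a * φ.2.1.v b * φ.2.2.v c + φ.1.v a * φ.2.2.v b * φ.2.1.v c + φ.2.1.v a * φ.1.v b * φ.2.2.v c
      + φ.2.1.v a * φ.2.2.v b * φ.1.v c + φ.2.2.v a * φ.1.v b * φ.2.1.v c + φ.2.2.v a * φ.2.1.v b * φ.1.v c := by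
  simp only [V3S, ords, filVal, List.map_cons, List.map_nil, List.sum_cons, List.sum_nil]
  ring

/-- `V_φ` is a symmetric function of the three passive shapes -/
theorem V3S_swap12 (φ : Phi) (a b c : Shape) : V3S φ (b, a, c) = V3S φ (a, b, c) := by
  rw [V3S_eq, V3S_eq]; ring
theorem V3S_swap23 (φ : Phi) (a b c : Shape) : V3S φ (a, c, b) = V3S φ (a, b, c) := by
  rw [V3S_eq, V3S_eq]; ring

/-- the passive shape triples of a type seen from the active slots `0, 1, 2, 3` (= v7 `passive f t`, spelled out per slot) -/
def pas0 (t : STuple) : STri := (t 1, t 2, t 3)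
def pas1 (t : STuple) : STri := (t 0, t 2, t 3)
def pas2 (t : STuple) : STri := (t 0, t 1, t 3)
def pas3 (t : STuple) : STri := (t 0, t 1, t 2)

/-- the |E| = 1 words with `e` at the active slot and the filling `ψ` on the passive slots in increasing order (= v7 `lawWord f ψ`, spelled out per slot) -/
def eW0 (ψ : Phi) : Word := ![Sym.e, filSym ψ.1, filSym ψ.2.1, filSym ψ.2.2]
def eW1 (ψ : Phi) : Word := ![filSym ψ.1, Sym.e, filSym ψ.2.1, filSym ψ.2.2]
def eW2 (ψ : Phi) : Word := ![filSym ψ.1, filSym ψ.2.1, Sym.e, filSym ψ.2.2]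
def eW3 (ψ : Phi) : Word := ![filSym ψ.1, filSym ψ.2.1, filSym ψ.2.2, Sym.e]

/-- FACTORISATION of the pair coefficient of `e ⊗ ψ`: `conj β` of the active letter times the (real, shape-level) passive product (pair form of v7 `cellCoef_lawWord`) -/
theorem cellCoefP_eW0 (c : Cell) (ψ : Phi) : cellCoefP c (eW0 ψ) = ((c 0).x * filVal ψ (pas0 (typeOf c)), -(c 0).y * filVal ψ (pas0 (typeOf c))) := by
  simp only [cellCoefP, eW0, Matrix.cons_val_zero, Matrix.cons_val_one, Matrix.cons_val_two, Matrix.cons_val_three, Matrix.head_cons,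
    Matrix.tail_cons, coefP_e, coefP_filSym, mulP, filVal, pas0, typeOf]
  refine Prod.ext ?_ ?_ <;> simp only <;> ring
theorem cellCoefP_eW1 (c : Cell) (ψ : Phi) : cellCoefP c (eW1 ψ) = ((c 1).x * filVal ψ (pas1 (typeOf c)), -(c 1).y * filVal ψ (pas1 (typeOf c))) := by
  simp only [cellCoefP, eW1, Matrix.cons_val_zero, Matrix.cons_val_one, Matrix.cons_val_two, Matrix.cons_val_three, Matrix.head_cons,
    Matrix.tail_cons, coefP_e, coefP_filSym, mulP, filVal, pas1, typeOf]
  refine Prod.ext ?_ ?_ <;> simp only <;> ring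
theorem cellCoefP_eW2 (c : Cell) (ψ : Phi) : cellCoefP c (eW2 ψ) = ((c 2).x * filVal ψ (pas2 (typeOf c)), -(c 2).y * filVal ψ (pas2 (typeOf c))) := by
  simp only [cellCoefP, eW2, Matrix.cons_val_zero, Matrix.cons_val_one, Matrix.cons_val_two, Matrix.cons_val_three, Matrix.head_cons,
    Matrix.tail_cons, coefP_e, coefP_filSym, mulP, filVal, pas2, typeOf]
  refine Prod.ext ?_ ?_ <;> simp only <;> ring
theorem cellCoefP_eW3 (c : Cell) (ψ : Phi) : cellCoefP c (eW3 ψ) = ((c 3).x * filVal ψ (pas3 (typeOf c)), -(c 3).y * filVal ψ (pas3 (typeOf c))) := by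
  simp only [cellCoefP, eW3, Matrix.cons_val_zero, Matrix.cons_val_one, Matrix.cons_val_two, Matrix.cons_val_three, Matrix.head_cons,
    Matrix.tail_cons, coefP_e, coefP_filSym, mulP, filVal, pas3, typeOf]
  refine Prod.ext ?_ ?_ <;> simp only <;> ring

/-- an |E| = 1 ORBIT ROW with its dual price `(λ_re, λ_im)` (on the real and imaginary parts) -/
structure EPhi where
  φ : Phi
  lre : ℤ
  lim : ℤ

/-- the 24 v7 word rows of one orbit row (4 active slots × 6 orderings), all with the orbit row's price -/
def rowsPhi (e : EPhi) : List RowSpec :=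
  (ords e.φ).flatMap fun ψ => [⟨eW0 ψ, none, e.lre, e.lim⟩, ⟨eW1 ψ, none, e.lre, e.lim⟩, ⟨eW2 ψ, none, e.lre, e.lim⟩, ⟨eW3 ψ, none, e.lre, e.lim⟩]

/-- all word rows of a leaf's orbit rows (a v7 `Func.cell` row list: balance is v7 `Gc_balance`, well-formedness the checkable `rowOK`) -/
def rowsE (ephi : List EPhi) : List RowSpec := ephi.flatMap rowsPhi

/-- the SEPARABLE per-slot value of the orbit rows: active letter `ℓ`, passive shape triple `π`:  `Σ_φ (λ_re·x(ℓ) − λ_im·y(ℓ))·V_φ(π)`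
(`Re(conj β(ℓ)·V) = x·V`, `Im = −y·V`) -/
def eTerm (ephi : List EPhi) (π : STri) (ℓ : Letter) : ℤ := (ephi.map fun e => (e.lre * ℓ.x - e.lim * ℓ.y) * V3S e.φ π).sum

/-- the orbit-row functional of a CELL as the sum of its four slot values -/
def GE (ephi : List EPhi) (c : Cell) : ℤ :=
  eTerm ephi (pas0 (typeOf c)) (c 0) + eTerm ephi (pas1 (typeOf c)) (c 1) + eTerm ephi (pas2 (typeOf c)) (c 2) + eTerm ephi (pas3 (typeOf c)) (c 3)

theorem Gc_append (A B : List RowSpec) (c : Cell) : Gc (A ++ B) c = Gc A c + Gc B c := by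
  simp [Gc, List.map_append, List.sum_append]

/-- one orbit row on a cell = its four separable slot values -/
theorem Gc_rowsPhi (e : EPhi) (c : Cell) :
    Gc (rowsPhi e) c = (e.lre * (c 0).x - e.lim * (c 0).y) * V3S e.φ (pas0 (typeOf c)) + (e.lre * (c 1).x - e.lim * (c 1).y) * V3S e.φ (pas1 (typeOf c))
      + (e.lre * (c 2).x - e.lim * (c 2).y) * V3S e.φ (pas2 (typeOf c)) + (e.lre * (c 3).x - e.lim * (c 3).y) * V3S e.φ (pas3 (typeOf c)) := by
  simp only [rowsPhi, ords, List.flatMap_cons, List.flatMap_nil, List.append_nil, List.cons_append, List.nil_append, Gc, List.map_cons,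
    List.map_nil, List.sum_cons, List.sum_nil, rowValP, cellCoefP_eW0, cellCoefP_eW1, cellCoefP_eW2, cellCoefP_eW3, V3S]
  ring

/-- **the orbit rows of a leaf on a cell = the separable functional `GE`** -/
theorem Gc_rowsE (ephi : List EPhi) (c : Cell) : Gc (rowsE ephi) c = GE ephi c := by
  induction ephi with
  | nil => simp [rowsE, Gc, GE, eTerm]
  | cons e rest ih =>
    rw [rowsE, List.flatMap_cons, Gc_append, ← rowsE, ih, Gc_rowsPhi e c]
    simp only [GE, eTerm, List.map_cons, List.sum_cons]
    ring

/-- **BALANCE of the orbit-row functional under (A1)** (each word row is an (A1).1 equality: v7 `Gc_balance`; `rowOK` is CHECKED on the generated rows) -/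
theorem GE_balance (D : Design) (h1 : D.A1) (ephi : List EPhi) (hok : (rowsE ephi).all rowOK = true) :
    linZ D.N (GE ephi) - linZ D.P (GE ephi) = 0 := by
  have hfun : GE ephi = Gc (rowsE ephi) := funext fun c => (Gc_rowsE ephi c).symm
  rw [hfun]
  exact Gc_balance D h1 (rowsE ephi) hok

/-! ## §12 (Δ3) KEY literals «(sd, τ, ℓ) banned ∕ present» and their letter-mass ∕ letter-cover pays -/

/-- a key literal: side, shape multiset (any representative), letter -/
abbrev KLit := Side × STuple × Letter

/-- a PRESENT key with its prices: `Z` on the letter-mass row of its own side, `W` on the letter-cover row of the other side -/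
structure KPres where
  side : Side
  τ : STuple
  ℓ : Letter
  Z : ℤ
  W : ℤ

/-- the key `(sd, τ, ℓ)` is PRESENT: some supported cell of side `sd` has multiset `τ` and the letter `ℓ` at some slot (its marginal `y[τ, σ, ℓ]` is `≥ 1`) -/
def KPresent (D : Design) (sd : Side) (τ : STuple) (ℓ : Letter) : Prop :=
  ∃ c ∈ suppSide D sd, sameM τ (typeOf c) = true ∧ ∃ f : Fin 4, c f = ℓ

/-- the key is BANNED: no supported cell of side `sd` with multiset `τ` carries the letter `ℓ` (`y[τ, σ, ℓ] = 0`) -/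
def KBanned (D : Design) (sd : Side) (τ : STuple) (ℓ : Letter) : Prop :=
  ∀ c ∈ suppSide D sd, sameM τ (typeOf c) = true → ∀ f : Fin 4, c f ≠ ℓ

theorem kbanned_of_not_kpresent {D : Design} {sd : Side} {τ : STuple} {ℓ : Letter} (h : ¬ KPresent D sd τ ℓ) : KBanned D sd τ ℓ :=
  fun c hc hs f hf => h ⟨c, hc, hs, f, hf⟩

/-- the letter-mass row of `r` hits the slot letter `ℓ` of a type `t` on side `sd` -/
def kmassAt (r : KPres) (sd : Side) (t : STuple) (ℓ : Letter) : Bool := decide (r.side = sd) && sameM r.τ t && decide (ℓ = r.ℓ)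

/-- the letter-cover row of `r` hits the slot letter `ℓ` of a type `t` on the OTHER side: the type is in the multiset shadow (`covUp` ∕ `covDown`, as Δ2) and the
letter is amply above (key on P) ∕ below (key on N) the key's letter -/
def kcovAt (r : KPres) (sd : Side) (t : STuple) (ℓ : Letter) : Bool :=
  match r.side, sd with
  | Side.P, Side.N => covUp r.τ t && ampleB r.ℓ ℓ
  | Side.N, Side.P => covDown r.τ t && ampleB ℓ r.ℓ
  | _, _ => false

/-- the per-slot key pay `Σ_r (Z_r·[mass hit] + W_r·[cover hit])` of the letter `ℓ` at a slot of a type `t` on side `sd` -/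
def kTerm (kpres : List KPres) (sd : Side) (t : STuple) (ℓ : Letter) : ℤ :=
  (kpres.map fun r => r.Z * indB (kmassAt r sd t ℓ) + r.W * indB (kcovAt r sd t ℓ)).sum

/-- the number of slots of a cell hit by the letter-mass row of `r` (= the cell's coefficient in the marginal `y[r.τ, σ, r.ℓ]`) -/
def kcntM (r : KPres) (sd : Side) (c : Cell) : ℤ :=
  indB (kmassAt r sd (typeOf c) (c 0)) + indB (kmassAt r sd (typeOf c) (c 1)) + indB (kmassAt r sd (typeOf c) (c 2)) + indB (kmassAt r sd (typeOf c) (c 3))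
/-- the number of slots of a cell hit by the letter-cover row of `r` -/
def kcntC (r : KPres) (sd : Side) (c : Cell) : ℤ :=
  indB (kcovAt r sd (typeOf c) (c 0)) + indB (kcovAt r sd (typeOf c) (c 1)) + indB (kcovAt r sd (typeOf c) (c 2)) + indB (kcovAt r sd (typeOf c) (c 3))

/-- the key pay of a CELL: `Σ_r (Z_r·#mass-hit slots + W_r·#cover-hit slots)` -/
def keyPay (kpres : List KPres) (sd : Side) (c : Cell) : ℤ := (kpres.map fun r => r.Z * kcntM r sd c + r.W * kcntC r sd c).sum

/-- the key pay of a cell is the sum of its four per-slot key pays (separability) -/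
theorem keyPay_eq_slots (kpres : List KPres) (sd : Side) (c : Cell) : keyPay kpres sd c =
    kTerm kpres sd (typeOf c) (c 0) + kTerm kpres sd (typeOf c) (c 1) + kTerm kpres sd (typeOf c) (c 2) + kTerm kpres sd (typeOf c) (c 3) := by
  induction kpres with
  | nil => simp [keyPay, kTerm]
  | cons r rest ih =>
    simp only [keyPay, kTerm, List.map_cons, List.sum_cons] at ih ⊢
    rw [ih]
    simp only [kcntM, kcntC]
    ring

theorem kcntM_nonneg (r : KPres) (sd : Side) (c : Cell) : 0 ≤ kcntM r sd c := by
  unfold kcntM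
  have := indB_nonneg (kmassAt r sd (typeOf c) (c 0)); have := indB_nonneg (kmassAt r sd (typeOf c) (c 1))
  have := indB_nonneg (kmassAt r sd (typeOf c) (c 2)); have := indB_nonneg (kmassAt r sd (typeOf c) (c 3))
  linarith
theorem kcntC_nonneg (r : KPres) (sd : Side) (c : Cell) : 0 ≤ kcntC r sd c := by
  unfold kcntC
  have := indB_nonneg (kcovAt r sd (typeOf c) (c 0)); have := indB_nonneg (kcovAt r sd (typeOf c) (c 1))
  have := indB_nonneg (kcovAt r sd (typeOf c) (c 2)); have := indB_nonneg (kcovAt r sd (typeOf c) (c 3))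
  linarith

theorem indB_true : indB true = 1 := rfl

/-- a cell carrying the key's letter at slot `f` (with the key's multiset, on the key's side) has mass count `≥ 1` -/
theorem one_le_kcntM {r : KPres} {c : Cell} (hs : sameM r.τ (typeOf c) = true) (f : Fin 4) (hf : c f = r.ℓ) : 1 ≤ kcntM r r.side c := by
  have hhit : ∀ g : Fin 4, c g = r.ℓ → indB (kmassAt r r.side (typeOf c) (c g)) = 1 := by
    intro g hg
    have : kmassAt r r.side (typeOf c) (c g) = true := by simp [kmassAt, hs, hg]
    rw [this]; rfl
  have h0 := indB_nonneg (kmassAt r r.side (typeOf c) (c 0)); have h1' := indB_nonneg (kmassAt r r.side (typeOf c) (c 1))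
  have h2 := indB_nonneg (kmassAt r r.side (typeOf c) (c 2)); have h3 := indB_nonneg (kmassAt r r.side (typeOf c) (c 3))
  unfold kcntM
  fin_cases f
  · have := hhit 0 hf; linarith
  · have := hhit 1 hf; linarith
  · have := hhit 2 hf; linarith
  · have := hhit 3 hf; linarith

/-- (A4) for a present P-key: the live N-partner of the carrying cell has cover count `≥ 1` (multiset shadow `covUp` at the type, `ampleB` at the active slot) -/
theorem one_le_kcntC_P {r : KPres} (hsd : r.side = Side.P) {c y : Cell} (hs : sameM r.τ (typeOf c) = true) (f : Fin 4) (hf : c f = r.ℓ)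
    (hl : Live c y) : 1 ≤ kcntC r Side.N y := by
  have hcov := covUp_of_live hs hl
  have hhit : ∀ g : Fin 4, c g = r.ℓ → indB (kcovAt r Side.N (typeOf y) (y g)) = 1 := by
    intro g hg
    have hamp : ampleB r.ℓ (y g) = true := by rw [← hg]; exact (ampleB_iff _ _).mpr (hl g)
    have : kcovAt r Side.N (typeOf y) (y g) = true := by simp [kcovAt, hsd, hcov, hamp]
    rw [this]; rfl
  have h0 := indB_nonneg (kcovAt r Side.N (typeOf y) (y 0)); have h1' := indB_nonneg (kcovAt r Side.N (typeOf y) (y 1))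
  have h2 := indB_nonneg (kcovAt r Side.N (typeOf y) (y 2)); have h3 := indB_nonneg (kcovAt r Side.N (typeOf y) (y 3))
  unfold kcntC
  fin_cases f
  · have := hhit 0 hf; linarith
  · have := hhit 1 hf; linarith
  · have := hhit 2 hf; linarith
  · have := hhit 3 hf; linarith

/-- (A4) for a present N-key: the live P-partner has cover count `≥ 1` (`covDown` at the type, `ampleB` at the active slot) -/
theorem one_le_kcntC_N {r : KPres} (hsd : r.side = Side.N) {x c : Cell} (hs : sameM r.τ (typeOf c) = true) (f : Fin 4) (hf : c f = r.ℓ)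
    (hl : Live x c) : 1 ≤ kcntC r Side.P x := by
  have hcov := covDown_of_live hs hl
  have hhit : ∀ g : Fin 4, c g = r.ℓ → indB (kcovAt r Side.P (typeOf x) (x g)) = 1 := by
    intro g hg
    have hamp : ampleB (x g) r.ℓ = true := by rw [← hg]; exact (ampleB_iff _ _).mpr (hl g)
    have : kcovAt r Side.P (typeOf x) (x g) = true := by simp [kcovAt, hsd, hcov, hamp]
    rw [this]; rfl
  have h0 := indB_nonneg (kcovAt r Side.P (typeOf x) (x 0)); have h1' := indB_nonneg (kcovAt r Side.P (typeOf x) (x 1))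
  have h2 := indB_nonneg (kcovAt r Side.P (typeOf x) (x 2)); have h3 := indB_nonneg (kcovAt r Side.P (typeOf x) (x 3))
  unfold kcntC
  fin_cases f
  · have := hhit 0 hf; linarith
  · have := hhit 1 hf; linarith
  · have := hhit 2 hf; linarith
  · have := hhit 3 hf; linarith

/-- a banned key hits the slot letter `ℓ` of a type `t` on side `sd` -/
def kbanAt (kbans : List KLit) (sd : Side) (t : STuple) (ℓ : Letter) : Bool :=
  kbans.any fun b => decide (b.1 = sd) && sameM b.2.1 t && decide (ℓ = b.2.2)

/-- on a design where the key bans hold, no supported cell's slot letter is hit -/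
theorem kbanAt_false_of_kbanned {D : Design} {kbans : List KLit} (hb : ∀ b ∈ kbans, KBanned D b.1 b.2.1 b.2.2) {sd : Side} {c : Cell}
    (hc : c ∈ suppSide D sd) (f : Fin 4) : kbanAt kbans sd (typeOf c) (c f) = false := by
  rw [Bool.eq_false_iff]
  intro h
  simp only [kbanAt, List.any_eq_true, Bool.and_eq_true, decide_eq_true_eq] at h
  obtain ⟨b, hbm, ⟨hsd, hs⟩, hℓ⟩ := h
  subst hsd
  exact hb b hbm c hc hs f hℓ

/-- exchange of the key pays against a multiplicity list -/
theorem linZ_keyPay (L' : List (Cell × ℕ)) (kpres : List KPres) (sd : Side) :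
    linZ L' (fun c => keyPay kpres sd c) = (kpres.map fun r => r.Z * linZ L' (kcntM r sd) + r.W * linZ L' (kcntC r sd)).sum := by
  unfold keyPay
  rw [linZ_sum_map L' kpres (fun r c => r.Z * kcntM r sd c + r.W * kcntC r sd c)]
  congr 1
  refine List.map_congr_left fun r _ => ?_
  rw [linZ_add, linZ_smul, linZ_smul]

/-! ### swap invariance of the key pays and bans in the tested type (they see the type through `sameM` ∕ `covUp` ∕ `covDown` only) -/

theorem kmassAt_swap01 (r : KPres) (sd : Side) (x y z w : Shape) (ℓ : Letter) : kmassAt r sd ![y, x, z, w] ℓ = kmassAt r sd ![x, y, z, w] ℓ := by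
  simp only [kmassAt, sameM, anyRel_swap01 _ _ x y z w]
theorem kmassAt_swap12 (r : KPres) (sd : Side) (x y z w : Shape) (ℓ : Letter) : kmassAt r sd ![x, z, y, w] ℓ = kmassAt r sd ![x, y, z, w] ℓ := by
  simp only [kmassAt, sameM, anyRel_swap12 _ _ x y z w]
theorem kmassAt_swap23 (r : KPres) (sd : Side) (x y z w : Shape) (ℓ : Letter) : kmassAt r sd ![x, y, w, z] ℓ = kmassAt r sd ![x, y, z, w] ℓ := by
  simp only [kmassAt, sameM, anyRel_swap23 _ _ x y z w]
theorem kcovAt_swap01 (r : KPres) (sd : Side) (x y z w : Shape) (ℓ : Letter) : kcovAt r sd ![y, x, z, w] ℓ = kcovAt r sd ![x, y, z, w] ℓ := by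
  cases hs : r.side <;> cases sd <;> simp only [kcovAt, hs, covUp, covDown, anyRel_swap01 _ _ x y z w]
theorem kcovAt_swap12 (r : KPres) (sd : Side) (x y z w : Shape) (ℓ : Letter) : kcovAt r sd ![x, z, y, w] ℓ = kcovAt r sd ![x, y, z, w] ℓ := by
  cases hs : r.side <;> cases sd <;> simp only [kcovAt, hs, covUp, covDown, anyRel_swap12 _ _ x y z w]
theorem kcovAt_swap23 (r : KPres) (sd : Side) (x y z w : Shape) (ℓ : Letter) : kcovAt r sd ![x, y, w, z] ℓ = kcovAt r sd ![x, y, z, w] ℓ := by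
  cases hs : r.side <;> cases sd <;> simp only [kcovAt, hs, covUp, covDown, anyRel_swap23 _ _ x y z w]
theorem kTerm_swap01 (kpres : List KPres) (sd : Side) (x y z w : Shape) (ℓ : Letter) : kTerm kpres sd ![y, x, z, w] ℓ = kTerm kpres sd ![x, y, z, w] ℓ := by
  simp only [kTerm, kmassAt_swap01, kcovAt_swap01]
theorem kTerm_swap12 (kpres : List KPres) (sd : Side) (x y z w : Shape) (ℓ : Letter) : kTerm kpres sd ![x, z, y, w] ℓ = kTerm kpres sd ![x, y, z, w] ℓ := by
  simp only [kTerm, kmassAt_swap12, kcovAt_swap12]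
theorem kTerm_swap23 (kpres : List KPres) (sd : Side) (x y z w : Shape) (ℓ : Letter) : kTerm kpres sd ![x, y, w, z] ℓ = kTerm kpres sd ![x, y, z, w] ℓ := by
  simp only [kTerm, kmassAt_swap23, kcovAt_swap23]
theorem kbanAt_swap01 (kbans : List KLit) (sd : Side) (x y z w : Shape) (ℓ : Letter) : kbanAt kbans sd ![y, x, z, w] ℓ = kbanAt kbans sd ![x, y, z, w] ℓ := by
  simp only [kbanAt, sameM, anyRel_swap01 _ _ x y z w]
theorem kbanAt_swap12 (kbans : List KLit) (sd : Side) (x y z w : Shape) (ℓ : Letter) : kbanAt kbans sd ![x, z, y, w] ℓ = kbanAt kbans sd ![x, y, z, w] ℓ := by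
  simp only [kbanAt, sameM, anyRel_swap12 _ _ x y z w]
theorem kbanAt_swap23 (kbans : List KLit) (sd : Side) (x y z w : Shape) (ℓ : Letter) : kbanAt kbans sd ![x, y, w, z] ℓ = kbanAt kbans sd ![x, y, z, w] ℓ := by
  simp only [kbanAt, sameM, anyRel_swap23 _ _ x y z w]

/-! ## §13 (Δ3) The «v1 + L1.5» leaf and its check -/

/-- a «v1 + L1.5» leaf: a Δ2 leaf (v1 base leaf with a CLASS functional, type literals `bans` ∕ `pres`) plus KEY literals (`kbans`; `kpres` with letter-mass ∕
letter-cover prices) and priced |E| = 1 orbit rows `ephi`.  JSON: Δ2's leaf object plus `"kbans":[[side,τ,ℓ],…]`, `"kpres":[{"side","tau","l","Z","W"},…]`,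
`"ephi":[{"phi":[s,s,s],"lre":int,"lim":int},…]` (`s ∈ {"1","h","p"}`, `ℓ = [a,x,y]`). -/
structure LeafK where
  base : Leaf
  bans : List (Side × STuple)
  pres : List Pres
  kbans : List KLit
  kpres : List KPres
  ephi : List EPhi

/-- a «v1 + L1.5» certificate -/
structure CertK where
  h : ℕ
  B : ℕ
  rmin : ℤ
  vars : List Var
  leaves : List LeafK

/-- the underlying v1 certificate (to cite v7's region ∕ bound ∕ parity machinery verbatim) -/
def CertK.toB (C : CertK) : BnCCert := ⟨C.h, C.B, C.rmin, C.vars, C.leaves.map LeafK.base⟩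

/-- the literal facts of a leaf HOLD on a design -/
def LeafK.LitsHold (lf : LeafK) (D : Design) : Prop :=
  (∀ b ∈ lf.bans, Banned D b.1 b.2) ∧ (∀ r ∈ lf.pres, Present D r.side r.τ) ∧
    (∀ b ∈ lf.kbans, KBanned D b.1 b.2.1 b.2.2) ∧ (∀ r ∈ lf.kpres, KPresent D r.side r.τ r.ℓ)

/-- the maximum of a non-empty integer list (`0` on `[]`; the value on `[]` is never used: a slot without candidates forces the type to be skipped) -/
def lmax1 : List ℤ → ℤ
  | [] => 0
  | a :: l => l.foldr max a

theorem le_foldr_max_init (l : List ℤ) (a : ℤ) : a ≤ l.foldr max a := by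
  induction l with
  | nil => simp
  | cons b l ih => simp only [List.foldr_cons]; exact le_trans ih (le_max_right _ _)

theorem le_foldr_max_of_mem {l : List ℤ} {x : ℤ} (a : ℤ) (h : x ∈ l) : x ≤ l.foldr max a := by
  induction l with
  | nil => simp at h
  | cons b l ih =>
    simp only [List.foldr_cons]
    rcases List.mem_cons.mp h with rfl | h
    · exact le_max_left _ _
    · exact le_trans (ih h) (le_max_right _ _)

theorem le_lmax1_of_mem {l : List ℤ} {x : ℤ} (h : x ∈ l) : x ≤ lmax1 l := by
  cases l with
  | nil => simp at h
  | cons a l =>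
    simp only [lmax1]
    rcases List.mem_cons.mp h with rfl | h
    · exact le_foldr_max_init l _
    · exact le_foldr_max_of_mem a h

theorem isEmpty_false_of_mem {α : Type} {l : List α} {a : α} (h : a ∈ l) : l.isEmpty = false := by
  cases l with
  | nil => simp at h
  | cons b l => rfl

/-- the CANDIDATE letters of a slot of shape `σ` in a type `t` on side `sd`: the letters of the shape not hit by a key ban -/
def cand (kbans : List KLit) (sd : Side) (t : STuple) (σ : Shape) : List Letter := σ.letters.filter fun ℓ => !kbanAt kbans sd t ℓ

/-- the per-slot value of a letter: signed orbit-row slot value plus key pay -/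
def slotVal (sd : Side) (ephi : List EPhi) (kpres : List KPres) (t : STuple) (π : STri) (ℓ : Letter) : ℤ :=
  sd.sgn * eTerm ephi π ℓ + kTerm kpres sd t ℓ

/-- the per-slot MAXIMUM over the candidate letters -/
def slotMax (sd : Side) (ephi : List EPhi) (kpres : List KPres) (kbans : List KLit) (t : STuple) (σ : Shape) (π : STri) : ℤ :=
  lmax1 ((cand kbans sd t σ).map (slotVal sd ephi kpres t π))

/-- the SEPARABLE BOUND `Q(t) = Σ_f max_{ℓ ∈ cand_f(t)} slotVal_f(t, ℓ)` of the letter-level part of the dual functional over the cells of type `t` -/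
def QK (sd : Side) (ephi : List EPhi) (kpres : List KPres) (kbans : List KLit) (t : STuple) : ℤ :=
  slotMax sd ephi kpres kbans t (t 0) (pas0 t) + slotMax sd ephi kpres kbans t (t 1) (pas1 t)
    + slotMax sd ephi kpres kbans t (t 2) (pas2 t) + slotMax sd ephi kpres kbans t (t 3) (pas3 t)

/-- the number of slots of a type without candidate letters (positive ⇒ no supported cell has this type: skipped like a banned type) -/
def emptyCnt (sd : Side) (kbans : List KLit) (t : STuple) : ℤ :=
  indB (cand kbans sd t (t 0)).isEmpty + indB (cand kbans sd t (t 1)).isEmpty + indB (cand kbans sd t (t 2)).isEmpty + indB (cand kbans sd t (t 3)).isEmpty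

/-- the POINTWISE CHECK of a «v1 + L1.5» class leaf on one side, at TYPE level: over the sorted admissible types not hit by a type ban and with candidates at
every slot, `sgn·Gtype + coverPay + presPay + Q ≤ bnd`. -/
def checkPtK (h : ℕ) (bs : List Bound) (E : List (Var × VarRec)) (γ : Coefs) (L ρ : ℤ) (bans : List (Side × STuple)) (pres : List Pres)
    (kbans : List KLit) (kpres : List KPres) (ephi : List EPhi) (sd : Side) : Bool :=
  (admTypesSorted h bs sd).all fun t =>
    banHit bans sd t || decide (0 < emptyCnt sd kbans t) ||
      decide (sd.sgn * Gtype γ t + coverPay E sd t + presPay pres sd t + QK sd ephi kpres kbans t ≤ sd.bnd L ρ)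

/-- the core conjuncts (Δ2's, plus `Z, W ≥ 0` for the keys, the (A1) well-formedness `rowOK` of every generated word row, and the closing inequality with the key
credits added) -/
def checkCoreK (C : CertK) (lf : LeafK) : Bool :=
  let E := ents C.vars lf.base
  let bs := allBounds C.vars lf.base
  decide (lf.base.recs.length = C.vars.length) &&
  checkDerivedAll C.h (primaryBounds E) lf.base.derived &&
  decide (0 ≤ lf.base.L) && decide (0 ≤ lf.base.ρ) &&
  (E.all fun e => decide (0 ≤ e.2.Y) && thrOK C.h bs lf.base.laws e) &&
  (lf.pres.all fun r => decide (0 ≤ r.Z) && decide (0 ≤ r.W)) &&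
  (lf.kpres.all fun r => decide (0 ≤ r.Z) && decide (0 ≤ r.W)) &&
  (rowsE lf.ephi).all rowOK &&
  decide (lf.base.L * (C.B : ℤ) < (E.map fun e => e.2.Y * (e.2.thr : ℤ)).sum + lf.base.ρ * C.rmin
    + (lf.pres.map fun r => r.Z + r.W).sum + (lf.kpres.map fun r => r.Z + r.W).sum)

/-- **leaf check** («v1 + L1.5»; CLASS functionals only — a `Func.cell` base leaf is rejected) -/
def checkLeafK (C : CertK) (lf : LeafK) : Bool :=
  match lf.base.func with
  | Func.cls γ =>
      checkCoreK C lf &&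
      checkPtK C.h (allBounds C.vars lf.base) (ents C.vars lf.base) γ lf.base.L lf.base.ρ lf.bans lf.pres lf.kbans lf.kpres lf.ephi Side.N &&
      checkPtK C.h (allBounds C.vars lf.base) (ents C.vars lf.base) γ lf.base.L lf.base.ρ lf.bans lf.pres lf.kbans lf.kpres lf.ephi Side.P
  | Func.cell _ => false

theorem checkLeafK_cls {C : CertK} {lf : LeafK} (h : checkLeafK C lf = true) :
    ∃ γ : Coefs, lf.base.func = Func.cls γ ∧ checkCoreK C lf = true ∧
      checkPtK C.h (allBounds C.vars lf.base) (ents C.vars lf.base) γ lf.base.L lf.base.ρ lf.bans lf.pres lf.kbans lf.kpres lf.ephi Side.N = true ∧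
      checkPtK C.h (allBounds C.vars lf.base) (ents C.vars lf.base) γ lf.base.L lf.base.ρ lf.bans lf.pres lf.kbans lf.kpres lf.ephi Side.P = true := by
  unfold checkLeafK at h
  split at h
  · rename_i γ hγ
    simp only [Bool.and_eq_true] at h
    exact ⟨γ, hγ, h.1.1, h.1.2, h.2⟩
  · exact absurd h Bool.false_ne_true

theorem hder_of_checkLeafK {C : CertK} {lf : LeafK} (h : checkLeafK C lf = true) :
    checkDerivedAll C.h (primaryBounds (ents C.vars lf.base)) lf.base.derived = true := by
  obtain ⟨γ, _, hcore, _, _⟩ := checkLeafK_cls h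
  simp only [checkCoreK, Bool.and_eq_true, decide_eq_true_eq] at hcore
  obtain ⟨⟨⟨⟨⟨⟨⟨⟨_, hder⟩, _⟩, _⟩, _⟩, _⟩, _⟩, _⟩, _⟩ := hcore
  exact hder

/-! ## §14 (Δ3) Soundness of the type-level pointwise check with per-slot maxima -/

theorem eTerm_perm12 (ephi : List EPhi) (a b c : Shape) : eTerm ephi (b, a, c) = eTerm ephi (a, b, c) := by
  funext ℓ; simp only [eTerm, V3S_swap12 _ a b c]
theorem eTerm_perm23 (ephi : List EPhi) (a b c : Shape) : eTerm ephi (a, c, b) = eTerm ephi (a, b, c) := by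
  funext ℓ; simp only [eTerm, V3S_swap23 _ a b c]

theorem slotVal_swap01 (sd : Side) (ephi : List EPhi) (kpres : List KPres) (x y z w : Shape) :
    slotVal sd ephi kpres ![y, x, z, w] = slotVal sd ephi kpres ![x, y, z, w] := by
  funext π ℓ; simp only [slotVal, kTerm_swap01 _ _ x y z w]
theorem slotVal_swap12 (sd : Side) (ephi : List EPhi) (kpres : List KPres) (x y z w : Shape) :
    slotVal sd ephi kpres ![x, z, y, w] = slotVal sd ephi kpres ![x, y, z, w] := by
  funext π ℓ; simp only [slotVal, kTerm_swap12 _ _ x y z w]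
theorem slotVal_swap23 (sd : Side) (ephi : List EPhi) (kpres : List KPres) (x y z w : Shape) :
    slotVal sd ephi kpres ![x, y, w, z] = slotVal sd ephi kpres ![x, y, z, w] := by
  funext π ℓ; simp only [slotVal, kTerm_swap23 _ _ x y z w]
theorem slotVal_perm12 (sd : Side) (ephi : List EPhi) (kpres : List KPres) (t : STuple) (a b c : Shape) :
    slotVal sd ephi kpres t (b, a, c) = slotVal sd ephi kpres t (a, b, c) := by
  funext ℓ; simp only [slotVal, eTerm_perm12 ephi a b c]
theorem slotVal_perm23 (sd : Side) (ephi : List EPhi) (kpres : List KPres) (t : STuple) (a b c : Shape) :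
    slotVal sd ephi kpres t (a, c, b) = slotVal sd ephi kpres t (a, b, c) := by
  funext ℓ; simp only [slotVal, eTerm_perm23 ephi a b c]

theorem cand_swap01 (kbans : List KLit) (sd : Side) (x y z w : Shape) : cand kbans sd ![y, x, z, w] = cand kbans sd ![x, y, z, w] := by
  funext σ; simp only [cand, kbanAt_swap01 _ _ x y z w]
theorem cand_swap12 (kbans : List KLit) (sd : Side) (x y z w : Shape) : cand kbans sd ![x, z, y, w] = cand kbans sd ![x, y, z, w] := by
  funext σ; simp only [cand, kbanAt_swap12 _ _ x y z w]
theorem cand_swap23 (kbans : List KLit) (sd : Side) (x y z w : Shape) : cand kbans sd ![x, y, w, z] = cand kbans sd ![x, y, z, w] := by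
  funext σ; simp only [cand, kbanAt_swap23 _ _ x y z w]

theorem slotMax_swap01 (sd : Side) (ephi : List EPhi) (kpres : List KPres) (kbans : List KLit) (x y z w : Shape) :
    slotMax sd ephi kpres kbans ![y, x, z, w] = slotMax sd ephi kpres kbans ![x, y, z, w] := by
  funext σ π; simp only [slotMax, cand_swap01 _ _ x y z w, slotVal_swap01 _ _ _ x y z w]
theorem slotMax_swap12 (sd : Side) (ephi : List EPhi) (kpres : List KPres) (kbans : List KLit) (x y z w : Shape) :
    slotMax sd ephi kpres kbans ![x, z, y, w] = slotMax sd ephi kpres kbans ![x, y, z, w] := by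
  funext σ π; simp only [slotMax, cand_swap12 _ _ x y z w, slotVal_swap12 _ _ _ x y z w]
theorem slotMax_swap23 (sd : Side) (ephi : List EPhi) (kpres : List KPres) (kbans : List KLit) (x y z w : Shape) :
    slotMax sd ephi kpres kbans ![x, y, w, z] = slotMax sd ephi kpres kbans ![x, y, z, w] := by
  funext σ π; simp only [slotMax, cand_swap23 _ _ x y z w, slotVal_swap23 _ _ _ x y z w]
theorem slotMax_perm12 (sd : Side) (ephi : List EPhi) (kpres : List KPres) (kbans : List KLit) (t : STuple) (σ a b c : Shape) :
    slotMax sd ephi kpres kbans t σ (b, a, c) = slotMax sd ephi kpres kbans t σ (a, b, c) := by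
  simp only [slotMax, slotVal_perm12 _ _ _ t a b c]
theorem slotMax_perm23 (sd : Side) (ephi : List EPhi) (kpres : List KPres) (kbans : List KLit) (t : STuple) (σ a b c : Shape) :
    slotMax sd ephi kpres kbans t σ (a, c, b) = slotMax sd ephi kpres kbans t σ (a, b, c) := by
  simp only [slotMax, slotVal_perm23 _ _ _ t a b c]

/-- `Q` is `S₄`-invariant (the tested type enters through `sameM` ∕ `covUp` ∕ `covDown`, the slot set and the symmetric `V_φ`) -/
theorem QK_swap01 (sd : Side) (ephi : List EPhi) (kpres : List KPres) (kbans : List KLit) (x y z w : Shape) :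
    QK sd ephi kpres kbans ![y, x, z, w] = QK sd ephi kpres kbans ![x, y, z, w] := by
  simp only [QK, pas0, pas1, pas2, pas3, Matrix.cons_val_zero, Matrix.cons_val_one, Matrix.cons_val_two, Matrix.cons_val_three, Matrix.head_cons,
    Matrix.tail_cons, slotMax_swap01 sd ephi kpres kbans x y z w, slotMax_perm12 _ _ _ _ _ _ x y w, slotMax_perm12 _ _ _ _ _ _ x y z]
  ring
theorem QK_swap12 (sd : Side) (ephi : List EPhi) (kpres : List KPres) (kbans : List KLit) (x y z w : Shape) :
    QK sd ephi kpres kbans ![x, z, y, w] = QK sd ephi kpres kbans ![x, y, z, w] := by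
  simp only [QK, pas0, pas1, pas2, pas3, Matrix.cons_val_zero, Matrix.cons_val_one, Matrix.cons_val_two, Matrix.cons_val_three, Matrix.head_cons,
    Matrix.tail_cons, slotMax_swap12 sd ephi kpres kbans x y z w, slotMax_perm12 _ _ _ _ _ _ y z w, slotMax_perm23 _ _ _ _ _ _ x y z]
  ring
theorem QK_swap23 (sd : Side) (ephi : List EPhi) (kpres : List KPres) (kbans : List KLit) (x y z w : Shape) :
    QK sd ephi kpres kbans ![x, y, w, z] = QK sd ephi kpres kbans ![x, y, z, w] := by
  simp only [QK, pas0, pas1, pas2, pas3, Matrix.cons_val_zero, Matrix.cons_val_one, Matrix.cons_val_two, Matrix.cons_val_three, Matrix.head_cons,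
    Matrix.tail_cons, slotMax_swap23 sd ephi kpres kbans x y z w, slotMax_perm23 _ _ _ _ _ _ y z w, slotMax_perm23 _ _ _ _ _ _ x z w]
  ring

theorem emptyCnt_swap01 (sd : Side) (kbans : List KLit) (x y z w : Shape) : emptyCnt sd kbans ![y, x, z, w] = emptyCnt sd kbans ![x, y, z, w] := by
  simp only [emptyCnt, Matrix.cons_val_zero, Matrix.cons_val_one, Matrix.cons_val_two, Matrix.cons_val_three, Matrix.head_cons, Matrix.tail_cons,
    cand_swap01 _ _ x y z w]
  ring
theorem emptyCnt_swap12 (sd : Side) (kbans : List KLit) (x y z w : Shape) : emptyCnt sd kbans ![x, z, y, w] = emptyCnt sd kbans ![x, y, z, w] := by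
  simp only [emptyCnt, Matrix.cons_val_zero, Matrix.cons_val_one, Matrix.cons_val_two, Matrix.cons_val_three, Matrix.head_cons, Matrix.tail_cons,
    cand_swap12 _ _ x y z w]
  ring
theorem emptyCnt_swap23 (sd : Side) (kbans : List KLit) (x y z w : Shape) : emptyCnt sd kbans ![x, y, w, z] = emptyCnt sd kbans ![x, y, z, w] := by
  simp only [emptyCnt, Matrix.cons_val_zero, Matrix.cons_val_one, Matrix.cons_val_two, Matrix.cons_val_three, Matrix.head_cons, Matrix.tail_cons,
    cand_swap23 _ _ x y z w]
  ring

/-- the «v1 + L1.5» pointwise predicate on an explicit type -/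
def KPt (h : ℕ) (bs : List Bound) (E : List (Var × VarRec)) (γ : Coefs) (L ρ : ℤ) (bans : List (Side × STuple)) (pres : List Pres)
    (kbans : List KLit) (kpres : List KPres) (ephi : List EPhi) (sd : Side) (x y z w : Shape) : Prop :=
  admType h bs sd ![x, y, z, w] = true → banHit bans sd ![x, y, z, w] = false → emptyCnt sd kbans ![x, y, z, w] = 0 →
    sd.sgn * Gtype γ ![x, y, z, w] + coverPay E sd ![x, y, z, w] + presPay pres sd ![x, y, z, w] + QK sd ephi kpres kbans ![x, y, z, w] ≤ sd.bnd L ρ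

theorem kPt_all {h : ℕ} {bs : List Bound} {E : List (Var × VarRec)} {γ : Coefs} {L ρ : ℤ} {bans : List (Side × STuple)} {pres : List Pres}
    {kbans : List KLit} {kpres : List KPres} {ephi : List EPhi} {sd : Side}
    (hchk : ∀ t ∈ admTypesSorted h bs sd, (banHit bans sd t = true ∨ 0 < emptyCnt sd kbans t) ∨
      sd.sgn * Gtype γ t + coverPay E sd t + presPay pres sd t + QK sd ephi kpres kbans t ≤ sd.bnd L ρ) :
    ∀ x y z w, KPt h bs E γ L ρ bans pres kbans kpres ephi sd x y z w := by
  refine forall_of_sorted4 (rankOf (adm0 h sd)) (KPt h bs E γ L ρ bans pres kbans kpres ephi sd) ?_ ?_ ?_ ?_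
  · intro x y z w hP ha hb he
    rw [banHit_swap01] at hb
    rw [emptyCnt_swap01] at he
    have := hP (admType_swap01 h bs sd x y z w ha) hb he
    rw [← Gtype_swap01, ← coverPay_swap01, ← presPay_swap01, ← QK_swap01] at this
    exact this
  · intro x y z w hP ha hb he
    rw [banHit_swap12] at hb
    rw [emptyCnt_swap12] at he
    have := hP (admType_swap12 h bs sd x y z w ha) hb he
    rw [← Gtype_swap12, ← coverPay_swap12, ← presPay_swap12, ← QK_swap12] at this
    exact this
  · intro x y z w hP ha hb he
    rw [banHit_swap23] at hb
    rw [emptyCnt_swap23] at he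
    have := hP (admType_swap23 h bs sd x y z w ha) hb he
    rw [← Gtype_swap23, ← coverPay_swap23, ← presPay_swap23, ← QK_swap23] at this
    exact this
  · intro x y z w h1 h2 h3 ha hb he
    have hx : (adm0 h sd).elem x = true := by simpa using admType_static ha 0
    have hy : (adm0 h sd).elem y = true := by simpa using admType_static ha 1
    have hz : (adm0 h sd).elem z = true := by simpa using admType_static ha 2
    have hw : (adm0 h sd).elem w = true := by simpa using admType_static ha 3
    rcases hchk _ (List.mem_filter.mpr ⟨mem_stuples _ x y z w (List.mem_of_elem_eq_true hx) (List.mem_of_elem_eq_true hy)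
      (List.mem_of_elem_eq_true hz) (List.mem_of_elem_eq_true hw) h1 h2 h3, ha⟩) with (hban | hemp) | hle
    · rw [hb] at hban
      exact absurd hban Bool.false_ne_true
    · rw [he] at hemp
      exact absurd hemp (lt_irrefl 0)
    · exact hle

/-- **the type-level pointwise check with per-slot maxima is sound on every supported cell** of an admissible, non-banned type whose letters respect the key bans:
the letter-level part `sgn·GE(c) + keyPay(c)` of the dual functional is the sum of the four slot values of the cell's own letters, each a candidate of its slot,
hence at most `Q(typeOf c)`. -/
theorem checkPtK_sound {h : ℕ} {bs : List Bound} {E : List (Var × VarRec)} {γ : Coefs} {L ρ : ℤ} {bans : List (Side × STuple)} {pres : List Pres}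
    {kbans : List KLit} {kpres : List KPres} {ephi : List EPhi} {sd : Side}
    (hchk : checkPtK h bs E γ L ρ bans pres kbans kpres ephi sd = true) (c : Cell)
    (hadm : admType h bs sd (typeOf c) = true) (hnb : banHit bans sd (typeOf c) = false) (hkb : ∀ f : Fin 4, kbanAt kbans sd (typeOf c) (c f) = false) :
    sd.sgn * (Gcell γ c + GE ephi c) + (coverPay E sd (typeOf c) + presPay pres sd (typeOf c) + keyPay kpres sd c) ≤ sd.bnd L ρ := by
  simp only [checkPtK, List.all_eq_true, Bool.or_eq_true, decide_eq_true_eq] at hchk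
  have ht : (![typeOf c 0, typeOf c 1, typeOf c 2, typeOf c 3] : STuple) = typeOf c := by
    funext f; fin_cases f <;> rfl
  have hmem : ∀ f : Fin 4, c f ∈ cand kbans sd (typeOf c) (typeOf c f) := fun f =>
    List.mem_filter.mpr ⟨mem_letters_shapeOf (c f), by simp [hkb f]⟩
  have hempty : emptyCnt sd kbans (typeOf c) = 0 := by
    simp only [emptyCnt, isEmpty_false_of_mem (hmem 0), isEmpty_false_of_mem (hmem 1), isEmpty_false_of_mem (hmem 2),
      isEmpty_false_of_mem (hmem 3), indB]
    simp
  have hP := kPt_all hchk (typeOf c 0) (typeOf c 1) (typeOf c 2) (typeOf c 3)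
  rw [KPt, ht] at hP
  have hineq := hP hadm hnb hempty
  have hslots : sd.sgn * GE ephi c + keyPay kpres sd c =
      slotVal sd ephi kpres (typeOf c) (pas0 (typeOf c)) (c 0) + slotVal sd ephi kpres (typeOf c) (pas1 (typeOf c)) (c 1)
        + slotVal sd ephi kpres (typeOf c) (pas2 (typeOf c)) (c 2) + slotVal sd ephi kpres (typeOf c) (pas3 (typeOf c)) (c 3) := by
    rw [keyPay_eq_slots]
    simp only [GE, slotVal]
    ring
  have hle : ∀ (σ : Shape) (π : STri) (ℓ : Letter), ℓ ∈ cand kbans sd (typeOf c) σ →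
      slotVal sd ephi kpres (typeOf c) π ℓ ≤ slotMax sd ephi kpres kbans (typeOf c) σ π :=
    fun σ π ℓ hℓ => le_lmax1_of_mem (List.mem_map.mpr ⟨ℓ, hℓ, rfl⟩)
  have h0 := hle _ (pas0 (typeOf c)) _ (hmem 0)
  have h1 := hle _ (pas1 (typeOf c)) _ (hmem 1)
  have h2 := hle _ (pas2 (typeOf c)) _ (hmem 2)
  have h3 := hle _ (pas3 (typeOf c)) _ (hmem 3)
  rw [Gcell_eq_Gtype]
  unfold QK at hineq
  have hdist : sd.sgn * (Gtype γ (typeOf c) + GE ephi c) = sd.sgn * Gtype γ (typeOf c) + sd.sgn * GE ephi c := by ring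
  linarith [hslots, h0, h1, h2, h3, hineq]

/-! ## §15 (Δ3) The leaf Farkas — a generic core, the three credit lemmas, and the «v1 + L1.5» leaf -/

/-- **FARKAS CORE** (the arithmetic of v7 `leaf_core`, abstracted): a balanced functional `F`, non-negative side pays with total credit `credit`, pointwise
`sgn·F + pay ≤ bnd` on the supported cells, and the closing inequality `L·B < credit + ρ·rmin` are contradictory under `copies ≤ B`, `rank ≥ rmin`. -/
theorem farkas_core (D : Design) (B : ℕ) (rmin : ℤ) (hB : D.copies ≤ B) (hr : rmin ≤ D.rank) (F : Cell → ℤ)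
    (hF : linZ D.N F - linZ D.P F = 0) (pay : Side → Cell → ℤ) (credit L ρ : ℤ) (hL : 0 ≤ L) (hρ : 0 ≤ ρ)
    (hpay : credit ≤ linZ D.N (pay Side.N) + linZ D.P (pay Side.P))
    (hpt : ∀ sd : Side, ∀ c ∈ suppSide D sd, sd.sgn * F c + pay sd c ≤ sd.bnd L ρ)
    (hclose : L * (B : ℤ) < credit + ρ * rmin) : False := by
  have hMN0 : (0 : ℤ) ≤ ((D.N.map Prod.snd).sum : ℕ) := by positivity
  have hMP0 : (0 : ℤ) ≤ ((D.P.map Prod.snd).sum : ℕ) := by positivity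
  have hcop : (((D.N.map Prod.snd).sum : ℕ) : ℤ) + ((D.P.map Prod.snd).sum : ℕ) ≤ B := by
    have : D.copies ≤ B := hB
    unfold Design.copies at this
    exact_mod_cast this
  have hrk : rmin ≤ (((D.N.map Prod.snd).sum : ℕ) : ℤ) - ((D.P.map Prod.snd).sum : ℕ) := by
    unfold Design.rank at hr
    exact hr
  have hNsum : linZ D.N (fun c => F c + pay Side.N c) ≤ (L - ρ) * ((D.N.map Prod.snd).sum : ℕ) := by
    refine linZ_le_mul_sum D.N _ _ fun cm hcm hpos => ?_
    have hsupp : cm.1 ∈ D.suppN := (mem_suppN_iff D cm.1).mpr ⟨cm.2, hcm, hpos⟩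
    have hineq := hpt Side.N cm.1 hsupp
    simp only [Side.sgn, Side.bnd, one_mul] at hineq
    exact hineq
  have hPsum : linZ D.P (fun c => -F c + pay Side.P c) ≤ (L + ρ) * ((D.P.map Prod.snd).sum : ℕ) := by
    refine linZ_le_mul_sum D.P _ _ fun cm hcm hpos => ?_
    have hsupp : cm.1 ∈ D.suppP := (mem_suppP_iff D cm.1).mpr ⟨cm.2, hcm, hpos⟩
    have hineq := hpt Side.P cm.1 hsupp
    simp only [Side.sgn, Side.bnd, neg_mul, one_mul] at hineq
    exact hineq
  rw [linZ_add] at hNsum hPsum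
  have hneg : linZ D.P (fun c => -F c) = -linZ D.P F := by
    have h := linZ_smul D.P (-1) F
    simp only [neg_mul, one_mul] at h
    exact h
  rw [hneg] at hPsum
  have hidN : linZ D.N (fun c => F c) = linZ D.N F := rfl
  have hidPN : linZ D.N (fun c => pay Side.N c) = linZ D.N (pay Side.N) := rfl
  have hidPP : linZ D.P (fun c => pay Side.P c) = linZ D.P (pay Side.P) := rfl
  rw [hidN, hidPN] at hNsum
  rw [hidPP] at hPsum
  have hLB : L * ((((D.N.map Prod.snd).sum : ℕ) : ℤ) + ((D.P.map Prod.snd).sum : ℕ)) ≤ L * (B : ℤ) := mul_le_mul_of_nonneg_left hcop hL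
  have hρr : ρ * rmin ≤ ρ * ((((D.N.map Prod.snd).sum : ℕ) : ℤ) - ((D.P.map Prod.snd).sum : ℕ)) := mul_le_mul_of_nonneg_left hrk hρ
  nlinarith [hF, hNsum, hPsum, hpay, hclose, hLB, hρr, hMN0, hMP0]

/-- the two multiplicity lists by side -/
def mlist (D : Design) : Side → List (Cell × ℕ)
  | Side.N => D.N
  | Side.P => D.P

theorem mem_suppSide_iff (D : Design) (sd : Side) (c : Cell) : c ∈ suppSide D sd ↔ ∃ m : ℕ, (c, m) ∈ mlist D sd ∧ 0 < m := by
  cases sd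
  · exact mem_suppN_iff D c
  · exact mem_suppP_iff D c

/-- a supported cell of side `sd` on which a non-negative side functional is `≥ 1` makes `Σ_N + Σ_P ≥ 1` -/
theorem one_le_linZ_sides (D : Design) (φ : Side → Cell → ℤ) (hφ : ∀ sd c, 0 ≤ φ sd c) {sd : Side} {c₀ : Cell} (hc₀ : c₀ ∈ suppSide D sd)
    (h1 : 1 ≤ φ sd c₀) : 1 ≤ linZ D.N (φ Side.N) + linZ D.P (φ Side.P) := by
  have hN := linZ_nonneg D.N (φ Side.N) fun cm _ _ => hφ _ _
  have hP := linZ_nonneg D.P (φ Side.P) fun cm _ _ => hφ _ _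
  obtain ⟨m₀, hm₀, hpos⟩ := (mem_suppSide_iff D sd c₀).mp hc₀
  have hm1 : (1 : ℤ) ≤ m₀ := by exact_mod_cast hpos
  have ht := term_le_linZ (mlist D sd) (φ sd) (hφ sd) c₀ m₀ hm₀
  have hφ0 := hφ sd c₀
  have hge : 1 ≤ linZ (mlist D sd) (φ sd) := by nlinarith
  cases sd with
  | N => change 1 ≤ linZ D.N (φ Side.N) at hge; linarith
  | P => change 1 ≤ linZ D.P (φ Side.P) at hge; linarith

/-- (credit 1) the COVER-ROW credit `Σ_i Y_i·thr_i ≤ Σ_c m(c)·coverPay` (v7 `leaf_core` step (4), verbatim: thresholds 0 ∕ 1 ∕ 2-with-parity, caps attained in the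
region) -/
theorem coverPay_credit (Cb : BnCCert) (lf : Leaf) (D : Design)
    (hYthr : ∀ e ∈ ents Cb.vars lf, 0 ≤ e.2.Y ∧ thrOK Cb.h (allBounds Cb.vars lf) lf.laws e = true)
    (hreg : InRegion Cb.vars lf D) (hN : D.suppN ≠ []) (hP : D.suppP ≠ []) (hparity : ParityOK Cb lf D) :
    ((ents Cb.vars lf).map fun e => e.2.Y * (e.2.thr : ℤ)).sum
      ≤ linZ D.N (fun c => coverPay (ents Cb.vars lf) Side.N (typeOf c)) + linZ D.P (fun c => coverPay (ents Cb.vars lf) Side.P (typeOf c)) := by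
  have hpay : ∀ (L' : List (Cell × ℕ)) (sd : Side), linZ L' (fun c => coverPay (ents Cb.vars lf) sd (typeOf c))
      = ((ents Cb.vars lf).map fun e => e.2.Y * linZ L' (fun c => ind e sd (typeOf c))).sum := by
    intro L' sd
    unfold coverPay
    rw [linZ_sum_map L' (ents Cb.vars lf) (fun e c => e.2.Y * ind e sd (typeOf c))]
    congr 1
    refine List.map_congr_left fun e _ => ?_
    exact linZ_smul L' _ _
  rw [hpay, hpay, ← List.sum_map_add]
  have hne : ∀ sd : Side, suppSide D sd ≠ [] := by
    intro sd
    cases sd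
    · exact hN
    · exact hP
  refine List.sum_le_sum fun e he => ?_
  obtain ⟨hY, hthr⟩ := hYthr e he
  rw [← mul_add]
  apply mul_le_mul_of_nonneg_left _ hY
  have hmN : 0 ≤ linZ D.N (fun c => ind e Side.N (typeOf c)) := linZ_nonneg _ _ fun cm _ _ => ind_nonneg _ _ _
  have hmP : 0 ≤ linZ D.P (fun c => ind e Side.P (typeOf c)) := linZ_nonneg _ _ fun cm _ _ => ind_nonneg _ _ _
  simp only [thrOK, Bool.or_eq_true, decide_eq_true_eq] at hthr
  rcases hthr with h0 | hcap
  · rw [h0]; push_cast; linarith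
  · cases hc : e.2.cap with
    | none => simp only [hc] at hcap; exact absurd hcap Bool.false_ne_true
    | some k =>
      simp only [hc, Bool.or_eq_true, Bool.and_eq_true, decide_eq_true_eq] at hcap
      have hmax := hreg e he k hc
      obtain ⟨c₀, hc₀, hcnt⟩ : ∃ c₀ ∈ suppSide D e.1.side, e.1.stat.count (typeOf c₀) = k := by
        rcases hmax.2 with hk0 | hex
        · obtain ⟨c₀, hc₀⟩ := List.exists_mem_of_ne_nil _ (hne e.1.side)
          refine ⟨c₀, hc₀, ?_⟩
          have := hmax.1 c₀ hc₀
          omega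
        · exact hex
      have hge1 : 1 ≤ linZ D.N (fun c => ind e Side.N (typeOf c)) + linZ D.P (fun c => ind e Side.P (typeOf c)) := by
        have hind1 : ind e e.1.side (typeOf c₀) = 1 := by
          simp [ind, hc, attains, hcnt]
        exact one_le_linZ_sides D (fun sd c => ind e sd (typeOf c)) (fun sd c => ind_nonneg _ _ _) hc₀ (le_of_eq hind1.symm)
      rcases hcap with h1' | ⟨h2, hpar⟩
      · rw [h1']; push_cast; linarith
      · rw [h2]
        have heven := hparity e he k hc h2 hpar
        have hindk : ∀ sd : Side, (fun c => ind e sd (typeOf c)) = fun c => if attains e.1 k sd (typeOf c) then (1 : ℤ) else 0 := by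
          intro sd
          funext c
          simp [ind, hc]
        rw [hindk Side.N, hindk Side.P] at hge1 ⊢
        obtain ⟨q, hq⟩ := heven
        push_cast
        omega

/-- (credit 2) the TYPE-LITERAL credit `Σ_r (Z_r + W_r) ≤ Σ_c m(c)·presPay` (Δ2 `leafC_sound` step (4b): presence ⇒ mass `≥ 1`, (A4) ⇒ cover `≥ 1`) -/
theorem presPay_credit (D : Design) (h4 : D.A4) (pres : List Pres) (hZW : ∀ r ∈ pres, 0 ≤ r.Z ∧ 0 ≤ r.W) (hpres : ∀ r ∈ pres, Present D r.side r.τ) :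
    (pres.map fun r => r.Z + r.W).sum ≤ linZ D.N (fun c => presPay pres Side.N (typeOf c)) + linZ D.P (fun c => presPay pres Side.P (typeOf c)) := by
  rw [linZ_presPay, linZ_presPay, ← List.sum_map_add]
  refine List.sum_le_sum fun r hrm => ?_
  obtain ⟨hZ, hW⟩ := hZW r hrm
  obtain ⟨c₀, hc₀, hsame⟩ := hpres r hrm
  have hmass : 1 ≤ linZ D.N (fun c => indB (massHit r Side.N (typeOf c))) + linZ D.P (fun c => indB (massHit r Side.P (typeOf c))) :=
    one_le_linZ_sides D (fun sd c => indB (massHit r sd (typeOf c))) (fun _ _ => indB_nonneg _) hc₀ (by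
      show 1 ≤ indB (massHit r r.side (typeOf c₀))
      rw [massHit_self hsame]; simp [indB])
  have hcov : 1 ≤ linZ D.N (fun c => indB (coverHit r Side.N (typeOf c))) + linZ D.P (fun c => indB (coverHit r Side.P (typeOf c))) := by
    cases hs : r.side with
    | P =>
      rw [hs] at hc₀
      obtain ⟨y, hy, hl⟩ := h4.1 c₀ hc₀
      exact one_le_linZ_sides D (fun sd c => indB (coverHit r sd (typeOf c))) (fun _ _ => indB_nonneg _) hy (by
        show 1 ≤ indB (coverHit r Side.N (typeOf y))
        rw [coverHit_P hs hsame hl]; simp [indB])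
    | N =>
      rw [hs] at hc₀
      obtain ⟨x, hx, hl⟩ := h4.2 c₀ hc₀
      exact one_le_linZ_sides D (fun sd c => indB (coverHit r sd (typeOf c))) (fun _ _ => indB_nonneg _) hx (by
        show 1 ≤ indB (coverHit r Side.P (typeOf x))
        rw [coverHit_N hs hsame hl]; simp [indB])
  have hZ1 := mul_le_mul_of_nonneg_left hmass hZ
  have hW1 := mul_le_mul_of_nonneg_left hcov hW
  rw [mul_one, mul_add] at hZ1 hW1
  linarith

/-- (credit 3) **the KEY-LITERAL credit** `Σ_r (Z_r + W_r) ≤ Σ_c m(c)·keyPay`: a present key `(sd, τ, ℓ)` is carried by a supported cell (letter-mass count `≥ 1`),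
whose (A4) live partner on the other side lies in the multiset shadow with an amply-related letter at the same slot (letter-cover count `≥ 1`). -/
theorem keyPay_credit (D : Design) (h4 : D.A4) (kpres : List KPres) (hZW : ∀ r ∈ kpres, 0 ≤ r.Z ∧ 0 ≤ r.W)
    (hk : ∀ r ∈ kpres, KPresent D r.side r.τ r.ℓ) :
    (kpres.map fun r => r.Z + r.W).sum ≤ linZ D.N (fun c => keyPay kpres Side.N c) + linZ D.P (fun c => keyPay kpres Side.P c) := by
  rw [linZ_keyPay, linZ_keyPay, ← List.sum_map_add]
  refine List.sum_le_sum fun r hr => ?_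
  obtain ⟨hZ, hW⟩ := hZW r hr
  obtain ⟨c₀, hc₀, hs, f, hf⟩ := hk r hr
  have hmass : 1 ≤ linZ D.N (kcntM r Side.N) + linZ D.P (kcntM r Side.P) :=
    one_le_linZ_sides D (fun sd c => kcntM r sd c) (fun sd c => kcntM_nonneg r sd c) hc₀ (one_le_kcntM hs f hf)
  have hcov : 1 ≤ linZ D.N (kcntC r Side.N) + linZ D.P (kcntC r Side.P) := by
    cases hsd : r.side with
    | P =>
      rw [hsd] at hc₀
      obtain ⟨y, hy, hl⟩ := h4.1 c₀ hc₀
      exact one_le_linZ_sides D (fun sd c => kcntC r sd c) (fun sd c => kcntC_nonneg r sd c) hy (one_le_kcntC_P hsd hs f hf hl)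
    | N =>
      rw [hsd] at hc₀
      obtain ⟨x, hx, hl⟩ := h4.2 c₀ hc₀
      exact one_le_linZ_sides D (fun sd c => kcntC r sd c) (fun sd c => kcntC_nonneg r sd c) hx (one_le_kcntC_N hsd hs f hf hl)
  have hZ1 := mul_le_mul_of_nonneg_left hmass hZ
  have hW1 := mul_le_mul_of_nonneg_left hcov hW
  rw [mul_one, mul_add] at hZ1 hW1
  linarith

/-- **LEAF FARKAS («v1 + L1.5») — PROVED.**  In the region of a checked leaf whose type literals, key literals hold on an (A1)∧(A4) design with both sides non-empty,
`copies ≤ B`, `rank ≥ rmin`: contradiction.  Functional `F = Gcell γ + GE` (balanced: `G_vanishes`, `GE_balance`); pays = cover rows + type literals + keys;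
pointwise bound `checkPtK_sound`; credits (1)–(3); arithmetic `farkas_core`. -/
theorem leafK_sound (C : CertK) (lf : LeafK) (hlf : checkLeafK C lf = true) (D : Design) (h1 : D.A1) (h4 : D.A4)
    (hB : D.copies ≤ C.B) (hr : C.rmin ≤ D.rank) (hN : D.suppN ≠ []) (hP : D.suppP ≠ [])
    (hreg : InRegion C.vars lf.base D)
    (hadm : ∀ sd : Side, ∀ c' ∈ suppSide D sd, admType C.h (allBounds C.vars lf.base) sd (typeOf c') = true)
    (hlits : lf.LitsHold D) (hparity : ParityOK C.toB lf.base D) : False := by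
  obtain ⟨hbans, hpres, hkbans, hkpres⟩ := hlits
  obtain ⟨γ, _hfunc, hcore, hNall, hPall⟩ := checkLeafK_cls hlf
  simp only [checkCoreK, Bool.and_eq_true, decide_eq_true_eq, List.all_eq_true] at hcore
  obtain ⟨⟨⟨⟨⟨⟨⟨⟨_hlen, _hder⟩, hL⟩, hρ⟩, hYthr⟩, hZW⟩, hKZW⟩, hrows⟩, hclose⟩ := hcore
  have hrows' : (rowsE lf.ephi).all rowOK = true := List.all_eq_true.mpr hrows
  refine farkas_core D C.B C.rmin hB hr (fun c => Gcell γ c + GE lf.ephi c) ?_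
    (fun sd c => coverPay (ents C.vars lf.base) sd (typeOf c) + presPay lf.pres sd (typeOf c) + keyPay lf.kpres sd c)
    (((ents C.vars lf.base).map fun e => e.2.Y * (e.2.thr : ℤ)).sum + (lf.pres.map fun r => r.Z + r.W).sum + (lf.kpres.map fun r => r.Z + r.W).sum)
    lf.base.L lf.base.ρ hL hρ ?_ ?_ ?_
  · have hG := G_vanishes D h1 γ
    have hE := GE_balance D h1 lf.ephi hrows'
    rw [linZ_add, linZ_add]
    have e1 : linZ D.N (fun c => Gcell γ c) = linZ D.N (Gcell γ) := rfl
    have e2 : linZ D.P (fun c => Gcell γ c) = linZ D.P (Gcell γ) := rfl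
    have e3 : linZ D.N (fun c => GE lf.ephi c) = linZ D.N (GE lf.ephi) := rfl
    have e4 : linZ D.P (fun c => GE lf.ephi c) = linZ D.P (GE lf.ephi) := rfl
    rw [e1, e2, e3, e4]
    linarith
  · have h1c := coverPay_credit C.toB lf.base D hYthr hreg hN hP hparity
    have h2c := presPay_credit D h4 lf.pres hZW hpres
    have h3c := keyPay_credit D h4 lf.kpres hKZW hkpres
    change ((ents C.vars lf.base).map fun e => e.2.Y * (e.2.thr : ℤ)).sum
      ≤ linZ D.N (fun c => coverPay (ents C.vars lf.base) Side.N (typeOf c)) + linZ D.P (fun c => coverPay (ents C.vars lf.base) Side.P (typeOf c)) at h1c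
    simp only [linZ_add]
    linarith
  · intro sd c hc
    have hnb := banHit_false_of_banned hbans hc
    have hkb : ∀ f : Fin 4, kbanAt lf.kbans sd (typeOf c) (c f) = false := fun f => kbanAt_false_of_kbanned hkbans hc f
    cases sd with
    | N => exact checkPtK_sound hNall c (hadm Side.N c hc) hnb hkb
    | P => exact checkPtK_sound hPall c (hadm Side.P c hc) hnb hkb
  · linarith

/-! ## §16 (Δ3) The branch tree with type-literal AND key-literal nodes, and its soundness -/

/-- a branch tree: `leaf i`; `node q kids` (statistic `q` into its five values, as Δ1); `disj sd τ A B` (type literal `(sd, τ)` absent ∕ present, as Δ2);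
`kdisj sd τ ℓ A B` = branch on the KEY literal `(sd, τ, ℓ)`: `A` is checked with the key BANNED (`y[τ, σ, ℓ] = 0`), `B` with the key PRESENT (`≥ 1`). -/
inductive CTreeK where
  | leaf (i : ℕ)
  | node (q : ℕ) (kids : List CTreeK)
  | disj (sd : Side) (τ : STuple) (absent present : CTreeK)
  | kdisj (sd : Side) (τ : STuple) (ℓ : Letter) (absent present : CTreeK)

/-- the literal lists of a tree path: type literals banned ∕ present, key literals banned ∕ present -/
structure KPath where
  bans : List (Side × STuple)
  pres : List (Side × STuple)
  kbans : List KLit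
  kpres : List KLit

/-- the literals of a path HOLD on a design -/
def KPath.Holds (p : KPath) (D : Design) : Prop :=
  (∀ b ∈ p.bans, Banned D b.1 b.2) ∧ (∀ b ∈ p.pres, Present D b.1 b.2) ∧
    (∀ b ∈ p.kbans, KBanned D b.1 b.2.1 b.2.2) ∧ (∀ b ∈ p.kpres, KPresent D b.1 b.2.1 b.2.2)

/-- the empty path -/
def KPath.nil : KPath := ⟨[], [], [], []⟩

theorem KPath.nil_holds (D : Design) : KPath.nil.Holds D := ⟨by simp [KPath.nil], by simp [KPath.nil], by simp [KPath.nil], by simp [KPath.nil]⟩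

/-- syntactic membership of a key literal in a key-literal list (ONE fixed representative per multiset, as Δ2 `memLit`) -/
def memKLit (l : List KLit) (b : KLit) : Bool := l.any fun b' => decide (b'.1 = b.1) && eqT b'.2.1 b.2.1 && decide (b'.2.2 = b.2.2)

theorem memKLit_sound {l : List KLit} {b : KLit} (h : memKLit l b = true) : ∃ b' ∈ l, b'.1 = b.1 ∧ b'.2.1 = b.2.1 ∧ b'.2.2 = b.2.2 := by
  simp only [memKLit, List.any_eq_true, Bool.and_eq_true, decide_eq_true_eq] at h
  obtain ⟨b', hb', ⟨h1, h2⟩, h3⟩ := h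
  exact ⟨b', hb', h1, eqT_eq h2, h3⟩

/-- a leaf may only USE literals of its path (syntactically) and must carry EXACTLY the caps of the path -/
def leafFits (lf : LeafK) (asg : List (Option ℕ)) (p : KPath) : Bool :=
  decide (lf.base.recs.map VarRec.cap = asg) && (lf.bans.all fun b => memLit p.bans b) && (lf.pres.all fun r => memLit p.pres (r.side, r.τ)) &&
    (lf.kbans.all fun b => memKLit p.kbans b) && (lf.kpres.all fun r => memKLit p.kpres (r.side, r.τ, r.ℓ))

theorem leafFits_sound {lf : LeafK} {asg : List (Option ℕ)} {p : KPath} (h : leafFits lf asg p = true) (D : Design) (hp : p.Holds D) :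
    lf.base.recs.map VarRec.cap = asg ∧ lf.LitsHold D := by
  simp only [leafFits, Bool.and_eq_true, decide_eq_true_eq, List.all_eq_true] at h
  obtain ⟨⟨⟨⟨hcaps, hbl⟩, hpl⟩, hkbl⟩, hkpl⟩ := h
  obtain ⟨hb, hpr, hkb, hkp⟩ := hp
  refine ⟨hcaps, fun b hbm => ?_, fun r hrm => ?_, fun b hbm => ?_, fun r hrm => ?_⟩
  · obtain ⟨b', hb', h1, h2⟩ := memLit_sound (hbl b hbm)
    have := hb b' hb'
    rw [h1, h2] at this
    exact this
  · obtain ⟨b', hb', h1, h2⟩ := memLit_sound (hpl r hrm)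
    have := hpr b' hb'
    rw [h1, h2] at this
    exact this
  · obtain ⟨b', hb', h1, h2, h3⟩ := memKLit_sound (hkbl b hbm)
    have := hkb b' hb'
    rw [h1, h2, h3] at this
    exact this
  · obtain ⟨b', hb', h1, h2, h3⟩ := memKLit_sound (hkpl r hrm)
    have := hkp b' hb'
    rw [h1, h2, h3] at this
    exact this

/-- the tree cover check with fuel (Δ2 `coverTC` plus the key-literal branch `kdisj`, which pushes its key onto `kbans` ∕ `kpres`) -/
def coverTK (C : CertK) : CTreeK → ℕ → List (Option ℕ) → KPath → Bool
  | .leaf i, _, asg, p =>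
      match C.leaves[i]? with
      | some lf => leafFits lf asg p
      | none => false
  | .node _ _, 0, _, _ => false
  | .node q kids, fuel + 1, asg, p =>
      decide (q < asg.length) && decide (kids.length = 5) &&
        ((List.range 5).all fun k =>
          match kids[k]? with
          | some t => coverTK C t fuel (setAt asg q k) p
          | none => false)
  | .disj _ _ _ _, 0, _, _ => false
  | .disj sd τ A B, fuel + 1, asg, p =>
      coverTK C A fuel asg {p with bans := (sd, τ) :: p.bans} && coverTK C B fuel asg {p with pres := (sd, τ) :: p.pres}
  | .kdisj _ _ _ _ _, 0, _, _ => false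
  | .kdisj sd τ ℓ A B, fuel + 1, asg, p =>
      coverTK C A fuel asg {p with kbans := (sd, τ, ℓ) :: p.kbans} && coverTK C B fuel asg {p with kpres := (sd, τ, ℓ) :: p.kpres}

/-- the ROOT check (as Δ1 ∕ Δ2: a root `node 0` may leave the floor statistic's value-0 child unchecked); `fuel` ≥ the depth of the tree -/
def rootCoverTK (C : CertK) (t : CTreeK) (fuel : ℕ) : Bool :=
  match t with
  | .node 0 kids =>
      decide (0 < C.vars.length) && decide (kids.length = 5) &&
        ((List.range 5).all fun k => decide (k = 0) ||
          match kids[k]? with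
          | some s => coverTK C s fuel (setAt (List.replicate C.vars.length none) 0 k) KPath.nil
          | none => false)
  | _ => coverTK C t fuel (List.replicate C.vars.length none) KPath.nil

/-- **the whole-node checker** («v1 + L1.5»): floor variable first, every leaf passes `checkLeafK`, the tree covers. -/
def validTK (C : CertK) (t : CTreeK) (fuel : ℕ) : Bool :=
  decide (C.vars[0]? = some ⟨Side.P, floorStat C.h⟩) &&
  (C.leaves.all fun lf => checkLeafK C lf) &&
  rootCoverTK C t fuel

/-- **the per-REGION checker** («v1 + L1.5»): the tree covers the single cap region `caps` from the empty path. -/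
def validRK (C : CertK) (t : CTreeK) (fuel : ℕ) (caps : List (Option ℕ)) : Bool :=
  decide (caps.length = C.vars.length) &&
  (C.leaves.all fun lf => checkLeafK C lf) &&
  coverTK C t fuel caps KPath.nil

/-- soundness of the tree cover: a matching leaf whose literal facts hold on the design (excluded middle on `Present` ∕ `KPresent` at the literal nodes) -/
theorem coverTK_sound (C : CertK) (D : Design) (ks : List ℕ) (hks : ∀ k ∈ ks, k < 5) :
    ∀ (fuel : ℕ) (t : CTreeK) (asg : List (Option ℕ)) (p : KPath),
      coverTK C t fuel asg p = true →
      (asg.length = ks.length ∧ ∀ j m : ℕ, asg[j]? = some (some m) → ks[j]? = some m) → p.Holds D →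
      ∃ lf ∈ C.leaves, matchesB (lf.base.recs.map VarRec.cap) ks = true ∧ lf.LitsHold D := by
  have hleaf : ∀ (fuel i : ℕ) (asg : List (Option ℕ)) (p : KPath), coverTK C (.leaf i) fuel asg p = true →
      (asg.length = ks.length ∧ ∀ j m : ℕ, asg[j]? = some (some m) → ks[j]? = some m) → p.Holds D →
      ∃ lf ∈ C.leaves, matchesB (lf.base.recs.map VarRec.cap) ks = true ∧ lf.LitsHold D := by
    intro fuel i asg p h hag hp
    rcases hi : C.leaves[i]? with _ | lf
    · simp [coverTK, hi] at h
    · simp only [coverTK, hi] at h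
      obtain ⟨hcaps, hlits⟩ := leafFits_sound h D hp
      subst hcaps
      exact ⟨lf, List.mem_of_getElem? hi, matchesB_of_agrees hag, hlits⟩
  intro fuel
  induction fuel with
  | zero =>
      intro t asg p h hag hp
      cases t with
      | leaf i => exact hleaf 0 i asg p h hag hp
      | node q kids => simp [coverTK] at h
      | disj sd τ A B => simp [coverTK] at h
      | kdisj sd τ ℓ A B => simp [coverTK] at h
  | succ n ih =>
      intro t asg p h hag hp
      cases t with
      | leaf i => exact hleaf (n + 1) i asg p h hag hp
      | node q kids =>
          simp only [coverTK, Bool.and_eq_true, decide_eq_true_eq, List.all_eq_true] at h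
          obtain ⟨⟨hq, hlen5⟩, hall⟩ := h
          have hqk : q < ks.length := by rw [← hag.1]; exact hq
          obtain ⟨k, hk⟩ : ∃ k, ks[q]? = some k := ⟨ks[q], List.getElem?_eq_getElem hqk⟩
          have hk5 : k < 5 := hks k (List.mem_of_getElem? hk)
          have hs := hall k (List.mem_range.mpr hk5)
          obtain ⟨s, hsk⟩ : ∃ s, kids[k]? = some s := ⟨kids[k]'(by omega), List.getElem?_eq_getElem (by omega)⟩
          simp only [hsk] at hs
          exact ih s (setAt asg q k) p hs (agrees_setAt hag hk) hp
      | disj sd τ A B =>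
          simp only [coverTK, Bool.and_eq_true] at h
          obtain ⟨hA, hB⟩ := h
          obtain ⟨hb, hpr, hkb, hkp⟩ := hp
          rcases Classical.em (Present D sd τ) with hyes | hno
          · refine ih B asg _ hB hag ⟨hb, fun b hbm => ?_, hkb, hkp⟩
            rcases List.mem_cons.mp hbm with rfl | hbm
            · exact hyes
            · exact hpr b hbm
          · refine ih A asg _ hA hag ⟨fun b hbm => ?_, hpr, hkb, hkp⟩
            rcases List.mem_cons.mp hbm with rfl | hbm
            · exact banned_of_not_present hno
            · exact hb b hbm
      | kdisj sd τ ℓ A B =>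
          simp only [coverTK, Bool.and_eq_true] at h
          obtain ⟨hA, hB⟩ := h
          obtain ⟨hb, hpr, hkb, hkp⟩ := hp
          rcases Classical.em (KPresent D sd τ ℓ) with hyes | hno
          · refine ih B asg _ hB hag ⟨hb, hpr, hkb, fun b hbm => ?_⟩
            rcases List.mem_cons.mp hbm with rfl | hbm
            · exact hyes
            · exact hkp b hbm
          · refine ih A asg _ hA hag ⟨hb, hpr, fun b hbm => ?_, hkp⟩
            rcases List.mem_cons.mp hbm with rfl | hbm
            · exact kbanned_of_not_kpresent hno
            · exact hkb b hbm

/-- the root check covers every value vector with a positive floor count (coordinate 0), with the literal facts of the matching leaf -/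
theorem rootCoverTK_sound (C : CertK) (D : Design) (t : CTreeK) (fuel : ℕ) (ks : List ℕ) (h : rootCoverTK C t fuel = true)
    (hlen : ks.length = C.vars.length) (hks : ∀ k ∈ ks, k < 5) (hk0 : ks.getD 0 0 ≠ 0) :
    ∃ lf ∈ C.leaves, matchesB (lf.base.recs.map VarRec.cap) ks = true ∧ lf.LitsHold D := by
  have hag0 : ((List.replicate C.vars.length (none : Option ℕ)).length = ks.length ∧ ∀ j m : ℕ,
      (List.replicate C.vars.length (none : Option ℕ))[j]? = some (some m) → ks[j]? = some m) := by
    exact ⟨by simp [hlen], fun _ _ h => absurd (List.eq_of_mem_replicate (List.mem_of_getElem? h)) (by simp)⟩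
  have hp0 := KPath.nil_holds D
  cases t with
  | leaf i =>
      simp only [rootCoverTK] at h
      exact coverTK_sound C D ks hks _ _ _ _ h hag0 hp0
  | disj sd τ A B =>
      simp only [rootCoverTK] at h
      exact coverTK_sound C D ks hks _ _ _ _ h hag0 hp0
  | kdisj sd τ ℓ A B =>
      simp only [rootCoverTK] at h
      exact coverTK_sound C D ks hks _ _ _ _ h hag0 hp0
  | node q kids =>
      cases q with
      | succ q =>
          simp only [rootCoverTK] at h
          exact coverTK_sound C D ks hks _ _ _ _ h hag0 hp0
      | zero =>
          simp only [rootCoverTK, Bool.and_eq_true, decide_eq_true_eq, List.all_eq_true, Bool.or_eq_true] at h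
          obtain ⟨⟨hn, hlen5⟩, hall⟩ := h
          cases ks with
          | nil => simp at hlen; omega
          | cons a tl =>
              simp only [List.getD_cons_zero] at hk0
              have hk5 : a < 5 := hks a (by simp)
              have hs := hall a (List.mem_range.mpr hk5)
              rcases hs with hbad | hs
              · exact absurd hbad hk0
              obtain ⟨s, hsk⟩ : ∃ s, kids[a]? = some s := ⟨kids[a]'(by omega), List.getElem?_eq_getElem (by omega)⟩
              simp only [hsk] at hs
              exact coverTK_sound C D (a :: tl) hks _ _ _ _ hs (agrees_setAt hag0 (k := a) (q := 0) rfl) hp0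

/-! ## §17 (Δ3) The end-to-end theorems («v1 + L1.5») -/

/-- (cover) every admissible design with a floor letter lies in the region of some leaf of a valid «v1 + L1.5» certificate, whose literal facts hold on it -/
theorem region_coverTK (C : CertK) (t : CTreeK) (fuel : ℕ) (hv : validTK C t fuel = true) (D : Design) (hA : D.OnAlphabet C.h) (h4 : D.A4)
    (c : Cell) (hc : c ∈ D.suppN ++ D.suppP) (f : Fin 4) (hfloor : (c f).a = 0) :
    ∃ lf ∈ C.leaves, InRegion C.vars lf.base D ∧
      (∀ sd : Side, ∀ c' ∈ suppSide D sd, admType C.h (allBounds C.vars lf.base) sd (typeOf c') = true) ∧ lf.LitsHold D := by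
  have hv' := hv
  unfold validTK at hv'
  simp only [Bool.and_eq_true, decide_eq_true_eq] at hv'
  obtain ⟨⟨hv0, hleaves⟩, hroot⟩ := hv'
  have hS1 := static_adm C.h D hA h4
  have hcP : c ∈ D.suppP := by
    rcases List.mem_append.mp hc with hcN | hcP
    · exfalso
      obtain ⟨x, hx, hlive⟩ := h4.2 c hcN
      have hlt := (hlive f).1
      have hx0 := (hA x (List.mem_append.mpr (Or.inr hx)) f).2
      omega
    · exact hcP
  have hks5 : ∀ k ∈ C.vars.map (kOf D), k < 5 := fun k hk => by
    obtain ⟨v, _, rfl⟩ := List.mem_map.mp hk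
    exact Nat.lt_succ_of_le (kOf_le_four D v)
  have hk0 : (C.vars.map (kOf D)).getD 0 0 ≠ 0 := by
    cases hvars : C.vars with
    | nil => rw [hvars] at hv0; simp at hv0
    | cons v0 rest =>
      rw [hvars] at hv0
      simp only [List.getElem?_cons_zero, Option.some.injEq] at hv0
      subst hv0
      simp only [List.map_cons, List.getD_cons_zero]
      have hcnt : 0 < (floorStat C.h).count (typeOf c) := by
        unfold Stat.count
        refine List.length_pos_of_mem (List.mem_filter.mpr ⟨List.mem_finRange f, ?_⟩)
        refine List.elem_eq_true_of_mem (List.mem_filter.mpr ⟨by rw [admP0T_eq]; exact hS1.1 c hcP f, ?_⟩)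
        simp [Shape.isFloor, shapeOf, typeOf, hfloor]
      have hle : (floorStat C.h).count (typeOf c) ≤ kOf D ⟨Side.P, floorStat C.h⟩ :=
        (isMax_kOf D ⟨Side.P, floorStat C.h⟩).1 c hcP
      omega
  obtain ⟨lf, hlf, hmatch, hlits⟩ := rootCoverTK_sound C D t fuel (C.vars.map (kOf D)) hroot (by simp) hks5 hk0
  have hreg : InRegion C.vars lf.base D := inRegion_of_matchesB C.vars lf.base D hmatch
  have hchk : checkLeafK C lf = true := List.all_eq_true.mp hleaves lf hlf
  exact ⟨lf, hlf, hreg, adm_of_region C.toB lf.base (hder_of_checkLeafK hchk) D hA h4 hreg, hlits⟩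

/-- **SOUNDNESS (floor form): `validTK C t fuel ⇒ FloorFree h B rmin`** — parity discharged by v7 (S4) `parity_even`. -/
theorem floorFree_of_validTK (C : CertK) (t : CTreeK) (fuel : ℕ) (hv : validTK C t fuel = true) : FloorFreeH C.h C.B C.rmin := by
  intro D hA h1 h4 _hμ hB hr c hc f
  by_contra hle
  have ha0 := (hA c hc f).2
  have hfloor : (c f).a = 0 := by omega
  have hleaves : C.leaves.all (fun lf => checkLeafK C lf) = true := by
    have hv' := hv
    unfold validTK at hv'
    simp only [Bool.and_eq_true] at hv'
    exact hv'.1.2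
  have hsides : D.suppN ≠ [] ∧ D.suppP ≠ [] := by
    rcases List.mem_append.mp hc with hcN | hcP
    · obtain ⟨x, hx, _⟩ := h4.2 c hcN
      exact ⟨List.ne_nil_of_mem hcN, List.ne_nil_of_mem hx⟩
    · obtain ⟨y, hy, _⟩ := h4.1 c hcP
      exact ⟨List.ne_nil_of_mem hy, List.ne_nil_of_mem hcP⟩
  obtain ⟨lf, hlf, hreg, hadm, hlits⟩ := region_coverTK C t fuel hv D hA h4 c hc f hfloor
  have hchk : checkLeafK C lf = true := List.all_eq_true.mp hleaves lf hlf
  exact leafK_sound C lf hchk D h1 h4 hB hr hsides.1 hsides.2 hreg hadm hlits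
    (fun e _ k _ _ he => parity_even C.toB lf.base e.1 k e.2.par he D h1 hadm)

/-- **PER-REGION SOUNDNESS** («v1 + L1.5» tree over one cap region; the honest shape of «FLOOR-GRADE on one region» — NOT `FloorFree`: the other regions remain) -/
theorem regionEmpty_of_validRK (C : CertK) (t : CTreeK) (fuel : ℕ) (caps : List (Option ℕ)) (hv : validRK C t fuel caps = true)
    (D : Design) (hA : D.OnAlphabet C.h) (h1 : D.A1) (h4 : D.A4) (hB : D.copies ≤ C.B) (hr : C.rmin ≤ D.rank) (hN : D.suppN ≠ [])
    (hcaps : InCaps C.vars caps D) : False := by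
  have hv' := hv
  unfold validRK at hv'
  simp only [Bool.and_eq_true, decide_eq_true_eq] at hv'
  obtain ⟨⟨hlen, hleaves⟩, hcov⟩ := hv'
  have hP : D.suppP ≠ [] := by
    obtain ⟨y, hy⟩ := List.exists_mem_of_ne_nil _ hN
    obtain ⟨x, hx, _⟩ := h4.2 y hy
    exact List.ne_nil_of_mem hx
  have hks5 : ∀ k ∈ C.vars.map (kOf D), k < 5 := fun k hk => by
    obtain ⟨v, _, rfl⟩ := List.mem_map.mp hk
    exact Nat.lt_succ_of_le (kOf_le_four D v)
  have hag : caps.length = (C.vars.map (kOf D)).length ∧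
      ∀ j m : ℕ, caps[j]? = some (some m) → (C.vars.map (kOf D))[j]? = some m := by
    refine ⟨by simp [hlen], fun j m hj => ?_⟩
    obtain ⟨hjl, _⟩ := List.getElem?_eq_some_iff.mp hj
    obtain ⟨v, hvj⟩ : ∃ v, C.vars[j]? = some v := ⟨C.vars[j]'(by omega), List.getElem?_eq_getElem (by omega)⟩
    have hz : (List.zip C.vars caps)[j]? = some (v, some m) := List.getElem?_zip_eq_some.mpr ⟨hvj, hj⟩
    have hmax := hcaps _ (List.mem_of_getElem? hz) m rfl
    rw [List.getElem?_map, hvj]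
    exact congrArg some (isMax_unique (isMax_kOf D v) hmax)
  obtain ⟨lf, hlf, hmatch, hlits⟩ := coverTK_sound C D (C.vars.map (kOf D)) hks5 fuel t caps KPath.nil hcov hag (KPath.nil_holds D)
  have hreg : InRegion C.vars lf.base D := inRegion_of_matchesB C.vars lf.base D hmatch
  have hchk : checkLeafK C lf = true := List.all_eq_true.mp hleaves lf hlf
  have hadm := adm_of_region C.toB lf.base (hder_of_checkLeafK hchk) D hA h4 hreg
  exact leafK_sound C lf hchk D h1 h4 hB hr hN hP hreg hadm hlits
    (fun e _ k _ _ he => parity_even C.toB lf.base e.1 k e.2.par he D h1 hadm)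

/-- the same with the non-emptiness of the N-side derived from a positive rank floor (`BnCCert.suppN_ne_nil_of_rank`) -/
theorem regionEmpty_of_validRK' (C : CertK) (t : CTreeK) (fuel : ℕ) (caps : List (Option ℕ)) (hv : validRK C t fuel caps = true)
    (hpos : 0 < C.rmin) (D : Design) (hA : D.OnAlphabet C.h) (h1 : D.A1) (h4 : D.A4) (hB : D.copies ≤ C.B) (hr : C.rmin ≤ D.rank)
    (hcaps : InCaps C.vars caps D) : False :=
  regionEmpty_of_validRK C t fuel caps hv D hA h1 h4 hB hr (suppN_ne_nil_of_rank D C.rmin hr hpos) hcaps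

/-! ## §18 (Δ3) Smoke tests (FAKE leaves: caps and literal patterns; the E1 factorisation and `Q` on toy data — no LP content, nothing about designs) -/
section SmokeK

def ℓA : Letter := ⟨1, 1, 0⟩
def ℓB : Letter := ⟨1, 0, 1⟩

/-- a fake «v1 + L1.5» leaf carrying only caps and literals -/
def fakeLeafK (caps : List (Option ℕ)) (bans : List (Side × STuple)) (pres : List Pres) (kbans : List KLit) (kpres : List KPres) (ephi : List EPhi) : LeafK :=
  {base := {recs := caps.map fun c => ⟨c, 0, 0, []⟩, derived := [], func := Func.cls ⟨0, 0, 0, 0, 0, 0⟩, L := 0, ρ := 0, laws := []},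
   bans := bans, pres := pres, kbans := kbans, kpres := kpres, ephi := ephi}

/-- one variable; FLOOR = 2 is split on the type literal `(P, τ0)`, its present branch again on the KEY `(P, τ0, ℓA)`:
absent ↦ leaf 2 (type present, key banned), present ↦ leaf 3 (key present with prices, one orbit row `φ = (1,1,h)`) -/
def fakeCK : CertK :=
  {h := 6, B := 199, rmin := 8, vars := [⟨Side.P, floorStat 6⟩],
   leaves := [fakeLeafK [some 1] [] [] [] [] [], fakeLeafK [some 2] [(Side.P, τ0)] [] [] [] [],
              fakeLeafK [some 2] [] [⟨Side.P, τ0, 5, 7⟩] [(Side.P, τ0, ℓA)] [] [],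
              fakeLeafK [some 2] [] [⟨Side.P, τ0, 5, 7⟩] [] [⟨Side.P, τ0, ℓA, 3, 4⟩] [⟨(Fil.one, Fil.one, Fil.h), 2, -1⟩],
              fakeLeafK [some 3] [] [] [] [] [], fakeLeafK [some 4] [] [] [] [] []]}

def fakeTK : CTreeK :=
  .node 0 [.leaf 0, .leaf 0, .disj Side.P τ0 (.leaf 1) (.kdisj Side.P τ0 ℓA (.leaf 2) (.leaf 3)), .leaf 4, .leaf 5]

example : rootCoverTK fakeCK fakeTK 3 = true := by decide
/-- the key branch's children swapped (the key-ban leaf on the PRESENT side) is rejected -/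
example : rootCoverTK fakeCK (.node 0 [.leaf 0, .leaf 0, .disj Side.P τ0 (.leaf 1) (.kdisj Side.P τ0 ℓA (.leaf 3) (.leaf 2)), .leaf 4, .leaf 5]) 3 = false := by
  decide
/-- a leaf using a key literal that is not on its path is rejected -/
example : rootCoverTK fakeCK (.node 0 [.leaf 0, .leaf 0, .disj Side.P τ0 (.leaf 1) (.leaf 3), .leaf 4, .leaf 5]) 3 = false := by decide
/-- the per-region form over FLOOR = 2 -/
example : coverTK fakeCK (.disj Side.P τ0 (.leaf 1) (.kdisj Side.P τ0 ℓA (.leaf 2) (.leaf 3))) 2 [some 2] KPath.nil = true := by decide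
/-- the generated word rows of an orbit row are (A1).1 rows (`rowOK`), 24 of them -/
example : ((rowsE [⟨(Fil.one, Fil.one, Fil.h), 2, -1⟩]).all rowOK, (rowsE [⟨(Fil.one, Fil.one, Fil.h), 2, -1⟩]).length) = (true, 24) := by decide
/-- the separable value on toy data: `V_{(1,1,h)}(σ₁,σ₂,σ₃) = 2(a₁+a₂+a₃)`; active letter `ℓB = (1;0,1)`: `x = 0`, `y = 1` ⇒ `(2x − (−1)y)·V = V` -/
example : eTerm [⟨(Fil.one, Fil.one, Fil.h), 2, -1⟩] (sA, sB, sB) ℓB = 2 * (0 + 1 + 1) := by decide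
/-- a key ban removes exactly the banned letter from the candidates of its slot shape (here `ℓA` of shape `sB = (1,1,0)`) -/
example : ((cand [(Side.P, τ0, ℓA)] Side.P τ0 sB).length + 1 = sB.letters.length) ∧ (ℓA ∉ cand [(Side.P, τ0, ℓA)] Side.P τ0 sB) := by decide

end SmokeK

/-! # Δ4 — «v1 + L1.5 + ℤ»: INTEGER MASS literals (branching `x_τ ≤ k ∨ x_τ ≥ k+1`) and the AGGREGATED COVER rows `x_τ ≤ B·Σ_{Cov(τ)} x`

Scope (honest): the branch of an INTEGER branch-and-bound on the multiset counts `x_τ = Σ_{t ~ τ} m(t)` of one side, and the unconditional big-M cover rows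
`x_τ ≤ B · Σ_{σ ∈ Cov(τ)} x_σ` (the x-space projection of `x_τ ≤ B·y_τ`, `Σ_{Cov(τ)} x ≥ y_τ`, `y_τ ≤ 1` — the LP relaxation of hsem-4's «MILP-L1ℤ», memo-108 §3),
added to the «v1 + L1.5» leaf as prices on rows that are VALID for every (A1)∧(A4) design with `copies ≤ B` (integrality of masses; (A4) live partner).
Nothing here is a certificate; nothing is proved toward `FloorFree 6 199 8` ∕ 18881 ∕ H2 ∕ HC_AV ∕ HC_CM ∕ HC.

## §19 (Δ4) Integer mass literals and aggregated cover rows: semantics, pays, credits -/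

/-- the MASS of the multiset `τ` on side `sd`: `x_τ = Σ_{supported cells c of sd with typeOf c ~ τ} m(c)` (cibb's column value `x_τ`) -/
def massOf (D : Design) (sd : Side) (τ : STuple) : ℤ := linZ (mlist D sd) fun c => indB (sameM τ (typeOf c))

/-- the integer literal `k ≤ x_τ` -/
def MassGE (D : Design) (sd : Side) (τ : STuple) (k : ℕ) : Prop := (k : ℤ) ≤ massOf D sd τ
/-- the integer literal `x_τ ≤ k` -/
def MassLE (D : Design) (sd : Side) (τ : STuple) (k : ℕ) : Prop := massOf D sd τ ≤ k

/-- integrality: `¬ (x_τ ≤ k) ⇒ k + 1 ≤ x_τ` -/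
theorem massGE_of_not_massLE {D : Design} {sd : Side} {τ : STuple} {k : ℕ} (h : ¬ MassLE D sd τ k) : MassGE D sd τ (k + 1) := by
  unfold MassLE at h
  unfold MassGE
  push_cast
  omega

/-- an integer mass literal on a tree path: `(side, τ, k)` (in the `mles` list: `x_τ ≤ k`; in the `mges` list: `k ≤ x_τ`) -/
abbrev MLit := Side × STuple × ℕ

/-- a priced lower mass literal `k ≤ x_τ` of a leaf: price `Z ≥ 0`, credit `Z·k` -/
structure MGe where
  side : Side
  τ : STuple
  k : ℕ
  Z : ℤ

/-- a priced upper mass literal `x_τ ≤ k` of a leaf: price `U ≥ 0`, credit `−U·k` (pointwise pay `−U` on the cells of the multiset) -/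
structure MLe where
  side : Side
  τ : STuple
  k : ℕ
  U : ℤ

/-- a priced AGGREGATED COVER row `x_τ ≤ B·Σ_{σ ∈ Cov(τ)} x_σ` (unconditional; price `V ≥ 0`, credit `0`): pointwise `−V` on the cells of `τ`, `+V·B` on the other
side's cells whose type lies in `Cov(τ)` (`covUp` ∕ `covDown`, as the Δ2 presence cover row) -/
structure AggCov where
  side : Side
  τ : STuple
  V : ℤ

/-- the three new rows priced as (signed) presence records, so that their pointwise pays ARE `presPay` (Δ2) and `checkPtK` (Δ3) applies verbatim -/
def MGe.toPres (r : MGe) : Pres := ⟨r.side, r.τ, r.Z, 0⟩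
def MLe.toPres (r : MLe) : Pres := ⟨r.side, r.τ, -r.U, 0⟩
def AggCov.toPres (B : ℕ) (r : AggCov) : Pres := ⟨r.side, r.τ, -r.V, r.V * (B : ℤ)⟩

theorem indB_and (a b : Bool) : indB (a && b) = indB a * indB b := by
  cases a <;> cases b <;> simp [indB]

theorem indB_le_one (b : Bool) : indB b ≤ 1 := by
  cases b <;> simp [indB]

theorem linZ_const_zero (L' : List (Cell × ℕ)) : linZ L' (fun _ => (0 : ℤ)) = 0 := by
  have h := linZ_smul L' 0 (fun _ => (1 : ℤ))
  simp only [zero_mul] at h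
  exact h

/-- the side gate: `Σ_N [sd₀ = N]·g + Σ_P [sd₀ = P]·g = Σ_{sd₀} g` -/
theorem linZ_sides_gate (D : Design) (sd₀ : Side) (g : Cell → ℤ) :
    linZ D.N (fun c => indB (decide (sd₀ = Side.N)) * g c) + linZ D.P (fun c => indB (decide (sd₀ = Side.P)) * g c) = linZ (mlist D sd₀) g := by
  cases sd₀ with
  | N =>
    have h1 : (fun c => indB (decide (Side.N = Side.N)) * g c) = g := by funext c; simp [indB]
    have h2 : (fun c => indB (decide (Side.N = Side.P)) * g c) = fun _ => (0 : ℤ) := by funext c; simp [indB]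
    rw [h1, h2, linZ_const_zero]
    simp [mlist]
  | P =>
    have h1 : (fun c => indB (decide (Side.P = Side.N)) * g c) = fun _ => (0 : ℤ) := by funext c; simp [indB]
    have h2 : (fun c => indB (decide (Side.P = Side.P)) * g c) = g := by funext c; simp [indB]
    rw [h1, h2, linZ_const_zero]
    simp [mlist]

/-- the two-sided mass pay of a presence record is the mass of its multiset on its side -/
theorem linZ_sides_massHit (D : Design) (r : Pres) :
    linZ D.N (fun c => indB (massHit r Side.N (typeOf c))) + linZ D.P (fun c => indB (massHit r Side.P (typeOf c))) = massOf D r.side r.τ := by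
  simp only [massHit, indB_and]
  exact linZ_sides_gate D r.side _

/-- `x_τ ≤ copies` -/
theorem massOf_le_copies (D : Design) (sd : Side) (τ : STuple) : massOf D sd τ ≤ D.copies := by
  have h1 := linZ_le_mul_sum (mlist D sd) (fun c => indB (sameM τ (typeOf c))) 1 (fun cm _ _ => indB_le_one _)
  rw [one_mul] at h1
  have h2 : (((mlist D sd).map Prod.snd).sum : ℕ) ≤ D.copies := by
    unfold Design.copies
    cases sd with
    | N => exact Nat.le_add_right _ _
    | P => exact Nat.le_add_left _ _
  have h3 : ((((mlist D sd).map Prod.snd).sum : ℕ) : ℤ) ≤ (D.copies : ℤ) := by exact_mod_cast h2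
  unfold massOf
  linarith

/-- a banned multiset has mass `≤ 0` -/
theorem massOf_nonpos_of_banned {D : Design} {sd : Side} {τ : STuple} (hb : Banned D sd τ) : massOf D sd τ ≤ 0 := by
  have h1 := linZ_le_mul_sum (mlist D sd) (fun c => indB (sameM τ (typeOf c))) 0 (fun cm hcm hpos => by
    have hc : cm.1 ∈ suppSide D sd := (mem_suppSide_iff D sd cm.1).mpr ⟨cm.2, hcm, hpos⟩
    show indB (sameM τ (typeOf cm.1)) ≤ 0
    rw [hb cm.1 hc]
    simp [indB])
  rw [zero_mul] at h1
  exact h1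

theorem presPay_append (l₁ l₂ : List Pres) (sd : Side) (t : STuple) : presPay (l₁ ++ l₂) sd t = presPay l₁ sd t + presPay l₂ sd t := by
  simp [presPay, List.map_append, List.sum_append]

/-- (credit 4) lower mass literals: `Σ_r Z_r·k_r ≤ Σ_c m(c)·pay` -/
theorem mge_credit (D : Design) (mges : List MGe) (hZ : ∀ r ∈ mges, 0 ≤ r.Z) (hm : ∀ r ∈ mges, MassGE D r.side r.τ r.k) :
    (mges.map fun r => r.Z * (r.k : ℤ)).sum ≤
      linZ D.N (fun c => presPay (mges.map MGe.toPres) Side.N (typeOf c)) + linZ D.P (fun c => presPay (mges.map MGe.toPres) Side.P (typeOf c)) := by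
  rw [linZ_presPay, linZ_presPay, ← List.sum_map_add, List.map_map]
  refine List.sum_le_sum fun r hr => ?_
  have hmass := linZ_sides_massHit D r.toPres
  have hk : (r.k : ℤ) ≤ linZ D.N (fun c => indB (massHit r.toPres Side.N (typeOf c))) + linZ D.P (fun c => indB (massHit r.toPres Side.P (typeOf c))) := by
    rw [hmass]; exact hm r hr
  have h1 := mul_le_mul_of_nonneg_left hk (hZ r hr)
  have eZ : r.toPres.Z = r.Z := rfl
  have eW : r.toPres.W = 0 := rfl
  simp only [Function.comp_apply, eZ, eW, zero_mul, add_zero]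
  linarith

theorem mles_sum_neg (l : List MLe) : (l.map fun r => -(r.U * (r.k : ℤ))).sum = -(l.map fun r => r.U * (r.k : ℤ)).sum := by
  induction l with
  | nil => simp
  | cons a t ih => simp only [List.map_cons, List.sum_cons, ih]; ring

/-- (credit 5) upper mass literals: `−Σ_r U_r·k_r ≤ Σ_c m(c)·pay` -/
theorem mle_credit (D : Design) (mles : List MLe) (hU : ∀ r ∈ mles, 0 ≤ r.U) (hm : ∀ r ∈ mles, MassLE D r.side r.τ r.k) :
    -(mles.map fun r => r.U * (r.k : ℤ)).sum ≤
      linZ D.N (fun c => presPay (mles.map MLe.toPres) Side.N (typeOf c)) + linZ D.P (fun c => presPay (mles.map MLe.toPres) Side.P (typeOf c)) := by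
  rw [← mles_sum_neg, linZ_presPay, linZ_presPay, ← List.sum_map_add, List.map_map]
  refine List.sum_le_sum fun r hr => ?_
  have hmass := linZ_sides_massHit D r.toPres
  have hk : linZ D.N (fun c => indB (massHit r.toPres Side.N (typeOf c))) + linZ D.P (fun c => indB (massHit r.toPres Side.P (typeOf c))) ≤ r.k := by
    rw [hmass]; exact hm r hr
  have h1 := mul_le_mul_of_nonneg_left hk (hU r hr)
  have eZ : r.toPres.Z = -r.U := rfl
  have eW : r.toPres.W = 0 := rfl
  simp only [Function.comp_apply, eZ, eW, zero_mul, add_zero]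
  linarith

/-- (credit 6) aggregated cover rows: `0 ≤ Σ_c m(c)·pay`, i.e. `x_τ ≤ B·Σ_{Cov(τ)} x` on every (A4) design with `copies ≤ B`: if `τ` is present its (A4) live partner
gives `Σ_{Cov(τ)} x ≥ 1`, so `B·Σ ≥ B ≥ copies ≥ x_τ`; if absent, `x_τ = 0`. -/
theorem agg_credit (D : Design) (h4 : D.A4) (B : ℕ) (hB : D.copies ≤ B) (aggs : List AggCov) (hV : ∀ r ∈ aggs, 0 ≤ r.V) :
    0 ≤ linZ D.N (fun c => presPay (aggs.map (AggCov.toPres B)) Side.N (typeOf c)) + linZ D.P (fun c => presPay (aggs.map (AggCov.toPres B)) Side.P (typeOf c)) := by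
  rw [linZ_presPay, linZ_presPay, ← List.sum_map_add, List.map_map]
  refine List.sum_nonneg ?_
  intro v hv
  obtain ⟨r, hr, rfl⟩ := List.mem_map.mp hv
  have hmass := linZ_sides_massHit D (r.toPres B)
  have eS : (r.toPres B).side = r.side := rfl
  have eT : (r.toPres B).τ = r.τ := rfl
  have eZ : (r.toPres B).Z = -r.V := rfl
  have eW : (r.toPres B).W = r.V * (B : ℤ) := rfl
  rw [eS, eT] at hmass
  have hcov0 : 0 ≤ linZ D.N (fun c => indB (coverHit (r.toPres B) Side.N (typeOf c))) + linZ D.P (fun c => indB (coverHit (r.toPres B) Side.P (typeOf c))) := by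
    have a := linZ_nonneg D.N (fun c => indB (coverHit (r.toPres B) Side.N (typeOf c))) fun _ _ _ => indB_nonneg _
    have b := linZ_nonneg D.P (fun c => indB (coverHit (r.toPres B) Side.P (typeOf c))) fun _ _ _ => indB_nonneg _
    linarith
  have hB' : (D.copies : ℤ) ≤ (B : ℤ) := by exact_mod_cast hB
  have hmc := massOf_le_copies D r.side r.τ
  have hkey : massOf D r.side r.τ ≤ (B : ℤ) * (linZ D.N (fun c => indB (coverHit (r.toPres B) Side.N (typeOf c)))
      + linZ D.P (fun c => indB (coverHit (r.toPres B) Side.P (typeOf c)))) := by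
    rcases Classical.em (Present D r.side r.τ) with ⟨c₀, hc₀, hsame⟩ | hno
    · have hcov : 1 ≤ linZ D.N (fun c => indB (coverHit (r.toPres B) Side.N (typeOf c))) + linZ D.P (fun c => indB (coverHit (r.toPres B) Side.P (typeOf c))) := by
        cases hs : r.side with
        | P =>
          rw [hs] at hc₀
          obtain ⟨y, hy, hl⟩ := h4.1 c₀ hc₀
          exact one_le_linZ_sides D (fun sd c => indB (coverHit (r.toPres B) sd (typeOf c))) (fun _ _ => indB_nonneg _) hy (by
            show 1 ≤ indB (coverHit (r.toPres B) Side.N (typeOf y))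
            rw [coverHit_P (show (r.toPres B).side = Side.P from hs) hsame hl]; simp [indB])
        | N =>
          rw [hs] at hc₀
          obtain ⟨x, hx, hl⟩ := h4.2 c₀ hc₀
          exact one_le_linZ_sides D (fun sd c => indB (coverHit (r.toPres B) sd (typeOf c))) (fun _ _ => indB_nonneg _) hx (by
            show 1 ≤ indB (coverHit (r.toPres B) Side.P (typeOf x))
            rw [coverHit_N (show (r.toPres B).side = Side.N from hs) hsame hl]; simp [indB])
      have hB0 : (0 : ℤ) ≤ (B : ℤ) := by positivity
      have := mul_le_mul_of_nonneg_left hcov hB0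
      linarith
    · have := massOf_nonpos_of_banned (banned_of_not_present hno)
      have hB0 : (0 : ℤ) ≤ (B : ℤ) := by positivity
      nlinarith
  have h1 := mul_le_mul_of_nonneg_left (sub_nonneg.mpr hkey) (hV r hr)
  simp only [Function.comp_apply, eZ, eW]
  rw [← hmass] at h1
  nlinarith [h1]

/-! ## §20 (Δ4) Leaves, certificates, the leaf check and its soundness -/

/-- a «v1 + L1.5 + ℤ» leaf: a «v1 + L1.5» leaf plus priced mass literals of its path and priced aggregated cover rows -/
structure LeafM where
  core : LeafK
  mges : List MGe
  mles : List MLe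
  aggs : List AggCov

structure CertM where
  h : ℕ
  B : ℕ
  rmin : ℤ
  vars : List Var
  leaves : List LeafM

def CertM.toB (C : CertM) : BnCCert := ⟨C.h, C.B, C.rmin, C.vars, C.leaves.map fun lf => lf.core.base⟩

/-- the EFFECTIVE presence list: the type literals' records, then the three new row kinds priced as signed presence records -/
def LeafM.presEff (B : ℕ) (lf : LeafM) : List Pres :=
  lf.core.pres ++ (lf.mges.map MGe.toPres ++ (lf.mles.map MLe.toPres ++ lf.aggs.map (AggCov.toPres B)))

/-- the literal facts of a leaf HOLD on a design (the aggregated cover rows are unconditional) -/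
def LeafM.LitsHold (lf : LeafM) (D : Design) : Prop :=
  lf.core.LitsHold D ∧ (∀ r ∈ lf.mges, MassGE D r.side r.τ r.k) ∧ (∀ r ∈ lf.mles, MassLE D r.side r.τ r.k)

def checkCoreM (C : CertM) (lf : LeafM) : Bool :=
  let E := ents C.vars lf.core.base
  let bs := allBounds C.vars lf.core.base
  decide (lf.core.base.recs.length = C.vars.length) &&
  checkDerivedAll C.h (primaryBounds E) lf.core.base.derived &&
  decide (0 ≤ lf.core.base.L) && decide (0 ≤ lf.core.base.ρ) &&
  (E.all fun e => decide (0 ≤ e.2.Y) && thrOK C.h bs lf.core.base.laws e) &&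
  (lf.core.pres.all fun r => decide (0 ≤ r.Z) && decide (0 ≤ r.W)) &&
  (lf.core.kpres.all fun r => decide (0 ≤ r.Z) && decide (0 ≤ r.W)) &&
  (lf.mges.all fun r => decide (0 ≤ r.Z)) &&
  (lf.mles.all fun r => decide (0 ≤ r.U)) &&
  (lf.aggs.all fun r => decide (0 ≤ r.V)) &&
  (rowsE lf.core.ephi).all rowOK &&
  decide (lf.core.base.L * (C.B : ℤ) < (E.map fun e => e.2.Y * (e.2.thr : ℤ)).sum + lf.core.base.ρ * C.rmin
    + (lf.core.pres.map fun r => r.Z + r.W).sum + (lf.core.kpres.map fun r => r.Z + r.W).sum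
    + (lf.mges.map fun r => r.Z * (r.k : ℤ)).sum - (lf.mles.map fun r => r.U * (r.k : ℤ)).sum)

/-- **leaf check** («v1 + L1.5 + ℤ»): the core conjuncts, and Δ3's type-level pointwise check run with the EFFECTIVE presence list -/
def checkLeafM (C : CertM) (lf : LeafM) : Bool :=
  match lf.core.base.func with
  | Func.cls γ =>
      checkCoreM C lf &&
      checkPtK C.h (allBounds C.vars lf.core.base) (ents C.vars lf.core.base) γ lf.core.base.L lf.core.base.ρ lf.core.bans (lf.presEff C.B)
        lf.core.kbans lf.core.kpres lf.core.ephi Side.N &&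
      checkPtK C.h (allBounds C.vars lf.core.base) (ents C.vars lf.core.base) γ lf.core.base.L lf.core.base.ρ lf.core.bans (lf.presEff C.B)
        lf.core.kbans lf.core.kpres lf.core.ephi Side.P
  | Func.cell _ => false

theorem checkLeafM_cls {C : CertM} {lf : LeafM} (h : checkLeafM C lf = true) :
    ∃ γ : Coefs, lf.core.base.func = Func.cls γ ∧ checkCoreM C lf = true ∧
      checkPtK C.h (allBounds C.vars lf.core.base) (ents C.vars lf.core.base) γ lf.core.base.L lf.core.base.ρ lf.core.bans (lf.presEff C.B)
        lf.core.kbans lf.core.kpres lf.core.ephi Side.N = true ∧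
      checkPtK C.h (allBounds C.vars lf.core.base) (ents C.vars lf.core.base) γ lf.core.base.L lf.core.base.ρ lf.core.bans (lf.presEff C.B)
        lf.core.kbans lf.core.kpres lf.core.ephi Side.P = true := by
  unfold checkLeafM at h
  split at h
  · rename_i γ hγ
    simp only [Bool.and_eq_true] at h
    exact ⟨γ, hγ, h.1.1, h.1.2, h.2⟩
  · exact absurd h Bool.false_ne_true

theorem hder_of_checkLeafM {C : CertM} {lf : LeafM} (h : checkLeafM C lf = true) :
    checkDerivedAll C.h (primaryBounds (ents C.vars lf.core.base)) lf.core.base.derived = true := by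
  obtain ⟨γ, _, hcore, _, _⟩ := checkLeafM_cls h
  simp only [checkCoreM, Bool.and_eq_true, decide_eq_true_eq] at hcore
  obtain ⟨⟨⟨⟨⟨⟨⟨⟨⟨⟨⟨_, hder⟩, _⟩, _⟩, _⟩, _⟩, _⟩, _⟩, _⟩, _⟩, _⟩, _⟩ := hcore
  exact hder

/-- **LEAF FARKAS («v1 + L1.5 + ℤ») — PROVED.** As `leafK_sound`, with the effective presence list: credits (1)–(3) of Δ3 plus (4) `Σ Z·k` (lower mass literals),
(5) `−Σ U·k` (upper mass literals), (6) `0` (aggregated cover rows, using `copies ≤ B`). -/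
theorem leafM_sound (C : CertM) (lf : LeafM) (hlf : checkLeafM C lf = true) (D : Design) (h1 : D.A1) (h4 : D.A4)
    (hB : D.copies ≤ C.B) (hr : C.rmin ≤ D.rank) (hN : D.suppN ≠ []) (hP : D.suppP ≠ [])
    (hreg : InRegion C.vars lf.core.base D)
    (hadm : ∀ sd : Side, ∀ c' ∈ suppSide D sd, admType C.h (allBounds C.vars lf.core.base) sd (typeOf c') = true)
    (hlits : lf.LitsHold D) (hparity : ParityOK C.toB lf.core.base D) : False := by
  obtain ⟨⟨hbans, hpres, hkbans, hkpres⟩, hmges, hmles⟩ := hlits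
  obtain ⟨γ, _hfunc, hcore, hNall, hPall⟩ := checkLeafM_cls hlf
  simp only [checkCoreM, Bool.and_eq_true, decide_eq_true_eq, List.all_eq_true] at hcore
  obtain ⟨⟨⟨⟨⟨⟨⟨⟨⟨⟨⟨_hlen, _hder⟩, hL⟩, hρ⟩, hYthr⟩, hZW⟩, hKZW⟩, hMZ⟩, hMU⟩, hAV⟩, hrows⟩, hclose⟩ := hcore
  have hrows' : (rowsE lf.core.ephi).all rowOK = true := List.all_eq_true.mpr hrows
  refine farkas_core D C.B C.rmin hB hr (fun c => Gcell γ c + GE lf.core.ephi c) ?_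
    (fun sd c => coverPay (ents C.vars lf.core.base) sd (typeOf c) + presPay (lf.presEff C.B) sd (typeOf c) + keyPay lf.core.kpres sd c)
    (((ents C.vars lf.core.base).map fun e => e.2.Y * (e.2.thr : ℤ)).sum + (lf.core.pres.map fun r => r.Z + r.W).sum
      + (lf.core.kpres.map fun r => r.Z + r.W).sum + (lf.mges.map fun r => r.Z * (r.k : ℤ)).sum - (lf.mles.map fun r => r.U * (r.k : ℤ)).sum)
    lf.core.base.L lf.core.base.ρ hL hρ ?_ ?_ ?_
  · have hG := G_vanishes D h1 γ
    have hE := GE_balance D h1 lf.core.ephi hrows'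
    rw [linZ_add, linZ_add]
    have e1 : linZ D.N (fun c => Gcell γ c) = linZ D.N (Gcell γ) := rfl
    have e2 : linZ D.P (fun c => Gcell γ c) = linZ D.P (Gcell γ) := rfl
    have e3 : linZ D.N (fun c => GE lf.core.ephi c) = linZ D.N (GE lf.core.ephi) := rfl
    have e4 : linZ D.P (fun c => GE lf.core.ephi c) = linZ D.P (GE lf.core.ephi) := rfl
    rw [e1, e2, e3, e4]
    linarith
  · have h1c := coverPay_credit C.toB lf.core.base D hYthr hreg hN hP hparity
    have h2c := presPay_credit D h4 lf.core.pres hZW hpres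
    have h3c := keyPay_credit D h4 lf.core.kpres hKZW hkpres
    have h4c := mge_credit D lf.mges hMZ hmges
    have h5c := mle_credit D lf.mles hMU hmles
    have h6c := agg_credit D h4 C.B hB lf.aggs hAV
    change ((ents C.vars lf.core.base).map fun e => e.2.Y * (e.2.thr : ℤ)).sum
      ≤ linZ D.N (fun c => coverPay (ents C.vars lf.core.base) Side.N (typeOf c)) + linZ D.P (fun c => coverPay (ents C.vars lf.core.base) Side.P (typeOf c))
      at h1c
    simp only [LeafM.presEff, presPay_append, linZ_add]
    linarith
  · intro sd c hc
    have hnb := banHit_false_of_banned hbans hc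
    have hkb : ∀ f : Fin 4, kbanAt lf.core.kbans sd (typeOf c) (c f) = false := fun f => kbanAt_false_of_kbanned hkbans hc f
    cases sd with
    | N => exact checkPtK_sound hNall c (hadm Side.N c hc) hnb hkb
    | P => exact checkPtK_sound hPall c (hadm Side.P c hc) hnb hkb
  · linarith

/-! ## §21 (Δ4) The branch tree with statistic, type-literal, key-literal and INTEGER-MASS nodes, and its soundness -/

/-- Δ3's tree plus `mdisj sd τ k A B` = the integer branch `x_τ ≤ k` (child `A`) ∕ `x_τ ≥ k + 1` (child `B`) -/
inductive CTreeM where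
  | leaf (i : ℕ)
  | node (q : ℕ) (kids : List CTreeM)
  | disj (sd : Side) (τ : STuple) (absent present : CTreeM)
  | kdisj (sd : Side) (τ : STuple) (ℓ : Letter) (absent present : CTreeM)
  | mdisj (sd : Side) (τ : STuple) (k : ℕ) (atMost atLeast : CTreeM)

structure MPath where
  bans : List (Side × STuple)
  pres : List (Side × STuple)
  kbans : List KLit
  kpres : List KLit
  mles : List MLit
  mges : List MLit

def MPath.toK (p : MPath) : KPath := ⟨p.bans, p.pres, p.kbans, p.kpres⟩

def MPath.Holds (p : MPath) (D : Design) : Prop :=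
  p.toK.Holds D ∧ (∀ b ∈ p.mles, MassLE D b.1 b.2.1 b.2.2) ∧ (∀ b ∈ p.mges, MassGE D b.1 b.2.1 b.2.2)

def MPath.nil : MPath := ⟨[], [], [], [], [], []⟩

theorem MPath.nil_holds (D : Design) : MPath.nil.Holds D := ⟨KPath.nil_holds D, by simp [MPath.nil], by simp [MPath.nil]⟩

def memMLit (l : List MLit) (b : MLit) : Bool := l.any fun b' => decide (b'.1 = b.1) && eqT b'.2.1 b.2.1 && decide (b'.2.2 = b.2.2)

theorem memMLit_sound {l : List MLit} {b : MLit} (h : memMLit l b = true) : ∃ b' ∈ l, b'.1 = b.1 ∧ b'.2.1 = b.2.1 ∧ b'.2.2 = b.2.2 := by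
  simp only [memMLit, List.any_eq_true, Bool.and_eq_true, decide_eq_true_eq] at h
  obtain ⟨b', hb', ⟨h1, h2⟩, h3⟩ := h
  exact ⟨b', hb', h1, eqT_eq h2, h3⟩

/-- a leaf fits a path: Δ3's `leafFits` for its core, and its mass literals are (syntactically) on the path -/
def leafFitsM (lf : LeafM) (asg : List (Option ℕ)) (p : MPath) : Bool :=
  leafFits lf.core asg p.toK && (lf.mges.all fun r => memMLit p.mges (r.side, r.τ, r.k)) && (lf.mles.all fun r => memMLit p.mles (r.side, r.τ, r.k))

theorem leafFitsM_sound {lf : LeafM} {asg : List (Option ℕ)} {p : MPath} (h : leafFitsM lf asg p = true) (D : Design) (hp : p.Holds D) :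
    lf.core.base.recs.map VarRec.cap = asg ∧ lf.LitsHold D := by
  simp only [leafFitsM, Bool.and_eq_true, List.all_eq_true] at h
  obtain ⟨⟨hK, hge⟩, hle⟩ := h
  obtain ⟨hpK, hple, hpge⟩ := hp
  obtain ⟨hcaps, hlitsK⟩ := leafFits_sound hK D hpK
  refine ⟨hcaps, hlitsK, fun r hr => ?_, fun r hr => ?_⟩
  · obtain ⟨b', hb', h1, h2, h3⟩ := memMLit_sound (hge r hr)
    have := hpge b' hb'
    rw [h1, h2, h3] at this
    exact this
  · obtain ⟨b', hb', h1, h2, h3⟩ := memMLit_sound (hle r hr)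
    have := hple b' hb'
    rw [h1, h2, h3] at this
    exact this

/-- the tree cover check with fuel (Δ3 `coverTK` plus the integer branch, which pushes `(sd, τ, k)` onto `mles` ∕ `(sd, τ, k+1)` onto `mges`) -/
def coverTM (C : CertM) : CTreeM → ℕ → List (Option ℕ) → MPath → Bool
  | .leaf i, _, asg, p =>
      match C.leaves[i]? with
      | some lf => leafFitsM lf asg p
      | none => false
  | .node _ _, 0, _, _ => false
  | .node q kids, fuel + 1, asg, p =>
      decide (q < asg.length) && decide (kids.length = 5) &&
        ((List.range 5).all fun k =>
          match kids[k]? with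
          | some t => coverTM C t fuel (setAt asg q k) p
          | none => false)
  | .disj _ _ _ _, 0, _, _ => false
  | .disj sd τ A B, fuel + 1, asg, p =>
      coverTM C A fuel asg {p with bans := (sd, τ) :: p.bans} && coverTM C B fuel asg {p with pres := (sd, τ) :: p.pres}
  | .kdisj _ _ _ _ _, 0, _, _ => false
  | .kdisj sd τ ℓ A B, fuel + 1, asg, p =>
      coverTM C A fuel asg {p with kbans := (sd, τ, ℓ) :: p.kbans} && coverTM C B fuel asg {p with kpres := (sd, τ, ℓ) :: p.kpres}
  | .mdisj _ _ _ _ _, 0, _, _ => false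
  | .mdisj sd τ k A B, fuel + 1, asg, p =>
      coverTM C A fuel asg {p with mles := (sd, τ, k) :: p.mles} && coverTM C B fuel asg {p with mges := (sd, τ, k + 1) :: p.mges}

def rootCoverTM (C : CertM) (t : CTreeM) (fuel : ℕ) : Bool :=
  match t with
  | .node 0 kids =>
      decide (0 < C.vars.length) && decide (kids.length = 5) &&
        ((List.range 5).all fun k => decide (k = 0) ||
          match kids[k]? with
          | some s => coverTM C s fuel (setAt (List.replicate C.vars.length none) 0 k) MPath.nil
          | none => false)
  | _ => coverTM C t fuel (List.replicate C.vars.length none) MPath.nil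

/-- **the whole-node checker** («v1 + L1.5 + ℤ») -/
def validTM (C : CertM) (t : CTreeM) (fuel : ℕ) : Bool :=
  decide (C.vars[0]? = some ⟨Side.P, floorStat C.h⟩) &&
  (C.leaves.all fun lf => checkLeafM C lf) &&
  rootCoverTM C t fuel

/-- **the per-REGION checker** («v1 + L1.5 + ℤ») -/
def validRM (C : CertM) (t : CTreeM) (fuel : ℕ) (caps : List (Option ℕ)) : Bool :=
  decide (caps.length = C.vars.length) &&
  (C.leaves.all fun lf => checkLeafM C lf) &&
  coverTM C t fuel caps MPath.nil

theorem coverTM_sound (C : CertM) (D : Design) (ks : List ℕ) (hks : ∀ k ∈ ks, k < 5) :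
    ∀ (fuel : ℕ) (t : CTreeM) (asg : List (Option ℕ)) (p : MPath),
      coverTM C t fuel asg p = true →
      (asg.length = ks.length ∧ ∀ j m : ℕ, asg[j]? = some (some m) → ks[j]? = some m) → p.Holds D →
      ∃ lf ∈ C.leaves, matchesB (lf.core.base.recs.map VarRec.cap) ks = true ∧ lf.LitsHold D := by
  have hleaf : ∀ (fuel i : ℕ) (asg : List (Option ℕ)) (p : MPath), coverTM C (.leaf i) fuel asg p = true →
      (asg.length = ks.length ∧ ∀ j m : ℕ, asg[j]? = some (some m) → ks[j]? = some m) → p.Holds D →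
      ∃ lf ∈ C.leaves, matchesB (lf.core.base.recs.map VarRec.cap) ks = true ∧ lf.LitsHold D := by
    intro fuel i asg p h hag hp
    rcases hi : C.leaves[i]? with _ | lf
    · simp [coverTM, hi] at h
    · simp only [coverTM, hi] at h
      obtain ⟨hcaps, hlits⟩ := leafFitsM_sound h D hp
      subst hcaps
      exact ⟨lf, List.mem_of_getElem? hi, matchesB_of_agrees hag, hlits⟩
  intro fuel
  induction fuel with
  | zero =>
      intro t asg p h hag hp
      cases t with
      | leaf i => exact hleaf 0 i asg p h hag hp
      | node q kids => simp [coverTM] at h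
      | disj sd τ A B => simp [coverTM] at h
      | kdisj sd τ ℓ A B => simp [coverTM] at h
      | mdisj sd τ k A B => simp [coverTM] at h
  | succ n ih =>
      intro t asg p h hag hp
      cases t with
      | leaf i => exact hleaf (n + 1) i asg p h hag hp
      | node q kids =>
          simp only [coverTM, Bool.and_eq_true, decide_eq_true_eq, List.all_eq_true] at h
          obtain ⟨⟨hq, hlen5⟩, hall⟩ := h
          have hqk : q < ks.length := by rw [← hag.1]; exact hq
          obtain ⟨k, hk⟩ : ∃ k, ks[q]? = some k := ⟨ks[q], List.getElem?_eq_getElem hqk⟩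
          have hk5 : k < 5 := hks k (List.mem_of_getElem? hk)
          have hs := hall k (List.mem_range.mpr hk5)
          obtain ⟨s, hsk⟩ : ∃ s, kids[k]? = some s := ⟨kids[k]'(by omega), List.getElem?_eq_getElem (by omega)⟩
          simp only [hsk] at hs
          exact ih s (setAt asg q k) p hs (agrees_setAt hag hk) hp
      | disj sd τ A B =>
          simp only [coverTM, Bool.and_eq_true] at h
          obtain ⟨hA, hB⟩ := h
          obtain ⟨⟨hb, hpr, hkb, hkp⟩, hle, hge⟩ := hp
          rcases Classical.em (Present D sd τ) with hyes | hno
          · refine ih B asg _ hB hag ⟨⟨hb, fun b hbm => ?_, hkb, hkp⟩, hle, hge⟩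
            rcases List.mem_cons.mp hbm with rfl | hbm
            · exact hyes
            · exact hpr b hbm
          · refine ih A asg _ hA hag ⟨⟨fun b hbm => ?_, hpr, hkb, hkp⟩, hle, hge⟩
            rcases List.mem_cons.mp hbm with rfl | hbm
            · exact banned_of_not_present hno
            · exact hb b hbm
      | kdisj sd τ ℓ A B =>
          simp only [coverTM, Bool.and_eq_true] at h
          obtain ⟨hA, hB⟩ := h
          obtain ⟨⟨hb, hpr, hkb, hkp⟩, hle, hge⟩ := hp
          rcases Classical.em (KPresent D sd τ ℓ) with hyes | hno
          · refine ih B asg _ hB hag ⟨⟨hb, hpr, hkb, fun b hbm => ?_⟩, hle, hge⟩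
            rcases List.mem_cons.mp hbm with rfl | hbm
            · exact hyes
            · exact hkp b hbm
          · refine ih A asg _ hA hag ⟨⟨hb, hpr, fun b hbm => ?_, hkp⟩, hle, hge⟩
            rcases List.mem_cons.mp hbm with rfl | hbm
            · exact kbanned_of_not_kpresent hno
            · exact hkb b hbm
      | mdisj sd τ k A B =>
          simp only [coverTM, Bool.and_eq_true] at h
          obtain ⟨hA, hB⟩ := h
          obtain ⟨hK, hle, hge⟩ := hp
          rcases Classical.em (MassLE D sd τ k) with hyes | hno
          · refine ih A asg _ hA hag ⟨hK, fun b hbm => ?_, hge⟩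
            rcases List.mem_cons.mp hbm with rfl | hbm
            · exact hyes
            · exact hle b hbm
          · refine ih B asg _ hB hag ⟨hK, hle, fun b hbm => ?_⟩
            rcases List.mem_cons.mp hbm with rfl | hbm
            · exact massGE_of_not_massLE hno
            · exact hge b hbm

theorem rootCoverTM_sound (C : CertM) (D : Design) (t : CTreeM) (fuel : ℕ) (ks : List ℕ) (h : rootCoverTM C t fuel = true)
    (hlen : ks.length = C.vars.length) (hks : ∀ k ∈ ks, k < 5) (hk0 : ks.getD 0 0 ≠ 0) :
    ∃ lf ∈ C.leaves, matchesB (lf.core.base.recs.map VarRec.cap) ks = true ∧ lf.LitsHold D := by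
  have hag0 : ((List.replicate C.vars.length (none : Option ℕ)).length = ks.length ∧ ∀ j m : ℕ,
      (List.replicate C.vars.length (none : Option ℕ))[j]? = some (some m) → ks[j]? = some m) := by
    exact ⟨by simp [hlen], fun _ _ h => absurd (List.eq_of_mem_replicate (List.mem_of_getElem? h)) (by simp)⟩
  have hp0 := MPath.nil_holds D
  cases t with
  | leaf i =>
      simp only [rootCoverTM] at h
      exact coverTM_sound C D ks hks _ _ _ _ h hag0 hp0
  | disj sd τ A B =>
      simp only [rootCoverTM] at h
      exact coverTM_sound C D ks hks _ _ _ _ h hag0 hp0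
  | kdisj sd τ ℓ A B =>
      simp only [rootCoverTM] at h
      exact coverTM_sound C D ks hks _ _ _ _ h hag0 hp0
  | mdisj sd τ k A B =>
      simp only [rootCoverTM] at h
      exact coverTM_sound C D ks hks _ _ _ _ h hag0 hp0
  | node q kids =>
      cases q with
      | succ q =>
          simp only [rootCoverTM] at h
          exact coverTM_sound C D ks hks _ _ _ _ h hag0 hp0
      | zero =>
          simp only [rootCoverTM, Bool.and_eq_true, decide_eq_true_eq, List.all_eq_true, Bool.or_eq_true] at h
          obtain ⟨⟨hn, hlen5⟩, hall⟩ := h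
          cases ks with
          | nil => simp at hlen; omega
          | cons a tl =>
              simp only [List.getD_cons_zero] at hk0
              have hk5 : a < 5 := hks a (by simp)
              have hs := hall a (List.mem_range.mpr hk5)
              rcases hs with hbad | hs
              · exact absurd hbad hk0
              obtain ⟨s, hsk⟩ : ∃ s, kids[a]? = some s := ⟨kids[a]'(by omega), List.getElem?_eq_getElem (by omega)⟩
              simp only [hsk] at hs
              exact coverTM_sound C D (a :: tl) hks _ _ _ _ hs (agrees_setAt hag0 (k := a) (q := 0) rfl) hp0

/-! ## §22 (Δ4) The end-to-end theorems («v1 + L1.5 + ℤ») -/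

theorem region_coverTM (C : CertM) (t : CTreeM) (fuel : ℕ) (hv : validTM C t fuel = true) (D : Design) (hA : D.OnAlphabet C.h) (h4 : D.A4)
    (c : Cell) (hc : c ∈ D.suppN ++ D.suppP) (f : Fin 4) (hfloor : (c f).a = 0) :
    ∃ lf ∈ C.leaves, InRegion C.vars lf.core.base D ∧
      (∀ sd : Side, ∀ c' ∈ suppSide D sd, admType C.h (allBounds C.vars lf.core.base) sd (typeOf c') = true) ∧ lf.LitsHold D := by
  have hv' := hv
  unfold validTM at hv'
  simp only [Bool.and_eq_true, decide_eq_true_eq] at hv'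
  obtain ⟨⟨hv0, hleaves⟩, hroot⟩ := hv'
  have hS1 := static_adm C.h D hA h4
  have hcP : c ∈ D.suppP := by
    rcases List.mem_append.mp hc with hcN | hcP
    · exfalso
      obtain ⟨x, hx, hlive⟩ := h4.2 c hcN
      have hlt := (hlive f).1
      have hx0 := (hA x (List.mem_append.mpr (Or.inr hx)) f).2
      omega
    · exact hcP
  have hks5 : ∀ k ∈ C.vars.map (kOf D), k < 5 := fun k hk => by
    obtain ⟨v, _, rfl⟩ := List.mem_map.mp hk
    exact Nat.lt_succ_of_le (kOf_le_four D v)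
  have hk0 : (C.vars.map (kOf D)).getD 0 0 ≠ 0 := by
    cases hvars : C.vars with
    | nil => rw [hvars] at hv0; simp at hv0
    | cons v0 rest =>
      rw [hvars] at hv0
      simp only [List.getElem?_cons_zero, Option.some.injEq] at hv0
      subst hv0
      simp only [List.map_cons, List.getD_cons_zero]
      have hcnt : 0 < (floorStat C.h).count (typeOf c) := by
        unfold Stat.count
        refine List.length_pos_of_mem (List.mem_filter.mpr ⟨List.mem_finRange f, ?_⟩)
        refine List.elem_eq_true_of_mem (List.mem_filter.mpr ⟨by rw [admP0T_eq]; exact hS1.1 c hcP f, ?_⟩)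
        simp [Shape.isFloor, shapeOf, typeOf, hfloor]
      have hle : (floorStat C.h).count (typeOf c) ≤ kOf D ⟨Side.P, floorStat C.h⟩ :=
        (isMax_kOf D ⟨Side.P, floorStat C.h⟩).1 c hcP
      omega
  obtain ⟨lf, hlf, hmatch, hlits⟩ := rootCoverTM_sound C D t fuel (C.vars.map (kOf D)) hroot (by simp) hks5 hk0
  have hreg : InRegion C.vars lf.core.base D := inRegion_of_matchesB C.vars lf.core.base D hmatch
  have hchk : checkLeafM C lf = true := List.all_eq_true.mp hleaves lf hlf
  exact ⟨lf, hlf, hreg, adm_of_region C.toB lf.core.base (hder_of_checkLeafM hchk) D hA h4 hreg, hlits⟩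

/-- **SOUNDNESS (floor form): `validTM C t fuel ⇒ FloorFree h B rmin`.** -/
theorem floorFree_of_validTM (C : CertM) (t : CTreeM) (fuel : ℕ) (hv : validTM C t fuel = true) : FloorFreeH C.h C.B C.rmin := by
  intro D hA h1 h4 _hμ hB hr c hc f
  by_contra hle
  have ha0 := (hA c hc f).2
  have hfloor : (c f).a = 0 := by omega
  have hleaves : C.leaves.all (fun lf => checkLeafM C lf) = true := by
    have hv' := hv
    unfold validTM at hv'
    simp only [Bool.and_eq_true] at hv'
    exact hv'.1.2
  have hsides : D.suppN ≠ [] ∧ D.suppP ≠ [] := by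
    rcases List.mem_append.mp hc with hcN | hcP
    · obtain ⟨x, hx, _⟩ := h4.2 c hcN
      exact ⟨List.ne_nil_of_mem hcN, List.ne_nil_of_mem hx⟩
    · obtain ⟨y, hy, _⟩ := h4.1 c hcP
      exact ⟨List.ne_nil_of_mem hy, List.ne_nil_of_mem hcP⟩
  obtain ⟨lf, hlf, hreg, hadm, hlits⟩ := region_coverTM C t fuel hv D hA h4 c hc f hfloor
  have hchk : checkLeafM C lf = true := List.all_eq_true.mp hleaves lf hlf
  exact leafM_sound C lf hchk D h1 h4 hB hr hsides.1 hsides.2 hreg hadm hlits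
    (fun e _ k _ _ he => parity_even C.toB lf.core.base e.1 k e.2.par he D h1 hadm)

/-- **PER-REGION SOUNDNESS** («v1 + L1.5 + ℤ» tree over one cap region — NOT `FloorFree`: the other regions remain) -/
theorem regionEmpty_of_validRM (C : CertM) (t : CTreeM) (fuel : ℕ) (caps : List (Option ℕ)) (hv : validRM C t fuel caps = true)
    (D : Design) (hA : D.OnAlphabet C.h) (h1 : D.A1) (h4 : D.A4) (hB : D.copies ≤ C.B) (hr : C.rmin ≤ D.rank) (hN : D.suppN ≠ [])
    (hcaps : InCaps C.vars caps D) : False := by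
  have hv' := hv
  unfold validRM at hv'
  simp only [Bool.and_eq_true, decide_eq_true_eq] at hv'
  obtain ⟨⟨hlen, hleaves⟩, hcov⟩ := hv'
  have hP : D.suppP ≠ [] := by
    obtain ⟨y, hy⟩ := List.exists_mem_of_ne_nil _ hN
    obtain ⟨x, hx, _⟩ := h4.2 y hy
    exact List.ne_nil_of_mem hx
  have hks5 : ∀ k ∈ C.vars.map (kOf D), k < 5 := fun k hk => by
    obtain ⟨v, _, rfl⟩ := List.mem_map.mp hk
    exact Nat.lt_succ_of_le (kOf_le_four D v)
  have hag : caps.length = (C.vars.map (kOf D)).length ∧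
      ∀ j m : ℕ, caps[j]? = some (some m) → (C.vars.map (kOf D))[j]? = some m := by
    refine ⟨by simp [hlen], fun j m hj => ?_⟩
    obtain ⟨hjl, _⟩ := List.getElem?_eq_some_iff.mp hj
    obtain ⟨v, hvj⟩ : ∃ v, C.vars[j]? = some v := ⟨C.vars[j]'(by omega), List.getElem?_eq_getElem (by omega)⟩
    have hz : (List.zip C.vars caps)[j]? = some (v, some m) := List.getElem?_zip_eq_some.mpr ⟨hvj, hj⟩
    have hmax := hcaps _ (List.mem_of_getElem? hz) m rfl
    rw [List.getElem?_map, hvj]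
    exact congrArg some (isMax_unique (isMax_kOf D v) hmax)
  obtain ⟨lf, hlf, hmatch, hlits⟩ := coverTM_sound C D (C.vars.map (kOf D)) hks5 fuel t caps MPath.nil hcov hag (MPath.nil_holds D)
  have hreg : InRegion C.vars lf.core.base D := inRegion_of_matchesB C.vars lf.core.base D hmatch
  have hchk : checkLeafM C lf = true := List.all_eq_true.mp hleaves lf hlf
  have hadm := adm_of_region C.toB lf.core.base (hder_of_checkLeafM hchk) D hA h4 hreg
  exact leafM_sound C lf hchk D h1 h4 hB hr hN hP hreg hadm hlits
    (fun e _ k _ _ he => parity_even C.toB lf.core.base e.1 k e.2.par he D h1 hadm)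

theorem regionEmpty_of_validRM' (C : CertM) (t : CTreeM) (fuel : ℕ) (caps : List (Option ℕ)) (hv : validRM C t fuel caps = true)
    (hpos : 0 < C.rmin) (D : Design) (hA : D.OnAlphabet C.h) (h1 : D.A1) (h4 : D.A4) (hB : D.copies ≤ C.B) (hr : C.rmin ≤ D.rank)
    (hcaps : InCaps C.vars caps D) : False :=
  regionEmpty_of_validRM C t fuel caps hv D hA h1 h4 hB hr (suppN_ne_nil_of_rank D C.rmin hr hpos) hcaps

/-! ## §23 (Δ4) Smoke tests (FAKE leaves; path discipline of the integer branch; the pays of the new rows on toy data) -/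
section SmokeM

def fakeLeafM (caps : List (Option ℕ)) (pres : List Pres) (mges : List MGe) (mles : List MLe) (aggs : List AggCov) : LeafM :=
  {core := fakeLeafK caps [] pres [] [] [], mges := mges, mles := mles, aggs := aggs}

/-- FLOOR = 2 split on `(P, τ0)`; its present branch on the integer branch `x_{τ0} ≤ 3 ∕ ≥ 4`; leaf 3 also carries an aggregated cover row -/
def fakeCM : CertM :=
  {h := 6, B := 199, rmin := 8, vars := [⟨Side.P, floorStat 6⟩],
   leaves := [fakeLeafM [some 1] [] [] [] [], fakeLeafM [some 2] [] [] [] [],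
              fakeLeafM [some 2] [⟨Side.P, τ0, 0, 7⟩] [] [⟨Side.P, τ0, 3, 2⟩] [],
              fakeLeafM [some 2] [⟨Side.P, τ0, 0, 7⟩] [⟨Side.P, τ0, 4, 5⟩] [] [⟨Side.N, τ0, 1⟩],
              fakeLeafM [some 3] [] [] [] [], fakeLeafM [some 4] [] [] [] []]}

def fakeTM : CTreeM :=
  .node 0 [.leaf 0, .leaf 0, .disj Side.P τ0 (.leaf 1) (.mdisj Side.P τ0 3 (.leaf 2) (.leaf 3)), .leaf 4, .leaf 5]

example : rootCoverTM fakeCM fakeTM 3 = true := by decide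
/-- the integer branch's children swapped is rejected (`x ≤ 3` leaf on the `≥ 4` side) -/
example : rootCoverTM fakeCM (.node 0 [.leaf 0, .leaf 0, .disj Side.P τ0 (.leaf 1) (.mdisj Side.P τ0 3 (.leaf 3) (.leaf 2)), .leaf 4, .leaf 5]) 3 = false := by
  decide
/-- a different threshold on the node than in the leaves is rejected -/
example : rootCoverTM fakeCM (.node 0 [.leaf 0, .leaf 0, .disj Side.P τ0 (.leaf 1) (.mdisj Side.P τ0 2 (.leaf 2) (.leaf 3)), .leaf 4, .leaf 5]) 3 = false := by
  decide
/-- the effective presence list of leaf 3: the type literal, the lower mass literal `(Z = 5, W = 0)`, the aggregated row `(Z = −1, W = 1·199)` -/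
example : ((fakeLeafM [some 2] [⟨Side.P, τ0, 0, 7⟩] [⟨Side.P, τ0, 4, 5⟩] [] [⟨Side.N, τ0, 1⟩]).presEff 199).map (fun r => (r.Z, r.W))
    = [(0, 7), (5, 0), (-1, 199)] := by decide
/-- their pays on a P-type equal to τ0 (mass hits: 0 + 5; the N-row's cover hit needs `covDown τ0 τ0`, false — no letter of a shape is amply above one of the same shape) -/
example : presPay ((fakeLeafM [some 2] [⟨Side.P, τ0, 0, 7⟩] [⟨Side.P, τ0, 4, 5⟩] [] [⟨Side.N, τ0, 1⟩]).presEff 199) Side.P τ0 = 5 := by decide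

end SmokeM

/-! ## §24 (Δ4) Chunked replay interface
A real tree has many leaves, and `validTM` ∕ `validRM` evaluate `C.leaves.all (checkLeafM C)` — at h = 6 one class leaf costs the kernel
≈ 20 s (g11 `ClassLeafDemo`), so a whole node is never ONE `decide`.  A replay module therefore (i) proves one lemma per leaf
`checkLeafM C lfᵢ = true` (each by `decide +kernel`; leaves may be spread over several modules), (ii) assembles
`∀ lf ∈ C.leaves, checkLeafM C lf = true` with `List.forall_mem_cons` ∕ `List.forall_mem_nil`, (iii) proves the cheap structural part
(`rootCoverTM` ∕ `coverTM`: leaf–path fitting only, no pointwise check) by `decide`, and (iv) concludes with the lemmas below.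
Nothing here is a certificate. -/

theorem validTM_intro (C : CertM) (t : CTreeM) (fuel : ℕ) (h0 : C.vars[0]? = some ⟨Side.P, floorStat C.h⟩)
    (hl : ∀ lf ∈ C.leaves, checkLeafM C lf = true) (hc : rootCoverTM C t fuel = true) : validTM C t fuel = true := by
  unfold validTM
  simp only [Bool.and_eq_true, decide_eq_true_eq, List.all_eq_true]
  exact ⟨⟨h0, hl⟩, hc⟩

theorem validRM_intro (C : CertM) (t : CTreeM) (fuel : ℕ) (caps : List (Option ℕ)) (h0 : caps.length = C.vars.length)
    (hl : ∀ lf ∈ C.leaves, checkLeafM C lf = true) (hc : coverTM C t fuel caps MPath.nil = true) : validRM C t fuel caps = true := by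
  unfold validRM
  simp only [Bool.and_eq_true, decide_eq_true_eq, List.all_eq_true]
  exact ⟨⟨h0, hl⟩, hc⟩

/-- **node-level end theorem from chunks**: leaf lemmas + structural cover ⇒ `FloorFreeH` -/
theorem floorFree_of_chunks (C : CertM) (t : CTreeM) (fuel : ℕ) (h0 : C.vars[0]? = some ⟨Side.P, floorStat C.h⟩)
    (hl : ∀ lf ∈ C.leaves, checkLeafM C lf = true) (hc : rootCoverTM C t fuel = true) : FloorFreeH C.h C.B C.rmin :=
  floorFree_of_validTM C t fuel (validTM_intro C t fuel h0 hl hc)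

/-- **region-level end theorem from chunks**: leaf lemmas + structural cover of the cap region ⇒ the region holds no admissible design -/
theorem regionEmpty_of_chunks (C : CertM) (t : CTreeM) (fuel : ℕ) (caps : List (Option ℕ)) (h0 : caps.length = C.vars.length)
    (hl : ∀ lf ∈ C.leaves, checkLeafM C lf = true) (hc : coverTM C t fuel caps MPath.nil = true)
    (D : Design) (hA : D.OnAlphabet C.h) (h1 : D.A1) (h4 : D.A4) (hB : D.copies ≤ C.B) (hr : C.rmin ≤ D.rank) (hN : D.suppN ≠ [])
    (hcaps : InCaps C.vars caps D) : False :=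
  regionEmpty_of_validRM C t fuel caps (validRM_intro C t fuel caps h0 hl hc) D hA h1 h4 hB hr hN hcaps

section SmokeChunks
/-- the assembly step (ii) on the toy certificate of §23: six leaf facts ⇒ the `∀ lf ∈ C.leaves` hypothesis (here the leaf facts are
FALSE — fake leaves do not check — so they are taken as hypotheses; the point is the shape of the assembled term) -/
example (h0 : checkLeafM fakeCM (fakeLeafM [some 1] [] [] [] []) = true) (h1 : checkLeafM fakeCM (fakeLeafM [some 2] [] [] [] []) = true)
    (h2 : checkLeafM fakeCM (fakeLeafM [some 2] [⟨Side.P, τ0, 0, 7⟩] [] [⟨Side.P, τ0, 3, 2⟩] []) = true)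
    (h3 : checkLeafM fakeCM (fakeLeafM [some 2] [⟨Side.P, τ0, 0, 7⟩] [⟨Side.P, τ0, 4, 5⟩] [] [⟨Side.N, τ0, 1⟩]) = true)
    (h4 : checkLeafM fakeCM (fakeLeafM [some 3] [] [] [] []) = true) (h5 : checkLeafM fakeCM (fakeLeafM [some 4] [] [] [] []) = true) :
    ∀ lf ∈ fakeCM.leaves, checkLeafM fakeCM lf = true :=
  List.forall_mem_cons.2 ⟨h0, List.forall_mem_cons.2 ⟨h1, List.forall_mem_cons.2 ⟨h2, List.forall_mem_cons.2 ⟨h3,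
    List.forall_mem_cons.2 ⟨h4, List.forall_mem_cons.2 ⟨h5, fun _ h => nomatch h⟩⟩⟩⟩⟩⟩
/-- step (iii) on the toy tree is a plain `decide` (no pointwise work) -/
example : rootCoverTM fakeCM fakeTM 3 = true := by decide
end SmokeChunks

/-! ## §25 (Δ5) EFA leaf certificates — ORDERED e-free (A1) rows against an ORDERED anchor on a thin support
(anomaly g13 «EFREE-ANCHOR» l.10993; director-hodge g27 R19.540 (4) KERNEL LANE.)

THE OBJECT.  A terminal leaf of the class B&B has a thin multiset support `S` (≈ 9 types).  On designs with `supp ⊆ S` the 72 ORDERED e-free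
(A1) rows (`Design.A1`, second conjunct: `T(w) = T(w′)` for ALL e-free words `w, w′ : Fin 4 → {1, h, pt}` of equal degree — ordered words, not
their S₄-symmetrisations) are linear in the ORDERED-type masses with coefficients that are products over the slots of the shape data
`v = (1, a, n = a² − p² − q²)` (v7 `Fil.v`), and one PRESENT ORDERED type `o₀` (an anchor) breaks the slot symmetry that lets the multiset-level
class LP satisfy them for free.  `LP(S, o₀) = min copies s.t. the ordered rows, x ≥ 0, x_{o₀} ≥ 1` has an exact dual `y ∈ ℚ^{rows}`; the
certificate is `(S, side and ordering of the anchor, rows with integer multipliers Λ = d·y, the scale d)`, and the kernel check is the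
reduced-cost inequality on every ordered column of `S` (≤ 24·|S| columns) plus the closing inequality `d·B < d − G(o₀)`.
SOUNDNESS = `farkas_core` (Δ3 §15) with `F = Σ Λ·(fval φ − fval ψ)` (balanced by (A1)), `ρ = 0`, pay `z = d − G(o₀)` on the anchor cells.
A FAMILY version (one certificate per ordering class of a multiset `τ`) concludes from MULTISET presence `Present D sd τ` with no WLOG lemma.
What it refutes: designs with `supp ⊆ S`, the anchor present, (A1), `copies ≤ B` — ONE LEAF SUPPORT, not a region, not `FloorFree`. -/

/-- an ordered e-free word: one filling symbol (`1 ∕ h ∕ pt`, v7 `Fil`) per slot -/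
abbrev EWord := Fin 4 → Fil

/-- the (A1) word of an ordered e-free word -/
def EWord.toWord (φ : EWord) : Word := fun f => filSym (φ f)

/-- type-level value `Π_f v(t_f)[φ_f]` of an ordered e-free word on an ORDERED type -/
def fval (φ : EWord) (t : STuple) : ℤ := (φ 0).v (t 0) * (φ 1).v (t 1) * (φ 2).v (t 2) * (φ 3).v (t 3)

theorem icoef_filSym (x : Fil) (ℓ : Letter) : (filSym x).icoef ℓ = x.v (shapeOf ℓ) := by
  cases x with
  | one => rfl
  | h => rfl
  | pt => simp [filSym, Sym.icoef, Fil.v, shapeOf_n]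

theorem icellCoef_toWord (c : Cell) (φ : EWord) : icellCoef c φ.toWord = fval φ (typeOf c) := by
  simp only [icellCoef, Fin.prod_univ_four, EWord.toWord, icoef_filSym, fval, typeOf]

theorem EWord.toWord_efree (φ : EWord) : φ.toWord.efree := by
  intro f
  simp only [EWord.toWord]
  cases φ f <;> rfl

/-- **(A1), ordered e-free row, integer, type-level**: two ordered e-free words of equal degree have the same `Σ_N m·fval − Σ_P m·fval` -/
theorem efree_row (D : Design) (h1 : D.A1) (φ ψ : EWord) (hd : φ.toWord.deg = ψ.toWord.deg) :
    linZ D.N (fun c => fval φ (typeOf c)) - linZ D.P (fun c => fval φ (typeOf c))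
      = linZ D.N (fun c => fval ψ (typeOf c)) - linZ D.P (fun c => fval ψ (typeOf c)) := by
  have h := Tz_eq_of_A1 D h1 φ.toWord ψ.toWord φ.toWord_efree ψ.toWord_efree hd
  unfold Design.Tz at h
  have e1 : (fun c => icellCoef c φ.toWord) = fun c => fval φ (typeOf c) := funext fun c => icellCoef_toWord c φ
  have e2 : (fun c => icellCoef c ψ.toWord) = fun c => fval ψ (typeOf c) := funext fun c => icellCoef_toWord c ψ
  rw [e1, e2] at h
  exact h

/-- a weighted ordered e-free row `Λ·(T(φ) − T(ψ))` (the certificate must have `deg φ = deg ψ`) -/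
structure ERow where
  φ : EWord
  ψ : EWord
  lam : ℤ

def ERow.degOK (r : ERow) : Bool := decide (r.φ.toWord.deg = r.ψ.toWord.deg)

/-- the dual combination of the rows at an ordered type (before the side sign) -/
def erVal (rows : List ERow) (t : STuple) : ℤ := (rows.map fun r => r.lam * (fval r.φ t - fval r.ψ t)).sum

theorem erVal_balance (D : Design) (h1 : D.A1) (rows : List ERow) (hdeg : ∀ r ∈ rows, r.degOK = true) :
    linZ D.N (fun c => erVal rows (typeOf c)) - linZ D.P (fun c => erVal rows (typeOf c)) = 0 := by
  induction rows with
  | nil => simp [erVal, linZ]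
  | cons r rs ih =>
    have hr : r.φ.toWord.deg = r.ψ.toWord.deg := by
      have := hdeg r (List.mem_cons_self ..)
      simpa [ERow.degOK] using this
    have ih' := ih fun r' hr' => hdeg r' (List.mem_cons_of_mem _ hr')
    have hsplit : ∀ L : List (Cell × ℕ), linZ L (fun c => erVal (r :: rs) (typeOf c))
        = r.lam * (linZ L (fun c => fval r.φ (typeOf c)) - linZ L (fun c => fval r.ψ (typeOf c))) + linZ L (fun c => erVal rs (typeOf c)) := by
      intro L
      have e : (fun c => erVal (r :: rs) (typeOf c))
          = fun c => r.lam * (fval r.φ (typeOf c) - fval r.ψ (typeOf c)) + erVal rs (typeOf c) := by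
        funext c; simp [erVal]
      rw [e, linZ_add, linZ_smul]
      have e2 : (fun c => fval r.φ (typeOf c) - fval r.ψ (typeOf c)) = fun c => fval r.φ (typeOf c) + (-1) * fval r.ψ (typeOf c) := by
        funext c; ring
      rw [e2, linZ_add, linZ_smul]
      ring
    have hrow := efree_row D h1 r.φ r.ψ hr
    rw [hsplit D.N, hsplit D.P]
    linear_combination r.lam * hrow + ih'

/-- the 24 slot orderings of a type (with repetitions when the type has a stabiliser) -/
def ordsOf (τ : STuple) : List STuple := perms4.map fun p => fun f => τ (p f)

theorem mem_ordsOf_of_sameM {τ t : STuple} (h : sameM τ t = true) : t ∈ ordsOf τ := by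
  obtain ⟨p, hp, hpt⟩ := sameM_elim h
  have : t = fun f => τ (p f) := funext fun f => (hpt f).symm
  rw [this]
  exact List.mem_map.mpr ⟨p, hp, rfl⟩

/-- an **EFA certificate**: budget, multiset support (one representative ordering per type), the anchor (side + ORDERED type), the rows with
integer multipliers, the scale `d` (= the common denominator of the exact dual; cost of a unit mass is `d`) -/
structure EFACert where
  B : ℕ
  supp : List (Side × STuple)
  sd0 : Side
  o0 : STuple
  rows : List ERow
  d : ℕ

/-- the ordered columns of the support on one side -/
def efaCols (S : List (Side × STuple)) (sd : Side) : List STuple :=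
  (S.filter fun e => decide (e.1 = sd)).flatMap fun e => ordsOf e.2

/-- the signed column value `sgn(sd)·Σ Λ·(fval φ − fval ψ)` -/
def gcol (E : EFACert) (sd : Side) (t : STuple) : ℤ := sd.sgn * erVal E.rows t

/-- **EFA check**: degrees, reduced costs on every ordered column of the support (`G ≤ d`), the anchor's own column, and the closing
inequality `d·B < d − G(o₀)` (⇔ LP bound `1 − G(o₀)∕d > B`) -/
def validEFA (E : EFACert) : Bool :=
  (E.rows.all ERow.degOK) &&
  ((efaCols E.supp Side.N).all fun t => decide (gcol E Side.N t ≤ E.d)) &&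
  ((efaCols E.supp Side.P).all fun t => decide (gcol E Side.P t ≤ E.d)) &&
  decide (gcol E E.sd0 E.o0 ≤ E.d) &&
  decide ((E.d : ℤ) * E.B < E.d - gcol E E.sd0 E.o0)

/-- the support of a design lies in the multiset list `S` (side by side) -/
def SuppIn (D : Design) (S : List (Side × STuple)) : Prop :=
  ∀ sd : Side, ∀ c ∈ suppSide D sd, ∃ e ∈ S, e.1 = sd ∧ sameM e.2 (typeOf c) = true

/-- an ORDERED type is present on a side: some supported cell has exactly this ordered type -/
def OPresent (D : Design) (sd : Side) (o : STuple) : Prop := ∃ c ∈ suppSide D sd, typeOf c = o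

theorem gcol_le_of_suppIn (E : EFACert) (hv : validEFA E = true) (D : Design) (hS : SuppIn D E.supp) (sd : Side) (c : Cell)
    (hc : c ∈ suppSide D sd) : gcol E sd (typeOf c) ≤ E.d := by
  simp only [validEFA, Bool.and_eq_true, List.all_eq_true, decide_eq_true_eq] at hv
  obtain ⟨⟨⟨⟨_, hN⟩, hP⟩, _⟩, _⟩ := hv
  obtain ⟨e, he, hesd, hsame⟩ := hS sd c hc
  have hmem : typeOf c ∈ efaCols E.supp sd := by
    unfold efaCols
    refine List.mem_flatMap.mpr ⟨e, ?_, mem_ordsOf_of_sameM hsame⟩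
    exact List.mem_filter.mpr ⟨he, by simp [hesd]⟩
  cases sd with
  | N => exact hN _ hmem
  | P => exact hP _ hmem

/-- **SOUNDNESS of the EFA leaf certificate**: no design with support in `S`, the ordered anchor present, (A1)-clean and `copies ≤ B`. -/
theorem efa_sound (E : EFACert) (hv : validEFA E = true) (D : Design) (h1 : D.A1) (hB : D.copies ≤ E.B) (hS : SuppIn D E.supp)
    (hpres : OPresent D E.sd0 E.o0) : False := by
  have hv' := hv
  simp only [validEFA, Bool.and_eq_true, List.all_eq_true, decide_eq_true_eq] at hv'
  obtain ⟨⟨⟨⟨hdeg, _⟩, _⟩, hanc⟩, hclose⟩ := hv'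
  -- the pay: `z = d − G(o₀)` on the anchor cells of side `sd0`, 0 elsewhere
  set z : ℤ := (E.d : ℤ) - gcol E E.sd0 E.o0 with hz
  have hz0 : 0 ≤ z := by rw [hz]; linarith
  refine farkas_core D E.B D.rank hB (le_refl _) (fun c => erVal E.rows (typeOf c)) (erVal_balance D h1 E.rows hdeg)
    (fun sd c => if sd = E.sd0 ∧ typeOf c = E.o0 then z else 0) z (E.d : ℤ) 0
    (by exact_mod_cast Nat.zero_le _) (le_refl _) ?_ ?_ (by simpa using hclose)
  · -- credit: the anchor is present ⇒ `z ≤ Σ m·pay`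
    obtain ⟨c₀, hc₀, ht₀⟩ := hpres
    have hind : 1 ≤ linZ D.N (fun c => if Side.N = E.sd0 ∧ typeOf c = E.o0 then (1 : ℤ) else 0)
        + linZ D.P (fun c => if Side.P = E.sd0 ∧ typeOf c = E.o0 then (1 : ℤ) else 0) := by
      refine one_le_linZ_sides D (fun sd c => if sd = E.sd0 ∧ typeOf c = E.o0 then (1 : ℤ) else 0)
        (fun sd c => ite_nonneg zero_le_one (le_refl _)) hc₀ ?_
      show (1 : ℤ) ≤ (if E.sd0 = E.sd0 ∧ typeOf c₀ = E.o0 then (1 : ℤ) else 0)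
      rw [if_pos ⟨rfl, ht₀⟩]
    have eN : (fun c => if Side.N = E.sd0 ∧ typeOf c = E.o0 then z else 0)
        = fun c => z * (if Side.N = E.sd0 ∧ typeOf c = E.o0 then (1 : ℤ) else 0) := by
      funext c; split <;> simp
    have eP : (fun c => if Side.P = E.sd0 ∧ typeOf c = E.o0 then z else 0)
        = fun c => z * (if Side.P = E.sd0 ∧ typeOf c = E.o0 then (1 : ℤ) else 0) := by
      funext c; split <;> simp
    show z ≤ linZ D.N (fun c => if Side.N = E.sd0 ∧ typeOf c = E.o0 then z else 0)
      + linZ D.P (fun c => if Side.P = E.sd0 ∧ typeOf c = E.o0 then z else 0)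
    rw [eN, eP, linZ_smul, linZ_smul]
    nlinarith [hind, hz0]
  · -- pointwise: reduced cost on every supported cell, the anchor cells paying exactly `d`
    intro sd c hc
    have hg := gcol_le_of_suppIn E hv D hS sd c hc
    simp only [gcol] at hg
    show sd.sgn * erVal E.rows (typeOf c) + (if sd = E.sd0 ∧ typeOf c = E.o0 then z else 0) ≤ Side.bnd (E.d : ℤ) 0 sd
    by_cases hA : sd = E.sd0 ∧ typeOf c = E.o0
    · rw [if_pos hA]
      obtain ⟨hsd, ht⟩ := hA
      have hG : gcol E E.sd0 E.o0 = sd.sgn * erVal E.rows (typeOf c) := by rw [← hsd, ← ht]; rfl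
      rw [hz, hG]
      cases sd <;> simp only [Side.sgn, Side.bnd] <;> linarith
    · rw [if_neg hA]
      cases sd <;> simp only [Side.sgn, Side.bnd] at hg ⊢ <;> linarith

/-- an **EFA family**: one certificate `(o, rows, d)` per ordering class of the multiset anchor `τ`; the check demands that EVERY slot ordering of
`τ` is (syntactically) the anchor of some certificate, so MULTISET presence suffices and no WLOG ∕ slot-symmetry lemma is used -/
structure EFAFam where
  B : ℕ
  supp : List (Side × STuple)
  sd0 : Side
  τ : STuple
  certs : List (STuple × List ERow × ℕ)

def EFAFam.cert (F : EFAFam) (c : STuple × List ERow × ℕ) : EFACert := ⟨F.B, F.supp, F.sd0, c.1, c.2.1, c.2.2⟩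

def validEFAFam (F : EFAFam) : Bool :=
  (perms4.all fun p => F.certs.any fun c => eqT c.1 (fun f => F.τ (p f))) &&
  (F.certs.all fun c => validEFA (F.cert c))

/-- **SOUNDNESS of an EFA family**: no design with support in `S`, the MULTISET anchor `τ` present on side `sd0`, (A1)-clean, `copies ≤ B`. -/
theorem efaFam_sound (F : EFAFam) (hv : validEFAFam F = true) (D : Design) (h1 : D.A1) (hB : D.copies ≤ F.B) (hS : SuppIn D F.supp)
    (hpres : Present D F.sd0 F.τ) : False := by
  simp only [validEFAFam, Bool.and_eq_true, List.all_eq_true, List.any_eq_true] at hv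
  obtain ⟨hcov, hval⟩ := hv
  obtain ⟨c₀, hc₀, hsame⟩ := hpres
  obtain ⟨p, hp, hpt⟩ := sameM_elim hsame
  obtain ⟨c, hc, heq⟩ := hcov p hp
  have ho : c.1 = typeOf c₀ := by
    have := eqT_eq heq
    rw [this]
    exact funext fun f => hpt f
  exact efa_sound (F.cert c) (hval c hc) D h1 hB hS ⟨c₀, hc₀, by simp [EFAFam.cert, ho]⟩

section SmokeEFA
/-- the ordered rows see the ordering: `h·1·1·1` and `1·h·1·1` differ on an ordered type with distinct first two slots -/
example : fval ![Fil.h, Fil.one, Fil.one, Fil.one] ![⟨0, 3, 3⟩, ⟨2, 2, 2⟩, ⟨0, 3, 3⟩, ⟨0, 3, 3⟩] = 0 ∧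
    fval ![Fil.one, Fil.h, Fil.one, Fil.one] ![⟨0, 3, 3⟩, ⟨2, 2, 2⟩, ⟨0, 3, 3⟩, ⟨0, 3, 3⟩] = 2 := by decide
/-- `ordsOf` lists 24 orderings; a type with stabiliser of order 6 has 4 distinct ones -/
example : (ordsOf ![⟨0, 3, 3⟩, ⟨0, 3, 3⟩, ⟨0, 3, 3⟩, ⟨2, 2, 2⟩]).length = 24 ∧
    ((ordsOf ![⟨0, 3, 3⟩, ⟨0, 3, 3⟩, ⟨0, 3, 3⟩, ⟨2, 2, 2⟩]).eraseDups).length = 4 := by decide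
/-- a FAKE one-row certificate is rejected (closing inequality fails) -/
example : validEFA ⟨199, [(Side.P, ![⟨0, 3, 3⟩, ⟨0, 3, 3⟩, ⟨0, 3, 3⟩, ⟨2, 2, 2⟩])], Side.P, ![⟨0, 3, 3⟩, ⟨0, 3, 3⟩, ⟨0, 3, 3⟩, ⟨2, 2, 2⟩],
    [⟨![Fil.h, Fil.one, Fil.one, Fil.one], ![Fil.one, Fil.h, Fil.one, Fil.one], 1⟩], 1⟩ = false := by decide
end SmokeEFA

/-! ## §26 (Δ5) FIRST KERNEL LEAF SUPPORT KILLED PAST 199 — anomaly g13's EFREE-ANCHOR certificate a5 (4273 terminal support, anchor P m³b)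
Data: `ideators∕plan-lens-HodgeAV-anomaly∕a29∕lift∕leaf4273x-efreeanchor-a5.json` 3531c95708e7e4e8 (support `leaf4273x.json` 5128aec5c9e4b65c =
the 9-multiset support of L1's 4273 terminal leaf, `warm_4273_bf.json` terminal_examples[0]; anchor class 5 = P `(0;3,3)³(2;2,2)` in the ordering
as listed; 72 rows `T(w) − T(w_ref(deg w))`, itertools order over `{1,h,p}⁴`, 50 non-zero exact duals), converted by `efa2lean.py` (dual g12: common
denominator `d` = 36 digits, `Λ_w = d·y_w`; an exact replica of `validEFA` PASSES with bound `(d − G(o₀))∕d = 6570865∕13212 ≈ 497.34 > 199`,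
= anomaly's bound to the digit).  WHAT THE THEOREM SAYS: no (A1)-clean design with `copies ≤ 199` has its support inside these 9 multisets AND a
supported P-cell of ordered type `(0;3,3),(0;3,3),(0;3,3),(2;2,2)`.  ONE LEAF SUPPORT with an ORDERED anchor — not the leaf's region, not region
4273, not `FloorFree 6 199 8`; the multiset-anchor version needs the other 3 ordering classes (an `EFAFam`, §25) or a WLOG slot-symmetry lemma. -/
section EFA4273

def efa4273a5S : List (Side × STuple) :=
  [(Side.N, ![⟨2, 2, 2⟩, ⟨2, 2, 2⟩, ⟨2, 2, 2⟩, ⟨4, 1, 1⟩]),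
   (Side.N, ![⟨2, 2, 2⟩, ⟨2, 2, 2⟩, ⟨6, 0, 0⟩, ⟨6, 0, 0⟩]),
   (Side.N, ![⟨2, 2, 2⟩, ⟨6, 0, 0⟩, ⟨6, 0, 0⟩, ⟨6, 0, 0⟩]),
   (Side.N, ![⟨2, 4, 0⟩, ⟨2, 4, 0⟩, ⟨4, 2, 0⟩, ⟨5, 1, 0⟩]),
   (Side.N, ![⟨5, 1, 0⟩, ⟨6, 0, 0⟩, ⟨6, 0, 0⟩, ⟨6, 0, 0⟩]),
   (Side.P, ![⟨0, 3, 3⟩, ⟨0, 3, 3⟩, ⟨0, 3, 3⟩, ⟨2, 2, 2⟩]),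
   (Side.P, ![⟨0, 5, 1⟩, ⟨0, 5, 1⟩, ⟨2, 3, 1⟩, ⟨2, 2, 2⟩]),
   (Side.P, ![⟨0, 5, 1⟩, ⟨2, 3, 1⟩, ⟨4, 1, 1⟩, ⟨4, 1, 1⟩]),
   (Side.P, ![⟨1, 4, 1⟩, ⟨2, 3, 1⟩, ⟨4, 1, 1⟩, ⟨4, 1, 1⟩])]

def efa4273a5Rows : List ERow :=
  [⟨![Fil.one, Fil.one, Fil.h, Fil.one], ![Fil.one, Fil.one, Fil.one, Fil.h], -37707817308469610616448848621611496000⟩,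
   ⟨![Fil.one, Fil.pt, Fil.one, Fil.one], ![Fil.one, Fil.one, Fil.one, Fil.pt], 16326261091632315936451364953465531032⟩,
   ⟨![Fil.h, Fil.one, Fil.one, Fil.h], ![Fil.one, Fil.one, Fil.one, Fil.pt], -3986488823115977140119174564953204448⟩,
   ⟨![Fil.h, Fil.h, Fil.one, Fil.one], ![Fil.one, Fil.one, Fil.one, Fil.pt], -18262070509693620694981565807404664112⟩,
   ⟨![Fil.pt, Fil.one, Fil.one, Fil.one], ![Fil.one, Fil.one, Fil.one, Fil.pt], 4003870894395884785374568917438986712⟩,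
   ⟨![Fil.one, Fil.h, Fil.one, Fil.pt], ![Fil.one, Fil.one, Fil.h, Fil.pt], 6246015169002871343412864461133686364⟩,
   ⟨![Fil.one, Fil.h, Fil.h, Fil.h], ![Fil.one, Fil.one, Fil.h, Fil.pt], 1429122709857792321952809583751465328⟩,
   ⟨![Fil.one, Fil.pt, Fil.one, Fil.h], ![Fil.one, Fil.one, Fil.h, Fil.pt], -25481833362692650404066980667091310460⟩,
   ⟨![Fil.one, Fil.pt, Fil.h, Fil.one], ![Fil.one, Fil.one, Fil.h, Fil.pt], 8967026829899938371097456411722324252⟩,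
   ⟨![Fil.h, Fil.one, Fil.pt, Fil.one], ![Fil.one, Fil.one, Fil.h, Fil.pt], 4893643111610499694963531661123576604⟩,
   ⟨![Fil.h, Fil.h, Fil.h, Fil.one], ![Fil.one, Fil.one, Fil.h, Fil.pt], 19113011913076526286127473753186015408⟩,
   ⟨![Fil.one, Fil.h, Fil.pt, Fil.h], ![Fil.one, Fil.one, Fil.pt, Fil.pt], 280465794868402429733793754796206572⟩,
   ⟨![Fil.one, Fil.pt, Fil.one, Fil.pt], ![Fil.one, Fil.one, Fil.pt, Fil.pt], 1844421358108341268360182895540577334⟩,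
   ⟨![Fil.one, Fil.pt, Fil.h, Fil.h], ![Fil.one, Fil.one, Fil.pt, Fil.pt], 6101090067707261505726328235573623194⟩,
   ⟨![Fil.h, Fil.one, Fil.pt, Fil.h], ![Fil.one, Fil.one, Fil.pt, Fil.pt], 5911967954062111178678034545992939140⟩,
   ⟨![Fil.h, Fil.h, Fil.one, Fil.pt], ![Fil.one, Fil.one, Fil.pt, Fil.pt], 4734338395828449545231675719880033604⟩,
   ⟨![Fil.h, Fil.h, Fil.h, Fil.h], ![Fil.one, Fil.one, Fil.pt, Fil.pt], -4636996228320009300533044530528227244⟩,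
   ⟨![Fil.h, Fil.h, Fil.pt, Fil.one], ![Fil.one, Fil.one, Fil.pt, Fil.pt], -11078096060866797442418651460708229212⟩,
   ⟨![Fil.h, Fil.pt, Fil.h, Fil.one], ![Fil.one, Fil.one, Fil.pt, Fil.pt], -1892399171757772201660916435836653408⟩,
   ⟨![Fil.pt, Fil.one, Fil.one, Fil.pt], ![Fil.one, Fil.one, Fil.pt, Fil.pt], -1485694393086740331654745319517879186⟩,
   ⟨![Fil.pt, Fil.one, Fil.h, Fil.h], ![Fil.one, Fil.one, Fil.pt, Fil.pt], -2993905765956019020000954572052001782⟩,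
   ⟨![Fil.pt, Fil.h, Fil.h, Fil.one], ![Fil.one, Fil.one, Fil.pt, Fil.pt], 801491146163553399644756679128961984⟩,
   ⟨![Fil.pt, Fil.pt, Fil.one, Fil.one], ![Fil.one, Fil.one, Fil.pt, Fil.pt], 346384305048843304499290638601148580⟩,
   ⟨![Fil.one, Fil.pt, Fil.h, Fil.pt], ![Fil.one, Fil.h, Fil.pt, Fil.pt], -609533522358231936114624034639802834⟩,
   ⟨![Fil.one, Fil.pt, Fil.pt, Fil.h], ![Fil.one, Fil.h, Fil.pt, Fil.pt], -696016437354468639641350311924036284⟩,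
   ⟨![Fil.h, Fil.one, Fil.pt, Fil.pt], ![Fil.one, Fil.h, Fil.pt, Fil.pt], -551508979484410621707112071432117796⟩,
   ⟨![Fil.h, Fil.h, Fil.h, Fil.pt], ![Fil.one, Fil.h, Fil.pt, Fil.pt], -357712234689338889156470759162005175⟩,
   ⟨![Fil.h, Fil.h, Fil.pt, Fil.h], ![Fil.one, Fil.h, Fil.pt, Fil.pt], 1050191232972989990915535511954170589⟩,
   ⟨![Fil.h, Fil.pt, Fil.one, Fil.pt], ![Fil.one, Fil.h, Fil.pt, Fil.pt], -420575982686005005778493808598724944⟩,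
   ⟨![Fil.h, Fil.pt, Fil.h, Fil.h], ![Fil.one, Fil.h, Fil.pt, Fil.pt], -154713925687202184409696169723840333⟩,
   ⟨![Fil.h, Fil.pt, Fil.pt, Fil.one], ![Fil.one, Fil.h, Fil.pt, Fil.pt], 521042849914178716051576648022845004⟩,
   ⟨![Fil.pt, Fil.one, Fil.h, Fil.pt], ![Fil.one, Fil.h, Fil.pt, Fil.pt], 123586272201765569858613153221899824⟩,
   ⟨![Fil.pt, Fil.one, Fil.pt, Fil.h], ![Fil.one, Fil.h, Fil.pt, Fil.pt], 81245767999443203832469757792630586⟩,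
   ⟨![Fil.pt, Fil.h, Fil.one, Fil.pt], ![Fil.one, Fil.h, Fil.pt, Fil.pt], 891840257332035913058576951218428366⟩,
   ⟨![Fil.pt, Fil.h, Fil.h, Fil.h], ![Fil.one, Fil.h, Fil.pt, Fil.pt], 677004017968658108125752398161773447⟩,
   ⟨![Fil.pt, Fil.h, Fil.pt, Fil.one], ![Fil.one, Fil.h, Fil.pt, Fil.pt], 124196944064366287253044397346081846⟩,
   ⟨![Fil.pt, Fil.pt, Fil.one, Fil.h], ![Fil.one, Fil.h, Fil.pt, Fil.pt], -798480685297956092332643707368916968⟩,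
   ⟨![Fil.pt, Fil.pt, Fil.h, Fil.one], ![Fil.one, Fil.h, Fil.pt, Fil.pt], 624749649188636560659677008948508772⟩,
   ⟨![Fil.h, Fil.h, Fil.pt, Fil.pt], ![Fil.one, Fil.pt, Fil.pt, Fil.pt], 58544728243517972102217371259090911⟩,
   ⟨![Fil.h, Fil.pt, Fil.h, Fil.pt], ![Fil.one, Fil.pt, Fil.pt, Fil.pt], 83422988136700221919243489217108501⟩,
   ⟨![Fil.h, Fil.pt, Fil.pt, Fil.h], ![Fil.one, Fil.pt, Fil.pt, Fil.pt], 64669148565467486830258186843692665⟩,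
   ⟨![Fil.pt, Fil.one, Fil.pt, Fil.pt], ![Fil.one, Fil.pt, Fil.pt, Fil.pt], 6601988532344726304944048827113357⟩,
   ⟨![Fil.pt, Fil.h, Fil.h, Fil.pt], ![Fil.one, Fil.pt, Fil.pt, Fil.pt], -216805829795524821603458228252996219⟩,
   ⟨![Fil.pt, Fil.h, Fil.pt, Fil.h], ![Fil.one, Fil.pt, Fil.pt, Fil.pt], -69043571894270441670437783021868563⟩,
   ⟨![Fil.pt, Fil.pt, Fil.one, Fil.pt], ![Fil.one, Fil.pt, Fil.pt, Fil.pt], -12123140891576861825936187070293192⟩,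
   ⟨![Fil.pt, Fil.pt, Fil.h, Fil.h], ![Fil.one, Fil.pt, Fil.pt, Fil.pt], 4519577610509831993364756124747429⟩,
   ⟨![Fil.pt, Fil.pt, Fil.pt, Fil.one], ![Fil.one, Fil.pt, Fil.pt, Fil.pt], -32704013662962420234860555135775882⟩,
   ⟨![Fil.pt, Fil.h, Fil.pt, Fil.pt], ![Fil.h, Fil.pt, Fil.pt, Fil.pt], 13182584600968773952214909197583197⟩,
   ⟨![Fil.pt, Fil.pt, Fil.h, Fil.pt], ![Fil.h, Fil.pt, Fil.pt, Fil.pt], 14830485181029274728162750632930428⟩,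
   ⟨![Fil.pt, Fil.pt, Fil.pt, Fil.h], ![Fil.h, Fil.pt, Fil.pt, Fil.pt], -7749836039502246425947627363833002⟩]

def efa4273a5 : EFACert := ⟨199, efa4273a5S, Side.P, ![⟨0, 3, 3⟩, ⟨0, 3, 3⟩, ⟨0, 3, 3⟩, ⟨2, 2, 2⟩], efa4273a5Rows, 266293095111393320972686294280676096⟩


/-- the kernel re-checks anomaly's exact dual: 216 ordered columns × 50 rows, 36–39-digit integers -/
theorem efa4273a5_valid : validEFA efa4273a5 = true := by decide +kernel

/-- **4273's L1-terminal support cannot carry an anchored (A1)-clean design of ≤ 199 copies** (anchor: a P-cell of ordered type m³b as listed). -/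
theorem efa4273a5_kills (D : Design) (h1 : D.A1) (hB : D.copies ≤ 199) (hS : SuppIn D efa4273a5S)
    (hp : OPresent D Side.P ![⟨0, 3, 3⟩, ⟨0, 3, 3⟩, ⟨0, 3, 3⟩, ⟨2, 2, 2⟩]) : False :=
  efa_sound efa4273a5 efa4273a5_valid D h1 hB hS hp

end EFA4273

end Summit.HodgeConjecture.HodgeConjecture.Cruxes.BlochSeedDiscOne.BnCCertCover
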